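import Summits.HodgeConjecture.HodgeConjecture.Cruxes.BlochSeedDiscOne.FloorPinTower

/-!
# XForkServer — fifth workfile of the `h`-uniform ABSENT families of ◇_h (`h = 2μ`): THE FLOOR-PINNED BLOCK `{c·ℓ_φ, B, Y, X}` — one floor
# letter `c·ℓ_φ` (`0 ≤ c ≤ μ`), one CEILING letter `Y`, ANY `B`, ANY `X ≠ O` — ABSENT AT BOTH LEVELS (T8 with `B` a boundary letter, §1 – §4;
# T9 every `B`, §5), THE `FL` DOUBLE PIN `{μ·ℓ_φ, B, Z ≠ O, X ≠ O}` (T10, §6), AND THE ORIGIN SUB-APEX BLOCK `{O, B, A = (h−2)·I, X ≠ O}`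
# (T11, §7: the sub-apex as a PSEUDO-PIN and the X⁺ fork with TYPED ESCAPES; §8 T12 = the block over a charged floor letter, CONDITIONAL on
# the raised-floor escape rows), by the pin moves of RULE D, the A2I⁻ origin interface and the X⁺ FORK with DESCENT (control lens g23, v0.1 – v0.5); §9 (g24, v0.6) = the
# `h`-uniform SERVER LEMMAS for the floor-free rows: the CEILING-UNIT COUSIN EXCLUSION (X⁺) and the GENERAL OWN-RAY A2I⁻ INTERFACE

STATUS: HC ∕ HC_CM ∕ HC_AV ∕ H2 = `BlochSeedDiscOne` (stmt-18881) ∕ (T_h) ∕ KAbsent_h are NOT proved here or anywhere; HC_CM is a displayed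
binder of the route only.  This file is KERNEL ARITHMETIC on the typed first-order encoder model of `Summits/Ventures/HSemireg/Pad4Tower*.lean`
under EXACTLY the hypotheses `C.InDiamond h`, RULE D on both levels `RuleDMu4N ∕ RuleDMu4P`, X⁺ `XPlusClosed`, A2I⁻ `A2IMinusClosed`, `S₄` on
both levels `PermClosed`, `h = 2μ`, `μ ≥ 1` (no `Δ`), census-neutral: the family is checked against the gs-eng-2 g54 j318002 peel tables
(◇₈ a459e02921a60310 ∕ ◇₁₀ 74004db439790926) to have 0 SURVIVORS at `h ∈ {4, 6, 8, 10}`; the block legitimately reaches peel round 19 at ◇₁₀.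

WHY A FIFTH FILE, AND NO §0. `FloorPinTower.lean` v0.6 (767a50eb475fa469, 199 340 B) is at the cap; since the hub build of 15:33Z (director-hodge
g32 R19.851) it IS importable on the farm, so this file IMPORTS it (namespace `…FloorPinTower` opened) instead of restating leaves: what §1 – §4
use from it (credited there and in its own §0 to `CeilingTower.lean` v0.5 and g18 – g21) are the RULE-D service lemmas `servedBelow_floor_apex ∕
_dir`, `servedAbove_ceiling_apex`, `upLine_ceilLetter'`, the origin pin `originPin_lower_step` with the A2I⁻ interface
`a2i_origin_floor_interface`, the frames `exists_frame_ne_zero ∕ _ne_h`, the letters `floorLetter ∕ ceilLetter` with their coordinate facts, the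
`S₄` re-readings `perm23_lower ∕ perm12_lower ∕ perm12_upper` (v0.1 of this file, crux commit 7fbbe4a44b04, restated those 29 declarations
verbatim in a §0; v0.2 is v0.1 with the §0 replaced by the import — §1 – §4 unchanged; v0.3 adds §5 – §6, v0.4 §7, v0.5 §8).  Booking: director-hodge g32 R19.834 (bus l.13216) «fifth
self-standing workfile `XForkServer.lean` … filed ONLY with a kernel-checked §1, … officer plate per version».  Memo `XFORK-SERVER-g23.md`
(architecture, the fork-descent argument, every census digit, coverage, NEXT).

THE MOVES — roles attach to SLOTS `{F, B, Y, X}` and `X` is served only at level `N`.  (N) `N{F, B, Y, X}`, `X ≠ O`: the floor letter `F`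
has the `X`-slot served BELOW (RULE D at `N`, `servedBelow_floor_dir`): child `P{F, B, Y, X′}`, `X′` strictly lower; for `F = O` the origin pin
`originPin_lower_step'` + A2I⁻: `X′` strictly lower, or `X′ = X` when `X` is on the floor; an `X′ = O` child is re-read `P{O, B, Y, F}`.
(P) `P{F, B, Y, X}`: the ceiling letter pins and the boundary letter is raised toward the apex (`servedAbove_ceiling_apex`,
`upLine_ceilLetter'`): child `N{F, B′, Y, X}` of smaller depth `(h − B.1) + (h − Y.1)`, down to the corner `P{F, hI, hI, X}`.  (C) corner,
`X ∉ {O, hI}`: raise `X` (`exists_frame_ne_h`), child `N{F, hI, hI, X↑}`; `X = hI`, `c < μ`: raise `F`.  (A) `N{F, hI, hI, X}`: the X⁺ FORK —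
two `P`-partners `P{F, hI, y, X}` of the apex slot in different directions (RULE D at `N`; `xplus_two_children_gen`), absurd once the
sibling rows `N{F, hI, y′, X}` are absent (`doubleApexN_absent`); for `F = O`, where at a floor `X` the sibling rows and their `P`-companions
need each other, FORK DESCENT (`originApex_forkDescent` on the sharp fork `xplus_fork`): a between-sibling has, by the origin pin, its
companion `P{O, hI, y′, X}` present = a CLOSER partner in the same direction; induction on the two partners' total depth.

§1 (T8a) `bdryBlockP ∕ N_of_cornerFree`: the block at both levels from the corners `CornerFree C h μ q φ c′`, `c′ ≤ c` (ℕ-induction `bdry_aux`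
on the depth, both levels and all `c ≥ 0` at once; flag `q` = also exclude `X = hI`).  §2 (T8b) `cornerFree_of_sibFree`: corners from the
sibling rows `SibFree` by (C)+(A); `bdryBlockP ∕ N_of_sibFree`.  §3 (T8c ∕ T8d) the origin rows `{O, hI, y(w,K), X}` for EVERY `X ≠ O` by
induction on the height of `X` (`originApex_aux`: fork descent at the double apex, then the inner induction on `K`); `OriginApexFloorRowFree`
(the rows `N{O, hI, hI, d·ℓ}`, ◇₁₀ peel rounds 9 – 14, the residual hypothesis of the pre-release draft) is PROVED, `originApexFloorRowFree_holds`;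
the origin corners `originCornerFree`, the origin block `originBlockP ∕ N_absent` `{O, B, Y, X}`, `X ∉ {O, hI}` (T8d).  §4 (T8e ∕ T8) the rows
`{F, hI, y, X}` over a charged floor `F` (`floorApex_aux`; children strictly lower in `X`, the `X′ = O` child is §3), hence `sibFree_holds`,
`cornerFree_holds`, and THE BLOCK `bdryBlockP_absent`: `P{c·ℓ_φ, B, Y, X} ∉ C.upper` for `0 ≤ c ≤ μ`, `IsBdry B`, `IsCeil Y`, `X ≠ O`,
`c = μ → X ≠ hI`; `bdryBlockN_absent`: `N{c·ℓ_φ, B, Y, X} ∉ C.lower`, no proviso (`P{FL, hI, hI, hI}` and the `{O, O, ·, ·}` cells outside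
the family ARE present in the census worlds).  Letter corollaries `floorFloorCeilP ∕ N_absent` `{c·ℓ, c′·ℓ, y(K), X}`, `floorCeilCeilP ∕ N_absent`
`{c·ℓ, y(K′), y(K), X}`, `originFloorCeil* ∕ originCeilCeil*`, `originApexRowN ∕ P_absent`, `floorApexRowN ∕ P_absent`.
CENSUS `tools/famAC.py 4 6 8 10` (family T8, both levels): members ◇₄ 1 385 ∕ ◇₆ 10 955 ∕ ◇₈ 49 089 ∕ ◇₁₀ 157 091, 0 SURVIVORS at every `h`;
beyond the g18 – g23 files (NEW) ◇₆ 6 791 ∕ ◇₈ 34 933 (N 17 929 + P 17 004, rounds 1 – 12) ∕ ◇₁₀ 124 555 (N 62 843 + P 61 712, rounds 1 – 19).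
§5 (T9, v0.3) `blockP ∕ N_absent`: the P-move needs nothing of `B` but `B ≠ hI` (`exists_frame_ne_h` + `servedAbove_ceiling_apex` under the
pin `Y`; `B = hI` lets `Y` climb or is the corner), so the §1 induction runs with `B` an ARBITRARY point of ◇_h (`blk_aux`): `{c·ℓ_φ, B, Y, X} ∉ E_±`
for `0 ≤ c ≤ μ`, every `B`, `IsCeil Y`, `X ≠ O` (`P`: `c = μ → X ≠ hI`); letters `floorAnyCeilP ∕ N_absent`, `originAnyCeilP ∕ N_absent`.  Census
`tools/famAD.py` (T9 ⊇ T8): members ◇₄ 1 425 ∕ ◇₆ 12 677 ∕ ◇₈ 66 093 ∕ ◇₁₀ 245 439, 0 SURVIVORS; NEW beyond T8 ◇₈ 6 014 ∕ ◇₁₀ 50 530 (N 28 643 +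
P 21 887, rounds 2 – 16).  §6 (T10, v0.3) `flPinP ∕ N_absent`: `FL_φ = μ·ℓ_φ = y(φ, μ−1)` is a floor pin at level `N` AND a ceiling pin at level
`P` at the same slot, so the engine runs with no other boundary letter (`fl_aux`; the `X′ = O` child is the T9 origin instance `{O, B, FL_φ, Z}`):
`{μ·ℓ_φ, B, Z, X} ∉ E_±` for every `B`, `Z ≠ O`, `X ≠ O` (`P`: `X ≠ hI`).  Census `tools/famAE.py`: members ◇₄ 1 012 ∕ ◇₆ 6 924 ∕ ◇₈ 29 360 ∕
◇₁₀ 93 650, 0 SURVIVORS; NEW beyond T9 ◇₆ 46 ∕ ◇₈ 1 076 ∕ ◇₁₀ 7 524 (N 3 954 + P 3 570, rounds 2 – 15).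
§7 (T11, v0.4) `originSubapexN_absent ∕ originSubapexP_absent`: the sub-apex `A = (h−2)·I` is a PSEUDO-PIN at level `P` (its only
null-above letters are the `cu_r`, so every RULE-D alternative through the `A`-slot is a T9 cell: `servedAbove_subapex_pin`), and the double
sub-apex `N{O, A, A, X}` falls to the X⁺ fork with the free slot holding `A` — `xplus_fork_esc`, the typed clause with BOTH free-slot
conditions (`W_f = ∅`, (H-b)) non-vacuous and their escape cells handed back as hypotheses: every escape carries a `cu` over a floor letter
(a cover through the floor slot raises `O` to `e·ℓ_ψ` — `exists_eq_floorLetter_of_nullBelow_origin`; only the HEIGHT of the raised letters is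
used, so Pythagorean null directions are covered) = T9; (H-e′) breakers off the causal past of `A` are ceiling letters = T9; between-siblings
become closer partners by the origin pin + A2I⁻ (`originSubapex_forkDescent`).  RESULT (`μ ≥ 2`): `N{O, B, A, X} ∉ C.lower` for EVERY `B`,
`X ≠ O`; `P{O, B, A, X} ∉ C.upper` for `X ≠ O` unless `B = X = A` (`P{O, A, A, A}` IS present); outer induction on the height of `X`
(`originSubapex_aux`), inner on the depth of `B` (`originSubapex_atX`).  Census `tools/famAF.py 4 6 8 10`: members ◇₄ 69 ∕ ◇₆ 221 ∕ ◇₈ 547 ∕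
◇₁₀ 1 149, 0 SURVIVORS; NEW beyond T9 ∕ T10 ◇₄ 13 ∕ ◇₆ 69 ∕ ◇₈ 221 (N 111 + P 110, rounds 3 – 9) ∕ ◇₁₀ 547 (N 274 + P 273, rounds 4 – 18; 329 of
them at rounds 14 – 18 — the first typed family in the deepest peel rounds).
§8 (T12 CONDITIONAL, v0.5) `floorSubapexN_absent ∕ floorSubapexP_absent`: the same block over a CHARGED floor letter, `{c·ℓ_φ, B, A, X}`,
`1 ≤ c ≤ μ − 1` (every `B`, `X ≠ O`; `P`: not `B = X = A`), from the hypothesis `SubapexEscapeFree C h μ` = the RAISED-FLOOR ESCAPE ROWS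
`N{F′, σ, cu, X}` are absent (`F′` non-floor null-above `c·ℓ_φ`).  Over `c ≥ 1` the argument is otherwise EASIER than §7 (the floor pin
serves `X` strictly below: no companion, no descent, no inner induction; the `X′ = O` child is a T11 row); the (r2a) cover of the fork head
through the floor slot is the ONLY escape no file types.  What it buys (`tools/famAF.py --full`): beyond T11 ◇₄ 18 ∕ ◇₆ 256 ∕ ◇₈ 1 496 ∕
◇₁₀ 5 576 cells (peel rounds up to 23); what it costs (`tools/rfrows.py 6 8 10`): the raised-floor rows, ◇₆ 1 582 ∕ ◇₈ 7 276 ∕ ◇₁₀ 23 082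
orbits, ALL census-absent, ◇₆ 314 ∕ ◇₈ 2 228 ∕ ◇₁₀ 8 962 of them untyped (peel rounds up to 24 — the deepest cells of ◇₁₀).  NOT counted in
the coverage below (conditional).
COVERAGE (`tools/cover.py 6 8 10`, cumulative over the five files; FloorPinTower v0.6 → XForkServer v0.2 (T8) → v0.3 (T9 + T10) → v0.4 (T11)):
round-2 orbits typed ◇₁₀ 89.3 % → 96.4 % → 99.7 % (23 784 ∕ 23 861) → same, ◇₈ 87.5 % → 97.1 % → 99.5 % (12 683 ∕ 12 744), ◇₆ 71.7 % → 97.8 % →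
100 % (4 463 ∕ 4 463); peel round ≥ 3 typed ◇₁₀ 46 418 → 169 177 → 226 458 → 227 005 (of 405 493), ◇₈ 12 109 → 45 762 → 52 541 → 52 762 (of
82 542), ◇₆ 7 111 → 7 180 (of 10 149); ALL absent orbits typed ◇₁₀ 16.4 % → 45.2 % → 58.6 % → 58.7 % (254 146 ∕ 432 711), ◇₈ 26.1 % → 61.9 % →
69.2 % → 69.4 % (67 700 ∕ 97 541), ◇₆ 35.8 % → 78.7 % → 80.8 % → 81.3 % (12 873 ∕ 15 842), ◇₄ 92.3 % (1 447 ∕ 1 567); 0 typed survivors.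
(◇₁₀ history: CeilingTower v0.1 6.2 → 9.6 → 13.9 → 14.5 → 15.8 → FloorPinTower v0.6 16.4 → XForkServer v0.2 45.2 → v0.3 58.6 → v0.4 58.7 %.)
§9 (SERVER LEMMAS, v0.6, control g24) `ceilingUnit_cousinsP_absent ∕ _absent'` (= g19's SECOND-CHILD THEOREM `apexCeilingUnit_absent_of_secondChild`
in two-present-cells form, NOT new: two present `P`-cells agreeing off a slot `g` with ceiling units of different phases there and `hI` at another
slot are contradictory), `ceilingUnit_cousinsP_esc` (new: the same with a GENERAL letter at the free slot, its three null-above X⁺ escapes handed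
back: `lift_of_ceilingUnit` + `xplus_fork_esc`), `a2i_ownray_esc ∕ a2i_ownray_witness` (the A2I⁻ clause at a head whose interior
letter `aI + c·ℓ_u` is lowered along its OWN ray by `d ≤ c`: the five escape species handed back), apex geometry `effective_apex_bsub ∕
not_nullBelow_apex ∕ encDir_ray_apex`.  These (g19's fork and the new A2I⁻ interface) are the two non-RULE-D servers of the census kills of the floor-free rows (memo XFORK-SERVER-g24.md
§2: of 850 decoded ◇₈ kills of hI-free floor-free cells the DAGs carry 900 X⁺ and 145 A2I⁻ clause nodes beside 2 898 RULE-D nodes, and use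
1 364 hI-cells).  THE hI-FREE CEILING LAW (memo §2b, `scratch/uprime.py`, census-EXACT): every cell with no floor letter, no `hI`, at least one
ceiling letter and at least one non-ceiling letter, other than the `N`-node-blocks `{aI, aI, aI, aI + c·ℓ}`, is ABSENT — ◇₄ 17 ∕ ◇₆ 970 ∕
◇₈ 11 523 ∕ ◇₁₀ 71 596 orbits, ZERO present; it contains every untyped hI-free raised-floor row of §8 and is the g25 target (T14); it is NOT
provable by RULE-D pin moves alone (its `P`-children enter the all-ceiling ∕ `hI` corner, whose census status is `h`-dependent:
`P{cu_a⁴}` present in ◇₈, `N{cu_{−1}⁴}` in ◇₁₀) — the §9 servers are what cuts that corner.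
NEXT (memo XFORK-SERVER-g23 §5 – §6, XFORK-SERVER-g24 §3).  `SubapexEscapeFree` (§8) IS the g24 → g25 item, typed and kernel-linked to its payoff; NOT closed.  THE PIN ENGINE IS EXHAUSTED (a below-pin is exactly a floor letter, an above-pin exactly a ceiling letter, T9 + T10 type
every cell carrying both; the pure RULE-D hull of the typed base is a FIXPOINT: `tools/dhull.py` ◇₈ +1 186, ◇₁₀ +127), and §7 is the template
for what replaces it: PSEUDO-PINS (letters whose up-servers are typed) + the FORK WITH TYPED ESCAPES.  The one obstruction between §7 and the
full sub-apex block `{c·ℓ_φ, B, A, X}` (◇₈ 1 717 ∕ ◇₁₀ ≈ 5 000 new; sole census survivor `P{(μ−1)·ℓ, A, A, A}`) — and behind it the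
`σ_d`-pseudo-pin tower `{O, B, σ_d(u), X}` by induction on `d` (`σ_d ↑ ∈ {σ_{d′<d}, A, cu_{u+2}, y(u,d)}`) — is ONE escape shape: the cover of
the fork head through the FLOOR slot raises `c·ℓ_φ` (`c ≥ 1`) off the floor, to `2e·I + (c−e)·ℓ_φ` or `2c·I + (e−c)·ℓ_{φ+2}`, giving the
floor-free rows `N{2eI + (c−e)ℓ_φ, σ_d(w), cu_r, X}` — census-absent (◇₈: 2 236 floor-free `N`-cells with a `cu` and a `σ`, 0 survivors;
peel rounds 7 – 8) but untyped: g24 START-HERE (memo §6: the escape shape, decoded kill DAGs).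
-/

set_option linter.dupNamespace false
set_option linter.unusedSimpArgs false

namespace Summit.HodgeConjecture.HodgeConjecture.Cruxes.BlochSeedDiscOne.XForkServer

open Finset Summit.Ventures.HSemireg.Pad4Tower
open Summit.HodgeConjecture.HodgeConjecture.Cruxes.BlochSeedDiscOne.DiamondLevelLaws
open Summit.HodgeConjecture.HodgeConjecture.Cruxes.BlochSeedDiscOne.FloorPinTower



/-! ## §1 T8a — THE BOUNDARY BLOCK `{c·ℓ_φ, B, Y, X}` REDUCES TO ITS DOUBLE-APEX CORNERS `P{c·ℓ_φ, hI, hI, X}` (RULE D both levels, A2I⁻, `S₄`)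

Slots: `0` = the FLOOR PIN `F = c·ℓ_φ` (`0 ≤ c ≤ μ`; never moves), `1` = a BOUNDARY letter `B` (a floor letter `c′·ℓ_u`, `0 ≤ c′ ≤ μ − 1`, or a
ceiling-line letter `y(u, K′)`, `−1 ≤ K′ ≤ μ − 1`, so `O`, `FL_u = y(u, μ−1)` and `hI = y(u, −1)` included), `2` = a CEILING letter
`Y = y(w, K)`, `−1 ≤ K ≤ μ − 1`, `3` = `X ≠ O` ARBITRARY.  Measure `M = (h − ht B) + (h − ht Y)`.  Level `P`: the ceiling pin `Y` raises `B`
along the boundary (`O ↦ e·ℓ_r`, `c′·ℓ_u ↦ (c′+e)·ℓ_u`, `y(u, K′) ↦ y(u, K′−e)`), or — once `B = hI` — the pin `B` raises `Y` inward; `M` drops.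
Level `N`: the floor pin serves `X` BELOW (`X′ ≠ O`: same `M`, level `P`; `X′ = O`: the child `{F, B, Y, O}` is the origin instance
`{O, B, Y, F}`; for `F = O` the origin pin + A2I⁻ `originPin_lower_step` never produces `X′ = O`).  The one leaf the pin moves cannot reach is the
DOUBLE-APEX CORNER `P{F, hI, hI, X}` (`M = 0`), carried as the hypothesis `CornerFree` (§2 reduces it to the apex–ceiling sibling rows by the
X⁺ fork). -/

/-- a BOUNDARY letter of ◇_{2μ} at slot `1`: `c′·ℓ_u` with `0 ≤ c′ ≤ μ − 1` (`c′ = 0`: `O`) or `y(u, K′) = ceilLetter h u K′` with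
`−1 ≤ K′ ≤ μ − 1` (`K′ = −1`: `hI`; `K′ = 0`: `cu_u`; `K′ = μ − 1`: `FL_u`). -/
def IsBdry (h μ : ℤ) (x : BPoint) : Prop :=
  (∃ u : Fin 4, ∃ c' : ℤ, 0 ≤ c' ∧ c' ≤ μ - 1 ∧ x = floorLetter u c') ∨ ∃ u : Fin 4, ∃ K' : ℤ, -1 ≤ K' ∧ K' ≤ μ - 1 ∧ x = ceilLetter h u K'

/-- a CEILING letter of ◇_{2μ} at slot `2`: `y(w, K)`, `−1 ≤ K ≤ μ − 1` (`hI`, `cu_w`, …, `FL_w`). -/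
def IsCeil (h μ : ℤ) (x : BPoint) : Prop := ∃ w : Fin 4, ∃ K : ℤ, -1 ≤ K ∧ K ≤ μ - 1 ∧ x = ceilLetter h w K

/-- **the double-apex corner over `c·ℓ_φ` is FREE**: no `P{c·ℓ_φ, hI, hI, X} ∈ C.upper` with `X ≠ O` (and `X ≠ hI` when `c = μ`:
`P{FL, hI, hI, hI}` IS present in the census worlds; with `q` true: `X ≠ hI` throughout — the variant the origin block §3 uses). -/
def CornerFree (C : MConfig) (h μ : ℤ) (q : Prop) (φ : Fin 4) (c : ℤ) : Prop :=
  ∀ P ∈ C.upper, P 0 = floorLetter φ c → P 1 = (h, 0, 0) → P 2 = (h, 0, 0) → P 3 ≠ (0, 0, 0) → (c = μ ∨ q → P 3 ≠ (h, 0, 0)) → False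

theorem isBdry_floorLetter {h μ c' : ℤ} (u : Fin 4) (hc0 : 0 ≤ c') (hc : c' ≤ μ - 1) : IsBdry h μ (floorLetter u c') :=
  Or.inl ⟨u, c', hc0, hc, rfl⟩

theorem isBdry_ceilLetter {h μ K' : ℤ} (u : Fin 4) (hK1 : -1 ≤ K') (hK : K' ≤ μ - 1) : IsBdry h μ (ceilLetter h u K') :=
  Or.inr ⟨u, K', hK1, hK, rfl⟩

theorem isBdry_origin {h μ : ℤ} (hμ : 1 ≤ μ) : IsBdry h μ (0, 0, 0) :=
  Or.inl ⟨0, 0, le_rfl, by omega, (ray_zero _ 0).symm⟩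

theorem isBdry_apex {h μ : ℤ} (hμ : 0 ≤ μ) : IsBdry h μ (h, 0, 0) :=
  Or.inr ⟨0, -1, le_rfl, by omega, (ceilLetter_neg_one h 0).symm⟩

/-- `FL_u = μ·ℓ_u` is a boundary letter (as `y(u, μ − 1)`). -/
theorem isBdry_floorLetter_mu {h μ : ℤ} (hh : h = 2 * μ) (hμ : 0 ≤ μ) (u : Fin 4) : IsBdry h μ (floorLetter u μ) :=
  Or.inr ⟨u, μ - 1, by omega, le_rfl, floorLetter_mu_eq_ceilLetter hh u⟩

theorem isCeil_ceilLetter {h μ K : ℤ} (w : Fin 4) (hK1 : -1 ≤ K) (hK : K ≤ μ - 1) : IsCeil h μ (ceilLetter h w K) := ⟨w, K, hK1, hK, rfl⟩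

theorem isCeil_apex {h μ : ℤ} (hμ : 0 ≤ μ) : IsCeil h μ (h, 0, 0) := ⟨0, -1, le_rfl, by omega, (ceilLetter_neg_one h 0).symm⟩

theorem isCeil_floorLetter_mu {h μ : ℤ} (hh : h = 2 * μ) (hμ : 0 ≤ μ) (u : Fin 4) : IsCeil h μ (floorLetter u μ) :=
  ⟨u, μ - 1, by omega, le_rfl, floorLetter_mu_eq_ceilLetter hh u⟩

/-- `S₄` on E₊, the transposition of slots `2` and `3`. -/
theorem perm23_upper {C : MConfig} (hGu : PermClosed C.upper) {P : MCell} (hP : P ∈ C.upper) :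
    P.perm (Equiv.swap (2 : Fin 4) 3) ∈ C.upper ∧ P.perm (Equiv.swap (2 : Fin 4) 3) 0 = P 0 ∧ P.perm (Equiv.swap (2 : Fin 4) 3) 1 = P 1 ∧
      P.perm (Equiv.swap (2 : Fin 4) 3) 2 = P 3 ∧ P.perm (Equiv.swap (2 : Fin 4) 3) 3 = P 2 :=
  ⟨hGu _ P hP, by show P (Equiv.swap (2 : Fin 4) 3 0) = _; simp [Equiv.swap_apply_of_ne_of_ne],
    by show P (Equiv.swap (2 : Fin 4) 3 1) = _; simp [Equiv.swap_apply_of_ne_of_ne],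
    by show P (Equiv.swap (2 : Fin 4) 3 2) = _; rw [Equiv.swap_apply_left],
    by show P (Equiv.swap (2 : Fin 4) 3 3) = _; rw [Equiv.swap_apply_right]⟩

/-- `S₄` on E₊, the transposition of slots `0` and `3`. -/
theorem perm03_upper {C : MConfig} (hGu : PermClosed C.upper) {P : MCell} (hP : P ∈ C.upper) :
    P.perm (Equiv.swap (0 : Fin 4) 3) ∈ C.upper ∧ P.perm (Equiv.swap (0 : Fin 4) 3) 0 = P 3 ∧ P.perm (Equiv.swap (0 : Fin 4) 3) 1 = P 1 ∧
      P.perm (Equiv.swap (0 : Fin 4) 3) 2 = P 2 ∧ P.perm (Equiv.swap (0 : Fin 4) 3) 3 = P 0 :=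
  ⟨hGu _ P hP, by show P (Equiv.swap (0 : Fin 4) 3 0) = _; rw [Equiv.swap_apply_left],
    by show P (Equiv.swap (0 : Fin 4) 3 1) = _; simp [Equiv.swap_apply_of_ne_of_ne],
    by show P (Equiv.swap (0 : Fin 4) 3 2) = _; simp [Equiv.swap_apply_of_ne_of_ne],
    by show P (Equiv.swap (0 : Fin 4) 3 3) = _; rw [Equiv.swap_apply_right]⟩

/-- `originPin_lower_step` (§0) with its hypothesis restricted to the cells the proof actually meets: the `E₊` cells agreeing with `N`
at slots `0, 1, 3` whose slot-`2` letter is STRICTLY LOWER than `N 2`, or equal to it when `N 2` is on the floor (the A2I⁻ swapped copy). -/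
theorem originPin_lower_step' {h : ℤ} {C : MConfig} (hU : C.InDiamond h) (hDN : ∀ Z ∈ C.lower, RuleDMu4N C Z) (hA : A2IMinusClosed C)
    (hGl : PermClosed C.lower) (hGu : PermClosed C.upper) {N : MCell} (hN : N ∈ C.lower) (h0 : N 0 = (0, 0, 0)) (h2 : N 2 ≠ (0, 0, 0))
    (hP : ∀ P ∈ C.upper, P 0 = (0, 0, 0) → P 1 = N 1 → P 3 = N 3 → ((P 2).1 < (N 2).1 ∨ (P 2 = N 2 ∧ OnFloor (N 2))) →
      P 2 = (0, 0, 0)) : False := by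
  obtain ⟨k, hk, hk0⟩ := exists_frame_ne_zero (hU.1 N hN 2).1 h2
  have hfl : OnFloor (N 0) := by rw [h0]; simp [OnFloor, absCharge, chargeOf]
  obtain ⟨r, P, hPu, hNP⟩ := servedBelow_floor_apex hU hN (hDN N hN) (i := 0) (g := 2) (by decide) hfl hk hk0
  have hP0 : P 0 = (0, 0, 0) := (hNP.1 0 (by decide)).trans h0
  have hW' : P 2 = (0, 0, 0) := hP P hPu hP0 (hNP.1 1 (by decide)) (hNP.1 3 (by decide)) (Or.inl hNP.2.1)
  obtain ⟨d, hdd⟩ : ∃ d, d = (N 2).1 - (P 2).1 := ⟨_, rfl⟩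
  have hd : 1 ≤ d := by have := hNP.2.1; omega
  have hN2 : N 2 = floorLetter r d := by have e := hNP.2.2; rw [← hdd, hW'] at e; exact e
  have hN2f : (N 2).1 = d := by rw [hN2, floorLetter_fst]
  have hflN2 : OnFloor (N 2) := by rw [hN2]; exact onFloor_floorLetter r (by omega)
  obtain ⟨P', hP', c', hc1, hc'd, hagree, hP'0, hP'2⟩ := a2i_origin_floor_interface hU hA hGl hN (a := 0) (b := 2) (by decide) h0 hN2 hd
    hPu hNP.1 hW' (fun Q hQ hNQ => by
      rw [hP Q hQ ((hNQ.1 0 (by decide)).trans h0) (hNQ.1 1 (by decide)) (hNQ.1 3 (by decide)) (Or.inl hNQ.2.1)])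
  have e2 : P'.perm (Equiv.swap (0 : Fin 4) 2) 2 = floorLetter r c' := by show P' (Equiv.swap (0 : Fin 4) 2 2) = _; simpa using hP'0
  have hle : (P'.perm (Equiv.swap (0 : Fin 4) 2) 2).1 < (N 2).1 ∨ (P'.perm (Equiv.swap (0 : Fin 4) 2) 2 = N 2 ∧ OnFloor (N 2)) := by
    rcases (show c' < d ∨ c' = d by omega) with hlt | heq
    · left; rw [e2, floorLetter_fst]; omega
    · exact Or.inr ⟨by rw [e2, heq, hN2], hflN2⟩
  have e := hP _ (hGu (Equiv.swap 0 2) P' hP') (by show P' (Equiv.swap (0 : Fin 4) 2 0) = _; simpa using hP'2)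
    (by show P' (Equiv.swap (0 : Fin 4) 2 1) = _; simpa [Equiv.swap_apply_of_ne_of_ne] using hagree 1 (by decide) (by decide))
    (by show P' (Equiv.swap (0 : Fin 4) 2 3) = _; simpa [Equiv.swap_apply_of_ne_of_ne] using hagree 3 (by decide) (by decide)) hle
  have e' : floorLetter r c' = (0, 0, 0) := e2.symm.trans e
  have := congrArg Prod.fst e'
  rw [floorLetter_fst] at this
  simp at this; omega

/-! ### §1a the two pin moves -/

/-- **P-STEP** (RULE D on E₊): `P{c·ℓ_φ, B, Y, X}` (`X ≠ O`; `X ≠ hI` if `c = μ`) is absent provided every `N{c·ℓ_φ, B′, Y′, X}` of SMALLER measure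
is (`ihN`) and the corner over `c·ℓ_φ` is free: the ceiling pin `Y` raises `B` along the boundary, or the pin `B = hI` raises `Y` inward. -/
theorem bdry_stepP {h μ : ℤ} {C : MConfig} (hU : C.InDiamond h) (hDP : ∀ P ∈ C.upper, RuleDMu4P C P) (hh : h = 2 * μ) (hμ : 1 ≤ μ)
    {q : Prop} {φ : Fin 4} {c : ℤ} (hC : CornerFree C h μ q φ c) {m : ℤ}
    (ihN : ∀ N ∈ C.lower, N 0 = floorLetter φ c → IsBdry h μ (N 1) → IsCeil h μ (N 2) → N 3 ≠ (0, 0, 0) →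
      (h - (N 1).1) + (h - (N 2).1) < m → False)
    {P : MCell} (hP : P ∈ C.upper) (h0 : P 0 = floorLetter φ c) (hB : IsBdry h μ (P 1)) (hY : IsCeil h μ (P 2)) (h3 : P 3 ≠ (0, 0, 0))
    (h3h : c = μ ∨ q → P 3 ≠ (h, 0, 0)) (hM : (h - (P 1).1) + (h - (P 2).1) ≤ m) : False := by
  obtain ⟨w, K, hK1, hKμ, h2⟩ := hY
  have hgc2 : OnCeiling h (P 2) := by rw [h2]; exact onCeiling_ceilLetter h w (by omega)
  have hP2f : (P 2).1 = h - 1 - K := by rw [h2, ceilLetter_fst]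
  rcases hB with ⟨u, c', hc'0, hc'μ, h1⟩ | ⟨u, K', hK'1, hK'μ, h1⟩
  · -- `B = c′·ℓ_u` on the floor, raised under the ceiling pin `Y`
    have hP1f : (P 1).1 = c' := by rw [h1, floorLetter_fst]
    -- common finish: a `u′`-server `N` of slot 1 with `N 1 = e′·ℓ_r`, `e′ ≥ 1`
    have finish : ∀ N ∈ C.lower, ∀ r : Fin 4, ∀ e' : ℤ, UPartner N P 1 r → 1 ≤ e' → N 1 = floorLetter r e' → False := by
      intro N hN r e' hNP he1 hN1
      have heμ : 2 * e' ≤ h := two_mul_le_of_floorLetter_inDiamond (by omega) (by rw [← hN1]; exact hU.1 N hN 1)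
      have hN1f : (N 1).1 = e' := by rw [hN1, floorLetter_fst]
      have hBN : IsBdry h μ (N 1) := by
        rcases (show e' ≤ μ - 1 ∨ e' = μ by omega) with hlt | hfl
        · rw [hN1]; exact isBdry_floorLetter r (by omega) hlt
        · rw [hN1, hfl]; exact isBdry_floorLetter_mu hh (by omega) r
      exact ihN N hN ((hNP.1 0 (by decide)).symm.trans h0) hBN ⟨w, K, hK1, hKμ, (hNP.1 2 (by decide)).symm.trans h2⟩
        (by rw [← hNP.1 3 (by decide)]; exact h3) (by rw [hN1f, ← hNP.1 2 (by decide)]; omega)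
    rcases (show c' = 0 ∨ 1 ≤ c' by omega) with hcz | hc1
    · -- `B = O`: served above in some direction `r`, `N 1 = e·ℓ_r`
      subst hcz
      have hO : P 1 = (0, 0, 0) := h1.trans (ray_zero _ u)
      have hk : Adapted (P 1) 0 := by rw [hO]; simp [Adapted]
      have hkh : coord (P 1) 0 ≠ h := by rw [hO]; simp [coord]; omega
      obtain ⟨r, N, hN, hNP⟩ := servedAbove_ceiling_apex hU hP (hDP P hP) (g := 2) (j := 1) (by decide) hgc2 hk hkh
      obtain ⟨e, he⟩ : ∃ e : ℤ, (N 1).1 - (P 1).1 = e := ⟨_, rfl⟩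
      have he0 : 0 < e := by have := hNP.2.1; omega
      exact finish N hN r e hNP (by omega) (by rw [hNP.2.2, he, hO])
    · -- `1 ≤ c′ ≤ μ − 1`: up its floor line `u`
      have hna : ¬ isApex (P 1) := by rw [h1]; exact floorLetter_not_isApex u (by omega)
      have hk : Adapted (P 1) u := by rw [h1]; exact (floorLetter_top u c').1
      have hkh : coord (P 1) u ≠ h := by rw [h1, (floorLetter_top u c').2]; omega
      obtain ⟨N, hN, hNP⟩ := upLine_of_ruleDMu4P hU hP (hDP P hP) (g := 2) (j := 1) (by decide) hgc2 hna hk hkh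
      obtain ⟨e, he⟩ : ∃ e : ℤ, (N 1).1 - (P 1).1 = e := ⟨_, rfl⟩
      have he0 : 0 < e := by have := hNP.2.1; omega
      exact finish N hN u (c' + e) hNP (by omega) (by rw [hNP.2.2, he, h1]; exact ray_floorLetter_line u c' e)
  · -- `B = y(u, K′)` on the ceiling line (incl. `FL_u`, `hI`)
    have hP1f : (P 1).1 = h - 1 - K' := by rw [h1, ceilLetter_fst]
    rcases (show 0 ≤ K' ∨ K' = -1 by omega) with hK'0 | hK'n
    · -- climbs inward under the pin `Y`
      obtain ⟨N, hN, hagree, e, he1, heK, hN1⟩ := upLine_ceilLetter' hU hP (hDP P hP) (g := 2) (j := 1) (by decide) hgc2 hK'0 h1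
      have hN1f : (N 1).1 = h - 1 - (K' - e) := by rw [hN1, ceilLetter_fst]
      exact ihN N hN ((hagree 0 (by decide)).trans h0) (by rw [hN1]; exact isBdry_ceilLetter u (by omega) (by omega))
        ⟨w, K, hK1, hKμ, (hagree 2 (by decide)).trans h2⟩ (by rw [hagree 3 (by decide)]; exact h3)
        (by rw [hN1f, hagree 2 (by decide)]; omega)
    · -- `B = hI`
      subst hK'n
      have hBI : P 1 = (h, 0, 0) := h1.trans (ceilLetter_neg_one h u)
      rcases (show 0 ≤ K ∨ K = -1 by omega) with hK0 | hKn
      · -- `Y = y(w, K)`, `K ≥ 0`, climbs inward under the pin `B = hI`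
        have hgc1 : OnCeiling h (P 1) := by rw [hBI]; exact onCeiling_apex h
        obtain ⟨N, hN, hagree, e, he1, heK, hN2⟩ := upLine_ceilLetter' hU hP (hDP P hP) (g := 1) (j := 2) (by decide) hgc1 hK0 h2
        have hN2f : (N 2).1 = h - 1 - (K - e) := by rw [hN2, ceilLetter_fst]
        exact ihN N hN ((hagree 0 (by decide)).trans h0) (by rw [hagree 1 (by decide), h1]; exact isBdry_ceilLetter u le_rfl (by omega))
          (by rw [hN2]; exact isCeil_ceilLetter w (by omega) (by omega)) (by rw [hagree 3 (by decide)]; exact h3)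
          (by rw [hN2f, hagree 1 (by decide), hP1f]; omega)
      · -- the double-apex corner `P{F, hI, hI, X}`
        subst hKn
        exact hC P hP h0 hBI (h2.trans (ceilLetter_neg_one h w)) h3 h3h

/-- **N-STEP** (RULE D on E₋, A2I⁻, `S₄`): `N{c·ℓ_φ, B, Y, X}` (`X ≠ O`) is absent provided every `P{c·ℓ_φ, B, Y, X′}` and every origin instance
`P{O, B, Y, X′}` of measure `≤ m` is: the floor pin serves `X` below; the child with `X′ = O` is `{O, B, Y, c·ℓ_φ}` (slots `0`, `3`); for
`c = 0` the origin pin + A2I⁻ (`originPin_lower_step`, slots `2`, `3` transposed) lowers `X` without reaching `O`. -/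
theorem bdry_stepN {h μ : ℤ} {C : MConfig} (hU : C.InDiamond h) (hDN : ∀ Z ∈ C.lower, RuleDMu4N C Z) (hA : A2IMinusClosed C)
    (hGl : PermClosed C.lower) (hGu : PermClosed C.upper) (hh1 : 1 ≤ h) {q : Prop} {φ : Fin 4} {c : ℤ} (hc0 : 0 ≤ c) {m : ℤ}
    (ihP : ∀ P ∈ C.upper, P 0 = floorLetter φ c → IsBdry h μ (P 1) → IsCeil h μ (P 2) → P 3 ≠ (0, 0, 0) → (c = μ ∨ q → P 3 ≠ (h, 0, 0)) →
      (h - (P 1).1) + (h - (P 2).1) ≤ m → False)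
    (ihP0 : ∀ P ∈ C.upper, P 0 = (0, 0, 0) → IsBdry h μ (P 1) → IsCeil h μ (P 2) → P 3 ≠ (0, 0, 0) → P 3 ≠ (h, 0, 0) →
      (h - (P 1).1) + (h - (P 2).1) ≤ m → False)
    {N : MCell} (hN : N ∈ C.lower) (h0 : N 0 = floorLetter φ c) (hB : IsBdry h μ (N 1)) (hY : IsCeil h μ (N 2)) (h3 : N 3 ≠ (0, 0, 0))
    (hM : (h - (N 1).1) + (h - (N 2).1) ≤ m) : False := by
  rcases (show c = 0 ∨ 1 ≤ c by omega) with hcz | hc1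
  · -- `F = O`
    subst hcz
    have hO : N 0 = (0, 0, 0) := h0.trans (ray_zero _ φ)
    obtain ⟨hN', e0, e1, e2, e3⟩ := perm23_lower hGl hN
    have hN3h : (N 3).1 ≤ h := fst_le_of_inDiamond (hU.1 N hN 3)
    refine originPin_lower_step' hU hDN hA hGl hGu hN' (e0.trans hO) (by rw [e2]; exact h3) fun P hP hP0 hP1 hP3 hle => ?_
    by_contra hP2
    have hP2I : P 2 ≠ (h, 0, 0) := by
      rcases hle with hlt | ⟨heq, hflo⟩
      · intro e; rw [e, e2] at hlt; simp only at hlt; omega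
      · intro e; rw [heq] at e; rw [e] at hflo; simp [OnFloor, absCharge, chargeOf] at hflo; omega
    obtain ⟨hP', f0, f1, f2, f3⟩ := perm23_upper hGu hP
    exact ihP0 _ hP' (f0.trans hP0) (by rw [f1, hP1, e1]; exact hB) (by rw [f2, hP3, e3]; exact hY) (by rw [f3]; exact hP2)
      (by rw [f3]; exact hP2I) (by rw [f1, f2, hP1, hP3, e1, e3]; exact hM)
  · -- `F = c·ℓ_φ`, `c ≥ 1`: the floor pin serves `X` (slot 3) below
    have hfl : OnFloor (N 0) := by rw [h0]; exact onFloor_floorLetter φ (by omega)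
    obtain ⟨k, hk, hk0⟩ := exists_frame_ne_zero (hU.1 N hN 3).1 h3
    obtain ⟨r, -, P, hP, hNP⟩ := servedBelow_floor_dir hU hN (hDN N hN) (i := 0) (g := 3) (by decide) hfl hk hk0
    have hP0 : P 0 = floorLetter φ c := (hNP.1 0 (by decide)).trans h0
    have hP1 : P 1 = N 1 := hNP.1 1 (by decide)
    have hP2 : P 2 = N 2 := hNP.1 2 (by decide)
    have hlt : (P 3).1 < (N 3).1 := hNP.2.1
    have hN3h : (N 3).1 ≤ h := fst_le_of_inDiamond (hU.1 N hN 3)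
    by_cases hP3 : P 3 = (0, 0, 0)
    · -- the child `{F, B, Y, O}` is the origin instance `{O, B, Y, F}`
      obtain ⟨hP', f0, f1, f2, f3⟩ := perm03_upper hGu hP
      have h2c : 2 * c ≤ h := two_mul_le_of_floorLetter_inDiamond hc0 (h0 ▸ hU.1 N hN 0)
      exact ihP0 _ hP' (f0.trans hP3) (by rw [f1, hP1]; exact hB) (by rw [f2, hP2]; exact hY)
        (by rw [f3, hP0]; exact floorLetter_ne_origin φ (by omega)) (by rw [f3, hP0]; exact floorLetter_ne_hI φ (by omega))
        (by rw [f1, f2, hP1, hP2]; exact hM)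
    · exact ihP P hP hP0 (by rw [hP1]; exact hB) (by rw [hP2]; exact hY) hP3
        (fun _ e => by rw [e] at hlt; simp only at hlt; omega) (by rw [hP1, hP2]; exact hM)

/-! ### §1b the induction on the measure `(h − ht B) + (h − ht Y)` -/

/-- **T8a engine**: for a fixed floor pin `c·ℓ_φ` (and the origin instances it spawns), both levels at once, by induction on the measure. -/
theorem bdry_aux {h μ : ℤ} {C : MConfig} (hU : C.InDiamond h) (hDN : ∀ Z ∈ C.lower, RuleDMu4N C Z)
    (hDP : ∀ P ∈ C.upper, RuleDMu4P C P) (hA : A2IMinusClosed C) (hGl : PermClosed C.lower) (hGu : PermClosed C.upper)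
    (hh : h = 2 * μ) (hμ : 1 ≤ μ) {q : Prop} {φ : Fin 4} (hC0 : CornerFree C h μ q φ 0) :
    ∀ n : ℕ, ∀ c : ℤ, 0 ≤ c → CornerFree C h μ q φ c →
      (∀ P ∈ C.upper, P 0 = floorLetter φ c → IsBdry h μ (P 1) → IsCeil h μ (P 2) → P 3 ≠ (0, 0, 0) → (c = μ ∨ q → P 3 ≠ (h, 0, 0)) →
          (h - (P 1).1) + (h - (P 2).1) ≤ n → False) ∧
      (∀ N ∈ C.lower, N 0 = floorLetter φ c → IsBdry h μ (N 1) → IsCeil h μ (N 2) → N 3 ≠ (0, 0, 0) →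
          (h - (N 1).1) + (h - (N 2).1) ≤ n → False) := by
  intro n
  induction n with
  | zero =>
    intro c hc0 hC
    have hPc : ∀ c' : ℤ, CornerFree C h μ q φ c' → ∀ P ∈ C.upper, P 0 = floorLetter φ c' → IsBdry h μ (P 1) → IsCeil h μ (P 2) →
        P 3 ≠ (0, 0, 0) → (c' = μ ∨ q → P 3 ≠ (h, 0, 0)) → (h - (P 1).1) + (h - (P 2).1) ≤ ((0 : ℕ) : ℤ) → False :=
      fun c' hC' P hP h0 hB hY h3 h3h hM => bdry_stepP hU hDP hh hμ hC' (m := 0)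
        (fun N hN _ _ _ _ hlt => by
          have := fst_le_of_inDiamond (hU.1 N hN 1); have := fst_le_of_inDiamond (hU.1 N hN 2); omega) hP h0 hB hY h3 h3h
        (by simpa using hM)
    exact ⟨hPc c hC, fun N hN h0 hB hY h3 hM => bdry_stepN hU hDN hA hGl hGu (by omega) hc0 (m := 0) (hPc c hC)
      (fun P hP hP0 hB' hY' h3' h3I hM' => hPc 0 hC0 P hP (hP0.trans (ray_zero _ φ).symm) hB' hY' h3' (fun _ => h3I) hM')
      hN h0 hB hY h3 (by simpa using hM)⟩
  | succ n ih =>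
    intro c hc0 hC
    have hPc : ∀ c' : ℤ, 0 ≤ c' → CornerFree C h μ q φ c' → ∀ P ∈ C.upper, P 0 = floorLetter φ c' → IsBdry h μ (P 1) → IsCeil h μ (P 2) →
        P 3 ≠ (0, 0, 0) → (c' = μ ∨ q → P 3 ≠ (h, 0, 0)) → (h - (P 1).1) + (h - (P 2).1) ≤ ((n + 1 : ℕ) : ℤ) → False :=
      fun c' hc'0 hC' P hP h0 hB hY h3 h3h hM => bdry_stepP hU hDP hh hμ hC' (m := ((n + 1 : ℕ) : ℤ))
        (fun N hN hN0 hB' hY' h3' hlt => (ih c' hc'0 hC').2 N hN hN0 hB' hY' h3' (by push_cast at hlt; omega)) hP h0 hB hY h3 h3h hM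
    exact ⟨hPc c hc0 hC, fun N hN h0 hB hY h3 hM => bdry_stepN hU hDN hA hGl hGu (by omega) hc0 (m := ((n + 1 : ℕ) : ℤ)) (hPc c hc0 hC)
      (fun P hP hP0 hB' hY' h3' h3I hM' => hPc 0 le_rfl hC0 P hP (hP0.trans (ray_zero _ φ).symm) hB' hY' h3' (fun _ => h3I) hM')
      hN h0 hB hY h3 hM⟩

/-! ### §1c T8a: the boundary block modulo its corners -/

/-- **T8a, level `P`.** [◇_h, RULE D both levels, A2I⁻, `S₄` both levels; `h = 2μ`, `μ ≥ 1`]  If the double-apex corners over `O` and over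
`c·ℓ_φ` are free (`CornerFree`), then `P{c·ℓ_φ, B, Y, X} ∉ C.upper` for `0 ≤ c ≤ μ`, every boundary letter `B` (`IsBdry`), every ceiling
letter `Y` (`IsCeil`) and EVERY `X ≠ O` (`X ≠ hI` if `c = μ`).  CONDITIONAL — a reduction, not an absent family. -/
theorem bdryBlockP_of_cornerFree {h μ c : ℤ} {C : MConfig} (hU : C.InDiamond h) (hDN : ∀ Z ∈ C.lower, RuleDMu4N C Z)
    (hDP : ∀ P ∈ C.upper, RuleDMu4P C P) (hA : A2IMinusClosed C) (hGl : PermClosed C.lower) (hGu : PermClosed C.upper)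
    (hh : h = 2 * μ) (hμ : 1 ≤ μ) {q : Prop} {φ : Fin 4} (hC0 : CornerFree C h μ q φ 0) (hc0 : 0 ≤ c) (hC : CornerFree C h μ q φ c)
    {P : MCell} (h0 : P 0 = floorLetter φ c) (hB : IsBdry h μ (P 1)) (hY : IsCeil h μ (P 2)) (h3 : P 3 ≠ (0, 0, 0))
    (h3h : c = μ ∨ q → P 3 ≠ (h, 0, 0)) : P ∉ C.upper := fun hP =>
  (bdry_aux hU hDN hDP hA hGl hGu hh hμ hC0 ((h - (P 1).1) + (h - (P 2).1)).toNat c hc0 hC).1 P hP h0 hB hY h3 h3h (Int.self_le_toNat _)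

/-- **T8a, level `N`.** [same]  `N{c·ℓ_φ, B, Y, X} ∉ C.lower` for `0 ≤ c ≤ μ`, every boundary `B`, every ceiling `Y`, every `X ≠ O` — given
`CornerFree` over `O` and over `c·ℓ_φ`.  CONDITIONAL. -/
theorem bdryBlockN_of_cornerFree {h μ c : ℤ} {C : MConfig} (hU : C.InDiamond h) (hDN : ∀ Z ∈ C.lower, RuleDMu4N C Z)
    (hDP : ∀ P ∈ C.upper, RuleDMu4P C P) (hA : A2IMinusClosed C) (hGl : PermClosed C.lower) (hGu : PermClosed C.upper)
    (hh : h = 2 * μ) (hμ : 1 ≤ μ) {q : Prop} {φ : Fin 4} (hC0 : CornerFree C h μ q φ 0) (hc0 : 0 ≤ c) (hC : CornerFree C h μ q φ c)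
    {N : MCell} (h0 : N 0 = floorLetter φ c) (hB : IsBdry h μ (N 1)) (hY : IsCeil h μ (N 2)) (h3 : N 3 ≠ (0, 0, 0)) : N ∉ C.lower :=
  fun hN =>
  (bdry_aux hU hDN hDP hA hGl hGu hh hμ hC0 ((h - (N 1).1) + (h - (N 2).1)).toNat c hc0 hC).2 N hN h0 hB hY h3 (Int.self_le_toNat _)

/-- **T8a at the origin** (`c = 0`): `{O, B, Y, X} ∉ E_±` (`X ≠ O`) given only `CornerFree` over `O`. -/
theorem originBdryBlockP_of_cornerFree {h μ : ℤ} {C : MConfig} (hU : C.InDiamond h) (hDN : ∀ Z ∈ C.lower, RuleDMu4N C Z)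
    (hDP : ∀ P ∈ C.upper, RuleDMu4P C P) (hA : A2IMinusClosed C) (hGl : PermClosed C.lower) (hGu : PermClosed C.upper)
    (hh : h = 2 * μ) (hμ : 1 ≤ μ) {q : Prop} {φ : Fin 4} (hC0 : CornerFree C h μ q φ 0) {P : MCell} (h0 : P 0 = (0, 0, 0))
    (hB : IsBdry h μ (P 1)) (hY : IsCeil h μ (P 2)) (h3 : P 3 ≠ (0, 0, 0)) (h3h : q → P 3 ≠ (h, 0, 0)) : P ∉ C.upper :=
  bdryBlockP_of_cornerFree hU hDN hDP hA hGl hGu hh hμ hC0 le_rfl hC0 (h0.trans (ray_zero _ φ).symm) hB hY h3 fun e =>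
    e.elim (fun e0 => absurd e0 (by omega)) h3h

theorem originBdryBlockN_of_cornerFree {h μ : ℤ} {C : MConfig} (hU : C.InDiamond h) (hDN : ∀ Z ∈ C.lower, RuleDMu4N C Z)
    (hDP : ∀ P ∈ C.upper, RuleDMu4P C P) (hA : A2IMinusClosed C) (hGl : PermClosed C.lower) (hGu : PermClosed C.upper)
    (hh : h = 2 * μ) (hμ : 1 ≤ μ) {q : Prop} {φ : Fin 4} (hC0 : CornerFree C h μ q φ 0) {N : MCell} (h0 : N 0 = (0, 0, 0))
    (hB : IsBdry h μ (N 1)) (hY : IsCeil h μ (N 2)) (h3 : N 3 ≠ (0, 0, 0)) : N ∉ C.lower :=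
  bdryBlockN_of_cornerFree hU hDN hDP hA hGl hGu hh hμ hC0 le_rfl hC0 (h0.trans (ray_zero _ φ).symm) hB hY h3

/-! ## §2 T8b — THE DOUBLE-APEX CORNERS BY THE X⁺ FORK: `P{F, hI, hI, X}` ⇐ the apex–ceiling sibling rows `N{F₁, hI, y, X′}`

At a double-apex `N`-cell `Z = {F₁, hI, hI, X′}` with `F₁` on the floor, RULE D on E₋ (floor pin `F₁`) serves the apex at slot `2` below through each
of its four adapted frames, in a direction `r_k ≠ k + 2`; two of the four directions differ, and the X⁺ fork `xplus_two_children_gen` (apex pin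
at slot `1`) fires unless a slot-`2` CEILING SIBLING `{F₁, hI, y, X′}` (`y` non-apex, on the ceiling) is present.  A double-apex corner
`P{F, hI, hI, X}` produces such a `Z` by ONE RULE-D move on E₊ under the pin `hI`: raise `X` (if `X ≠ hI`; any floor `F`, `O` and `FL` included) or
raise `F` along the floor (`O ↦ e·ℓ_r`, `c·ℓ_φ ↦ (c+e)·ℓ_φ`, `c ≤ μ − 1`; needed only for `X = hI`).  Hence `SibFree ⇒ CornerFree` for every
`0 ≤ c ≤ μ`, and with §1: `SibFree ⇒` the whole boundary block is absent (T8).  The sibling rows ARE boundary-block `N`-cells (`B = hI`,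
`Y = y(w, K)`, `K ≥ 0`): T8 is the statement that the block `{F, B, Y, X}` of ◇_h stands or falls with its rows `N{F, hI, y(K ≥ 0), X}`. -/

/-- **the apex–ceiling sibling rows are free**: no `N ∈ C.lower` with `N 0` on the floor, `N 1 = hI`, `N 2` a non-apex ceiling point and
`N 3 ≠ O` — the boundary-block `N`-cells `{F, hI, y(w,K), X}`, `K ≥ 0` (census j318002: all ABSENT at `h ∈ {4,6,8,10}`, docstring digits). -/
def SibFree (C : MConfig) (h : ℤ) : Prop :=
  ∀ N ∈ C.lower, OnFloor (N 0) → N 1 = (h, 0, 0) → ¬ isApex (N 2) → OnCeiling h (N 2) → N 3 ≠ (0, 0, 0) → False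

/-- four RULE-D service directions, one per frame of the apex (`r_k ≠ k + 2`), cannot all coincide. -/
theorem two_dirs_of_four : ∀ a b d e : Fin 4, a ≠ 0 + 2 → b ≠ 1 + 2 → d ≠ 2 + 2 → e ≠ 3 + 2 → a ≠ d ∨ a ≠ b ∨ a ≠ e := by decide

theorem onFloor_origin : OnFloor ((0, 0, 0) : BPoint) := by simp [OnFloor, absCharge, chargeOf]

/-- **the fork server at a double apex.** [◇_h, RULE D on E₋, X⁺]  `Z = {F₁, hI, hI, X′} ∈ C.lower` with `F₁` on the floor and no slot-`2`
ceiling sibling `{F₁, hI, y, X′} ∈ C.lower` (`y` non-apex, on the ceiling) is contradictory. -/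
theorem doubleApexN_absent {h : ℤ} {C : MConfig} (hU : C.InDiamond h) (hDN : ∀ Z ∈ C.lower, RuleDMu4N C Z) (hX : XPlusClosed C)
    (hh1 : 1 ≤ h) {Z : MCell} (hZ : Z ∈ C.lower) (hfl : OnFloor (Z 0)) (h1 : Z 1 = (h, 0, 0)) (h2 : Z 2 = (h, 0, 0))
    (hNT : ∀ X ∈ C.lower, MAgree X Z 2 → ¬ isApex (X 2) → OnCeiling h (X 2) → False) : False := by
  have hk : ∀ k : Fin 4, Adapted (Z 2) k := fun k => by rw [h2]; fin_cases k <;> simp [Adapted]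
  have hk0 : ∀ k : Fin 4, coord (Z 2) k ≠ 0 := fun k => by rw [h2]; fin_cases k <;> simp [coord] <;> omega
  obtain ⟨a, ha, Pa, hPa, hZa⟩ := servedBelow_floor_dir hU hZ (hDN Z hZ) (i := 0) (g := 2) (by decide) hfl (hk 0) (hk0 0)
  obtain ⟨b, hb, Pb, hPb, hZb⟩ := servedBelow_floor_dir hU hZ (hDN Z hZ) (i := 0) (g := 2) (by decide) hfl (hk 1) (hk0 1)
  obtain ⟨d, hd, Pd, hPd, hZd⟩ := servedBelow_floor_dir hU hZ (hDN Z hZ) (i := 0) (g := 2) (by decide) hfl (hk 2) (hk0 2)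
  obtain ⟨e, he, Pe, hPe, hZe⟩ := servedBelow_floor_dir hU hZ (hDN Z hZ) (i := 0) (g := 2) (by decide) hfl (hk 3) (hk0 3)
  rcases two_dirs_of_four a b d e ha hb hd he with hne | hne | hne
  · exact xplus_two_children_gen hU hX hZ (g := 2) (f := 1) (by decide) h2 h1 hPa hPd (Ne.symm hne) hZa hZd hNT
  · exact xplus_two_children_gen hU hX hZ (g := 2) (f := 1) (by decide) h2 h1 hPa hPb (Ne.symm hne) hZa hZb hNT
  · exact xplus_two_children_gen hU hX hZ (g := 2) (f := 1) (by decide) h2 h1 hPa hPe (Ne.symm hne) hZa hZe hNT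

/-- the siblings of a double-apex `N`-cell with `N 3 ≠ O` are `SibFree` rows. -/
theorem doubleApexN_absent_of_sibFree {h : ℤ} {C : MConfig} (hU : C.InDiamond h) (hDN : ∀ Z ∈ C.lower, RuleDMu4N C Z) (hX : XPlusClosed C)
    (hh1 : 1 ≤ h) (hS : SibFree C h) {Z : MCell} (hZ : Z ∈ C.lower) (hfl : OnFloor (Z 0)) (h1 : Z 1 = (h, 0, 0)) (h2 : Z 2 = (h, 0, 0))
    (h3 : Z 3 ≠ (0, 0, 0)) : False :=
  doubleApexN_absent hU hDN hX hh1 hZ hfl h1 h2 fun X hXl hXa hna hXc =>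
    hS X hXl (by rw [hXa 0 (by decide)]; exact hfl) (by rw [hXa 1 (by decide), h1]) hna hXc (by rw [hXa 3 (by decide)]; exact h3)

/-- **double-apex corner, `X ≠ hI`** [◇_h, RULE D both levels, X⁺]: `P{F, hI, hI, X} ∉ C.upper` for EVERY floor point `F` (`O`, `c·ℓ`, `FL`)
and every `X ≠ hI`, given `SibFree`: the pin `hI` raises `X` (RULE D on E₊), the server is a double-apex `N`-cell with `N 3 ≠ O`. -/
theorem doubleApexP_absent_of_sibFree {h : ℤ} {C : MConfig} (hU : C.InDiamond h) (hDN : ∀ Z ∈ C.lower, RuleDMu4N C Z)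
    (hDP : ∀ P ∈ C.upper, RuleDMu4P C P) (hX : XPlusClosed C) (hh1 : 1 ≤ h) (hS : SibFree C h) {P : MCell} (hP : P ∈ C.upper)
    (hfl : OnFloor (P 0)) (h1 : P 1 = (h, 0, 0)) (h2 : P 2 = (h, 0, 0)) (h3 : P 3 ≠ (h, 0, 0)) : False := by
  have hgc1 : OnCeiling h (P 1) := by rw [h1]; exact onCeiling_apex h
  obtain ⟨k, hk, hkh⟩ := exists_frame_ne_h (hU.2 P hP 3) h3
  obtain ⟨r, N, hN, hNP⟩ := servedAbove_ceiling_apex hU hP (hDP P hP) (g := 1) (j := 3) (by decide) hgc1 hk hkh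
  have hN3 : N 3 ≠ (0, 0, 0) := fun e => by
    have h0le : 0 ≤ (P 3).1 := fst_nonneg_of_inDiamond (hU.2 P hP 3)
    have := hNP.2.1; rw [e] at this; simp only at this; omega
  exact doubleApexN_absent_of_sibFree hU hDN hX hh1 hS hN (by rw [← hNP.1 0 (by decide)]; exact hfl)
    ((hNP.1 1 (by decide)).symm.trans h1) ((hNP.1 2 (by decide)).symm.trans h2) hN3

/-- **double-apex corner, `X = hI` allowed, `F = c·ℓ_φ` with `0 ≤ c ≤ μ − 1`** [same]: the pin `hI` raises `F` along the floor instead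
(`O ↦ e·ℓ_r`, `c·ℓ_φ ↦ (c+e)·ℓ_φ`); needs `X ≠ O`. -/
theorem doubleApexP_absent_of_sibFree' {h μ c : ℤ} {C : MConfig} (hU : C.InDiamond h) (hDN : ∀ Z ∈ C.lower, RuleDMu4N C Z)
    (hDP : ∀ P ∈ C.upper, RuleDMu4P C P) (hX : XPlusClosed C) (hh : h = 2 * μ) (hμ : 1 ≤ μ) (hS : SibFree C h) {φ : Fin 4} (hc0 : 0 ≤ c)
    (hcμ : c ≤ μ - 1) {P : MCell} (hP : P ∈ C.upper) (h0 : P 0 = floorLetter φ c) (h1 : P 1 = (h, 0, 0)) (h2 : P 2 = (h, 0, 0))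
    (h3 : P 3 ≠ (0, 0, 0)) : False := by
  have hgc1 : OnCeiling h (P 1) := by rw [h1]; exact onCeiling_apex h
  have finish : ∀ N ∈ C.lower, (∀ i, i ≠ 0 → P i = N i) → OnFloor (N 0) → False := fun N hN hag hflN =>
    doubleApexN_absent_of_sibFree hU hDN hX (by omega) hS hN hflN ((hag 1 (by decide)).symm.trans h1) ((hag 2 (by decide)).symm.trans h2)
      (by rw [← hag 3 (by decide)]; exact h3)
  rcases (show c = 0 ∨ 1 ≤ c by omega) with hcz | hc1
  · subst hcz
    have hO : P 0 = (0, 0, 0) := h0.trans (ray_zero _ φ)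
    obtain ⟨r, N, hN, hNP⟩ := servedAbove_ceiling_apex hU hP (hDP P hP) (g := 1) (j := 0) (by decide) hgc1 (k := 0)
      (by rw [hO]; simp [Adapted]) (by rw [hO]; simp [coord]; omega)
    obtain ⟨e, he⟩ : ∃ e : ℤ, (N 0).1 - (P 0).1 = e := ⟨_, rfl⟩
    have he0 : 0 < e := by have := hNP.2.1; omega
    have hN0 : N 0 = floorLetter r e := by rw [hNP.2.2, he, hO]
    exact finish N hN hNP.1 (by rw [hN0]; exact onFloor_floorLetter r (by omega))
  · have hna : ¬ isApex (P 0) := by rw [h0]; exact floorLetter_not_isApex φ (by omega)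
    obtain ⟨N, hN, hNP⟩ := upLine_of_ruleDMu4P hU hP (hDP P hP) (g := 1) (j := 0) (by decide) hgc1 hna (k := φ)
      (by rw [h0]; exact (floorLetter_top φ c).1) (by rw [h0, (floorLetter_top φ c).2]; omega)
    obtain ⟨e, he⟩ : ∃ e : ℤ, (N 0).1 - (P 0).1 = e := ⟨_, rfl⟩
    have he0 : 0 < e := by have := hNP.2.1; omega
    have hN0 : N 0 = floorLetter φ (c + e) := by rw [hNP.2.2, he, h0]; exact ray_floorLetter_line φ c e
    exact finish N hN hNP.1 (by rw [hN0]; exact onFloor_floorLetter φ (by omega))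

/-- **T8b.** [◇_h, RULE D both levels, X⁺; `h = 2μ`, `μ ≥ 1`]  `SibFree ⇒ CornerFree C h μ q φ c` for every phase `φ`, every `0 ≤ c ≤ μ`
(and either proviso flag `q`). -/
theorem cornerFree_of_sibFree {h μ c : ℤ} {C : MConfig} (hU : C.InDiamond h) (hDN : ∀ Z ∈ C.lower, RuleDMu4N C Z)
    (hDP : ∀ P ∈ C.upper, RuleDMu4P C P) (hX : XPlusClosed C) (hh : h = 2 * μ) (hμ : 1 ≤ μ) (hS : SibFree C h) (q : Prop) (φ : Fin 4)
    (hc0 : 0 ≤ c) (hcμ : c ≤ μ) : CornerFree C h μ q φ c := by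
  intro P hP h0 h1 h2 h3 h3h
  by_cases hXI : P 3 = (h, 0, 0)
  · exact doubleApexP_absent_of_sibFree' hU hDN hDP hX hh hμ hS hc0 (by by_contra hc; exact h3h (Or.inl (by omega)) hXI) hP h0 h1 h2 h3
  · exact doubleApexP_absent_of_sibFree hU hDN hDP hX (by omega) hS hP (by rw [h0]; exact onFloor_floorLetter φ hc0) h1 h2 hXI

/-! ### §2a T8 = T8a + T8b: the boundary block stands or falls with its apex–ceiling sibling rows -/

/-- **T8, level `P`.** [◇_h, RULE D both levels, X⁺, A2I⁻, `S₄` both levels; `h = 2μ`, `μ ≥ 1`]  `SibFree` ⇒ `P{c·ℓ_φ, B, Y, X} ∉ C.upper` for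
`0 ≤ c ≤ μ`, every boundary `B` (`IsBdry`), every ceiling `Y` (`IsCeil`), every `X ≠ O` (`X ≠ hI` if `c = μ`).  CONDITIONAL on `SibFree`. -/
theorem bdryBlockP_of_sibFree {h μ c : ℤ} {C : MConfig} (hU : C.InDiamond h) (hDN : ∀ Z ∈ C.lower, RuleDMu4N C Z)
    (hDP : ∀ P ∈ C.upper, RuleDMu4P C P) (hX : XPlusClosed C) (hA : A2IMinusClosed C) (hGl : PermClosed C.lower) (hGu : PermClosed C.upper)
    (hh : h = 2 * μ) (hμ : 1 ≤ μ) (hS : SibFree C h) {q : Prop} (φ : Fin 4) (hc0 : 0 ≤ c) (hcμ : c ≤ μ) {P : MCell}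
    (h0 : P 0 = floorLetter φ c) (hB : IsBdry h μ (P 1)) (hY : IsCeil h μ (P 2)) (h3 : P 3 ≠ (0, 0, 0)) (h3h : c = μ ∨ q → P 3 ≠ (h, 0, 0)) :
    P ∉ C.upper :=
  bdryBlockP_of_cornerFree hU hDN hDP hA hGl hGu hh hμ (cornerFree_of_sibFree hU hDN hDP hX hh hμ hS q φ le_rfl (by omega)) hc0
    (cornerFree_of_sibFree hU hDN hDP hX hh hμ hS q φ hc0 hcμ) h0 hB hY h3 h3h

/-- **T8, level `N`.** [same]  `SibFree` ⇒ `N{c·ℓ_φ, B, Y, X} ∉ C.lower` for `0 ≤ c ≤ μ`, every boundary `B`, every ceiling `Y`, every `X ≠ O`. -/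
theorem bdryBlockN_of_sibFree {h μ c : ℤ} {C : MConfig} (hU : C.InDiamond h) (hDN : ∀ Z ∈ C.lower, RuleDMu4N C Z)
    (hDP : ∀ P ∈ C.upper, RuleDMu4P C P) (hX : XPlusClosed C) (hA : A2IMinusClosed C) (hGl : PermClosed C.lower) (hGu : PermClosed C.upper)
    (hh : h = 2 * μ) (hμ : 1 ≤ μ) (hS : SibFree C h) (φ : Fin 4) (hc0 : 0 ≤ c) (hcμ : c ≤ μ) {N : MCell} (h0 : N 0 = floorLetter φ c)
    (hB : IsBdry h μ (N 1)) (hY : IsCeil h μ (N 2)) (h3 : N 3 ≠ (0, 0, 0)) : N ∉ C.lower :=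
  bdryBlockN_of_cornerFree hU hDN hDP hA hGl hGu hh hμ (cornerFree_of_sibFree hU hDN hDP hX hh hμ hS False φ le_rfl (by omega)) hc0
    (cornerFree_of_sibFree hU hDN hDP hX hh hμ hS False φ hc0 hcμ) h0 hB hY h3

/-- **T8 in letters, level `P`, two floor letters**: `P{c·ℓ_φ, c′·ℓ_u, y(w,K), X} ∉ C.upper`, `0 ≤ c ≤ μ`, `0 ≤ c′ ≤ μ`, `−1 ≤ K ≤ μ − 1`,
`X ≠ O` (`X ≠ hI` if `c = μ`), given `SibFree`. -/
theorem floorFloorCeilP_of_sibFree {h μ c c' K : ℤ} {C : MConfig} (hU : C.InDiamond h) (hDN : ∀ Z ∈ C.lower, RuleDMu4N C Z)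
    (hDP : ∀ P ∈ C.upper, RuleDMu4P C P) (hX : XPlusClosed C) (hA : A2IMinusClosed C) (hGl : PermClosed C.lower) (hGu : PermClosed C.upper)
    (hh : h = 2 * μ) (hμ : 1 ≤ μ) (hS : SibFree C h) {φ u w : Fin 4} (hc0 : 0 ≤ c) (hcμ : c ≤ μ) (hc'0 : 0 ≤ c') (hc'μ : c' ≤ μ)
    (hK1 : -1 ≤ K) (hKμ : K ≤ μ - 1) {P : MCell} (h0 : P 0 = floorLetter φ c) (h1 : P 1 = floorLetter u c') (h2 : P 2 = ceilLetter h w K)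
    (h3 : P 3 ≠ (0, 0, 0)) (h3h : c = μ → P 3 ≠ (h, 0, 0)) : P ∉ C.upper :=
  bdryBlockP_of_sibFree hU hDN hDP hX hA hGl hGu hh hμ hS (q := False) φ hc0 hcμ h0
    (by rcases (show c' ≤ μ - 1 ∨ c' = μ by omega) with hl | hm
        · rw [h1]; exact isBdry_floorLetter u hc'0 hl
        · rw [h1, hm]; exact isBdry_floorLetter_mu hh (by omega) u)
    (by rw [h2]; exact isCeil_ceilLetter w hK1 hKμ) h3 (fun e => h3h (e.elim id False.elim))

/-- **T8 in letters, level `N`, two floor letters**: `N{c·ℓ_φ, c′·ℓ_u, y(w,K), X} ∉ C.lower`, same ranges, `X ≠ O`, given `SibFree`. -/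
theorem floorFloorCeilN_of_sibFree {h μ c c' K : ℤ} {C : MConfig} (hU : C.InDiamond h) (hDN : ∀ Z ∈ C.lower, RuleDMu4N C Z)
    (hDP : ∀ P ∈ C.upper, RuleDMu4P C P) (hX : XPlusClosed C) (hA : A2IMinusClosed C) (hGl : PermClosed C.lower) (hGu : PermClosed C.upper)
    (hh : h = 2 * μ) (hμ : 1 ≤ μ) (hS : SibFree C h) {φ u w : Fin 4} (hc0 : 0 ≤ c) (hcμ : c ≤ μ) (hc'0 : 0 ≤ c') (hc'μ : c' ≤ μ)
    (hK1 : -1 ≤ K) (hKμ : K ≤ μ - 1) {N : MCell} (h0 : N 0 = floorLetter φ c) (h1 : N 1 = floorLetter u c') (h2 : N 2 = ceilLetter h w K)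
    (h3 : N 3 ≠ (0, 0, 0)) : N ∉ C.lower :=
  bdryBlockN_of_sibFree hU hDN hDP hX hA hGl hGu hh hμ hS φ hc0 hcμ h0
    (by rcases (show c' ≤ μ - 1 ∨ c' = μ by omega) with hl | hm
        · rw [h1]; exact isBdry_floorLetter u hc'0 hl
        · rw [h1, hm]; exact isBdry_floorLetter_mu hh (by omega) u)
    (by rw [h2]; exact isCeil_ceilLetter w hK1 hKμ) h3

/-- **T8 in letters, level `P`, floor + two ceiling letters**: `P{c·ℓ_φ, y(u,K′), y(w,K), X} ∉ C.upper`, `0 ≤ c ≤ μ`, `−1 ≤ K′, K ≤ μ − 1`,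
`X ≠ O` (`X ≠ hI` if `c = μ`), given `SibFree`. -/
theorem floorCeilCeilP_of_sibFree {h μ c K' K : ℤ} {C : MConfig} (hU : C.InDiamond h) (hDN : ∀ Z ∈ C.lower, RuleDMu4N C Z)
    (hDP : ∀ P ∈ C.upper, RuleDMu4P C P) (hX : XPlusClosed C) (hA : A2IMinusClosed C) (hGl : PermClosed C.lower) (hGu : PermClosed C.upper)
    (hh : h = 2 * μ) (hμ : 1 ≤ μ) (hS : SibFree C h) {φ u w : Fin 4} (hc0 : 0 ≤ c) (hcμ : c ≤ μ) (hK'1 : -1 ≤ K') (hK'μ : K' ≤ μ - 1)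
    (hK1 : -1 ≤ K) (hKμ : K ≤ μ - 1) {P : MCell} (h0 : P 0 = floorLetter φ c) (h1 : P 1 = ceilLetter h u K') (h2 : P 2 = ceilLetter h w K)
    (h3 : P 3 ≠ (0, 0, 0)) (h3h : c = μ → P 3 ≠ (h, 0, 0)) : P ∉ C.upper :=
  bdryBlockP_of_sibFree hU hDN hDP hX hA hGl hGu hh hμ hS (q := False) φ hc0 hcμ h0 (by rw [h1]; exact isBdry_ceilLetter u hK'1 hK'μ)
    (by rw [h2]; exact isCeil_ceilLetter w hK1 hKμ) h3 (fun e => h3h (e.elim id False.elim))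

/-- **T8 in letters, level `N`, floor + two ceiling letters**: `N{c·ℓ_φ, y(u,K′), y(w,K), X} ∉ C.lower`, same ranges, `X ≠ O`, given `SibFree`. -/
theorem floorCeilCeilN_of_sibFree {h μ c K' K : ℤ} {C : MConfig} (hU : C.InDiamond h) (hDN : ∀ Z ∈ C.lower, RuleDMu4N C Z)
    (hDP : ∀ P ∈ C.upper, RuleDMu4P C P) (hX : XPlusClosed C) (hA : A2IMinusClosed C) (hGl : PermClosed C.lower) (hGu : PermClosed C.upper)
    (hh : h = 2 * μ) (hμ : 1 ≤ μ) (hS : SibFree C h) {φ u w : Fin 4} (hc0 : 0 ≤ c) (hcμ : c ≤ μ) (hK'1 : -1 ≤ K') (hK'μ : K' ≤ μ - 1)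
    (hK1 : -1 ≤ K) (hKμ : K ≤ μ - 1) {N : MCell} (h0 : N 0 = floorLetter φ c) (h1 : N 1 = ceilLetter h u K') (h2 : N 2 = ceilLetter h w K)
    (h3 : N 3 ≠ (0, 0, 0)) : N ∉ C.lower :=
  bdryBlockN_of_sibFree hU hDN hDP hX hA hGl hGu hh hμ hS φ hc0 hcμ h0 (by rw [h1]; exact isBdry_ceilLetter u hK'1 hK'μ)
    (by rw [h2]; exact isCeil_ceilLetter w hK1 hKμ) h3

/-! ## §3 T8c ∕ T8d — THE ORIGIN–APEX ROWS `{O, hI, Y, X}` AND THE ORIGIN BLOCK `{O, B, Y, X}`, EVERY `X`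

Induction on the height of `X` (RULE D both levels, X⁺, A2I⁻, `S₄`): `N{O, hI, y, X}` — the origin pin lowers `X` (`originPin_lower_step'`;
the A2I⁻ swapped copy keeps `X` only when `X` is on the floor, and is then the row `P{O, hI, y, X}`); `P{O, hI, y, X}` — the pin `hI`
raises `y` (same `X`); `N{O, hI, hI, X}` — FORK DESCENT (§3b): two `P`-partners of the apex slot in different directions (RULE D at `N`),
the sharp X⁺ fork `xplus_fork` gives a between-sibling `N{O, hI, y′, X}`, the origin pin turns it into a CLOSER partner; descent.  This is the
step that discharges what v0.1-pre called H₁ (the `μ` rows `N{O, hI, hI, d·ℓ}`, ◇₁₀ peel rounds 9 – 14): at a floor `X` the rows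
`N{O, hI, y, X}` and `P{O, hI, y, X}` need each other at the same `X`, and only the double apex breaks the circle.  Consequences: the
origin double-apex corners `P{O, hI, hI, X}`, `X ∉ {O, hI}` (raise `X`), hence by §1 (flag `q` true) the whole ORIGIN BLOCK `{O, B, Y, X}`,
`X ∉ {O, hI}` (T8d). -/

/-- **H₁ — the origin–double-apex rows over the floor**: no `N{O, hI, hI, F} ∈ C.lower` with `F ≠ O` on the floor (`F = d·ℓ_ψ`,
`1 ≤ d ≤ μ`; `μ` orbits of ◇_{2μ}, peel rounds 9 – 14 at ◇₁₀).  PROVED below (`originApexFloorRowFree_holds`, via fork descent); kept as a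
named statement because it is the one leaf of the origin rows that no pin move reaches. -/
def OriginApexFloorRowFree (C : MConfig) (h : ℤ) : Prop :=
  ∀ N ∈ C.lower, N 0 = (0, 0, 0) → N 1 = (h, 0, 0) → N 2 = (h, 0, 0) → OnFloor (N 3) → N 3 ≠ (0, 0, 0) → False

/-- classification: a non-apex ceiling point of ◇_{2μ} is a ceiling-line letter `y(w, K)`, `0 ≤ K ≤ μ − 1`. -/
theorem exists_eq_ceilLetter {h μ : ℤ} (hh : h = 2 * μ) {z : BPoint} (hz : InDiamond h z) (hc : OnCeiling h z) (hne : z ≠ (h, 0, 0)) :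
    ∃ w : Fin 4, ∃ K : ℤ, 0 ≤ K ∧ K ≤ μ - 1 ∧ z = ceilLetter h w K := by
  obtain ⟨α, a, b⟩ := z
  have hax := hz.1
  have hle := hz.2.1
  simp only [OnCeiling, absCharge, chargeOf, AxisPt, Prod.mk.injEq, ne_eq] at hc hax hle hne
  rcases hax with ⟨ha, hb⟩ | ⟨ha, hb⟩ | ⟨ha, hb⟩
  · subst ha; subst hb; simp at hc; exact absurd ⟨hc, rfl, rfl⟩ hne
  · subst hb
    rcases lt_or_gt_of_ne ha with hneg | hpos
    · rw [sub_zero, abs_of_neg hneg] at hc hle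
      exact ⟨2, -a - 1, by omega, by omega, by (ext <;> simp [ray]); omega⟩
    · rw [sub_zero, abs_of_pos hpos] at hc hle
      exact ⟨0, a - 1, by omega, by omega, by (ext <;> simp [ray]); omega⟩
  · subst ha
    rcases lt_or_gt_of_ne hb with hneg | hpos
    · rw [zero_sub, abs_neg, abs_of_neg hneg] at hc hle
      exact ⟨1, -b - 1, by omega, by omega, by (ext <;> simp [ray]); omega⟩
    · rw [zero_sub, abs_neg, abs_of_pos hpos] at hc hle
      exact ⟨3, b - 1, by omega, by omega, by (ext <;> simp [ray]); omega⟩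

/-! ### §3a the three moves at a fixed `X` -/

/-- **row `N{O, hI, y(w,K), X}`, `K ≥ 0`**: the origin pin lowers `X`; children `P{O, hI, y, X′}` with `X′ ≠ O` strictly lower (`ihB`), or —
only when `X` is on the floor — the A2I⁻ copy `P{O, hI, y, X}` itself (`sameB`). -/
theorem originApex_stepA {h K : ℤ} {C : MConfig} (hU : C.InDiamond h) (hDN : ∀ Z ∈ C.lower, RuleDMu4N C Z) (hA : A2IMinusClosed C)
    (hGl : PermClosed C.lower) (hGu : PermClosed C.upper) {w : Fin 4} {x : BPoint} (hx : x ≠ (0, 0, 0))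
    (ihB : ∀ P ∈ C.upper, P 0 = (0, 0, 0) → P 1 = (h, 0, 0) → P 2 = ceilLetter h w K → P 3 ≠ (0, 0, 0) → (P 3).1 < x.1 → False)
    (sameB : OnFloor x → ∀ P ∈ C.upper, P 0 = (0, 0, 0) → P 1 = (h, 0, 0) → P 2 = ceilLetter h w K → P 3 = x → False)
    {N : MCell} (hN : N ∈ C.lower) (h0 : N 0 = (0, 0, 0)) (h1 : N 1 = (h, 0, 0)) (h2 : N 2 = ceilLetter h w K) (h3 : N 3 = x) : False := by
  obtain ⟨hN', e0, e1, e2, e3⟩ := perm23_lower hGl hN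
  refine originPin_lower_step' hU hDN hA hGl hGu hN' (e0.trans h0) (by rw [e2, h3]; exact hx) fun P hP hP0 hP1 hP3 hle => ?_
  by_contra hP2
  obtain ⟨hP', f0, f1, f2, f3⟩ := perm23_upper hGu hP
  rcases hle with hlt | ⟨heq, hflx⟩
  · exact ihB _ hP' (f0.trans hP0) (by rw [f1, hP1, e1, h1]) (by rw [f2, hP3, e3, h2]) (by rw [f3]; exact hP2)
      (by rw [f3, ← h3, ← e2]; exact hlt)
  · exact sameB (by rw [← h3, ← e2]; exact hflx) _ hP' (f0.trans hP0) (by rw [f1, hP1, e1, h1]) (by rw [f2, hP3, e3, h2])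
      (by rw [f3, heq, e2, h3])

/-- **row `N{F, hI, hI, X}`, `F` on the floor**: the X⁺ fork at the double apex (§2 `doubleApexN_absent`); its siblings are the rows
`N{F, hI, y(w,K), X}`, `K ≥ 0` (`hAy`). -/
theorem apex_stepFork {h μ : ℤ} {C : MConfig} (hU : C.InDiamond h) (hDN : ∀ Z ∈ C.lower, RuleDMu4N C Z) (hX : XPlusClosed C)
    (hh : h = 2 * μ) (hμ : 1 ≤ μ) {F : BPoint} (hF : OnFloor F) {x : BPoint}
    (hAy : ∀ w : Fin 4, ∀ K : ℤ, 0 ≤ K → K ≤ μ - 1 → ∀ N ∈ C.lower, N 0 = F → N 1 = (h, 0, 0) → N 2 = ceilLetter h w K → N 3 = x → False)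
    {N : MCell} (hN : N ∈ C.lower) (h0 : N 0 = F) (h1 : N 1 = (h, 0, 0)) (h2 : N 2 = (h, 0, 0)) (h3 : N 3 = x) : False :=
  doubleApexN_absent hU hDN hX (by omega) hN (by rw [h0]; exact hF) h1 h2 fun X hXl hXa hna hXc => by
    obtain ⟨w, K, hK0, hKμ, hX2⟩ := exists_eq_ceilLetter hh (hU.1 X hXl 2) hXc (fun e => hna (by rw [e]; exact ⟨rfl, rfl⟩))
    exact hAy w K hK0 hKμ X hXl ((hXa 0 (by decide)).trans h0) ((hXa 1 (by decide)).trans h1) hX2 ((hXa 3 (by decide)).trans h3)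

/-- **row `P{F, hI, y(w,K), X}`, `K ≥ 0`** (any `F`): the pin `hI` raises `y` inward to `y(w, K′)`, `−1 ≤ K′ < K` (`hAup`, same `X`). -/
theorem apex_stepB {h K : ℤ} {C : MConfig} (hU : C.InDiamond h) (hDP : ∀ P ∈ C.upper, RuleDMu4P C P) {F : BPoint} {w : Fin 4}
    (hK0 : 0 ≤ K) {x : BPoint}
    (hAup : ∀ K' : ℤ, -1 ≤ K' → K' < K → ∀ N ∈ C.lower, N 0 = F → N 1 = (h, 0, 0) → N 2 = ceilLetter h w K' → N 3 = x → False)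
    {P : MCell} (hP : P ∈ C.upper) (h0 : P 0 = F) (h1 : P 1 = (h, 0, 0)) (h2 : P 2 = ceilLetter h w K) (h3 : P 3 = x) : False := by
  have hgc1 : OnCeiling h (P 1) := by rw [h1]; exact onCeiling_apex h
  obtain ⟨N, hN, hagree, e, he1, heK, hN2⟩ := upLine_ceilLetter' hU hP (hDP P hP) (g := 1) (j := 2) (by decide) hgc1 hK0 h2
  exact hAup (K - e) (by omega) (by omega) N hN ((hagree 0 (by decide)).trans h0) ((hagree 1 (by decide)).trans h1) hN2
    ((hagree 3 (by decide)).trans h3)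

/-- **row `N{F, hI, y(w,K), X}`, `F ≠ O` on the floor** (used in §4): the floor letter `F` has `X` served BELOW at `N` — children
`P{F, hI, y, X′}` with `X′` STRICTLY lower (`ihB`; `X′ = O` included). -/
theorem floorApex_stepA {h K : ℤ} {C : MConfig} (hU : C.InDiamond h) (hDN : ∀ Z ∈ C.lower, RuleDMu4N C Z) {F : BPoint} (hF : OnFloor F)
    {w : Fin 4} {x : BPoint} (hx : x ≠ (0, 0, 0))
    (ihB : ∀ P ∈ C.upper, P 0 = F → P 1 = (h, 0, 0) → P 2 = ceilLetter h w K → (P 3).1 < x.1 → False)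
    {N : MCell} (hN : N ∈ C.lower) (h0 : N 0 = F) (h1 : N 1 = (h, 0, 0)) (h2 : N 2 = ceilLetter h w K) (h3 : N 3 = x) : False := by
  obtain ⟨k, hk, hk0⟩ := exists_frame_ne_zero (hU.1 N hN 3).1 (by rw [h3]; exact hx)
  obtain ⟨r, -, P, hP, hNP⟩ := servedBelow_floor_dir hU hN (hDN N hN) (i := 0) (g := 3) (by decide) (by rw [h0]; exact hF) hk hk0
  exact ihB P hP ((hNP.1 0 (by decide)).trans h0) ((hNP.1 1 (by decide)).trans h1) ((hNP.1 2 (by decide)).trans h2)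
    (by rw [← h3]; exact hNP.2.1)

/-! ### §3b the double apex `N{O, hI, hI, X}` from the rows below `X` alone: X⁺ FORK DESCENT (this is where H₁ is discharged) -/

/-- **fork descent.** [◇_h, RULE D at `N`, X⁺, A2I⁻, `S₄`]  If `Z = N{O, hI, hI, X}` (`X ≠ O`) is present then RULE D at `Z` (floor letter `O`,
slot `2`) gives two `P`-partners `P{O, hI, y, X}` below the apex slot in DIFFERENT directions; the sharp X⁺ fork `xplus_fork` puts an `N`-sibling
`N{O, hI, y′, X}` strictly between a partner and the apex on that partner's ray; by the origin pin (`originApex_stepA`; the rows below `X` are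
absent by `ih`) its A2I⁻ companion `P{O, hI, y′, X}` is present — a partner in the same direction strictly closer to the apex.  Descent on the
total depth of the two partners.  No hypothesis on `X` (floor or not). -/
theorem originApex_forkDescent {h μ : ℤ} {C : MConfig} (hU : C.InDiamond h) (hDN : ∀ Z ∈ C.lower, RuleDMu4N C Z) (hX : XPlusClosed C)
    (hA : A2IMinusClosed C) (hGl : PermClosed C.lower) (hGu : PermClosed C.upper) (hh : h = 2 * μ) (hμ : 1 ≤ μ) {x : BPoint}
    (hx : x ≠ (0, 0, 0))
    (ih : ∀ w : Fin 4, ∀ K : ℤ, 0 ≤ K → K ≤ μ - 1 →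
      ∀ P ∈ C.upper, P 0 = (0, 0, 0) → P 1 = (h, 0, 0) → P 2 = ceilLetter h w K → P 3 ≠ (0, 0, 0) → (P 3).1 < x.1 → False)
    {Z : MCell} (hZ : Z ∈ C.lower) (h0 : Z 0 = (0, 0, 0)) (h1 : Z 1 = (h, 0, 0)) (h2 : Z 2 = (h, 0, 0)) (h3 : Z 3 = x) : False := by
  have hZ21 : (Z 2).1 = h := by rw [h2]
  -- (AB) an `N`-sibling of `Z` at slot `2` carrying a non-apex ceiling letter has a `P`-companion with the same four letters
  have hAB : ∀ X ∈ C.lower, MAgree X Z 2 → (X 2).1 < h → OnCeiling h (X 2) → ∃ P ∈ C.upper, MAgree P Z 2 ∧ P 2 = X 2 := by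
    intro X hXl hag hlt hc
    obtain ⟨w, K, hK0, hKμ, hX2⟩ := exists_eq_ceilLetter hh (hU.1 X hXl 2) hc (fun e => by rw [e] at hlt; exact lt_irrefl _ hlt)
    by_contra hno
    refine originApex_stepA hU hDN hA hGl hGu hx (ih w K hK0 hKμ) (fun _ P hP hP0 hP1 hP2 hP3 => hno ⟨P, hP, ?_, hP2.trans hX2.symm⟩)
      hXl ((hag 0 (by decide)).trans h0) ((hag 1 (by decide)).trans h1) hX2 ((hag 3 (by decide)).trans h3)
    intro g hg
    fin_cases g
    · exact hP0.trans h0.symm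
    · exact hP1.trans h1.symm
    · exact absurd rfl hg
    · exact hP3.trans h3.symm
  -- descent on the total depth of two partners in different directions
  have desc : ∀ m : ℕ, ∀ r₁ r₂ : Fin 4, r₂ ≠ r₁ → ∀ P₁ ∈ C.upper, ∀ P₂ ∈ C.upper, UPartner Z P₁ 2 r₁ → UPartner Z P₂ 2 r₂ →
      (h - (P₁ 2).1) + (h - (P₂ 2).1) ≤ m → False := by
    intro m
    induction m with
    | zero => intro r₁ r₂ _ P₁ _ P₂ _ hu1 hu2 hm; have := hu1.2.1; have := hu2.2.1; push_cast at hm; omega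
    | succ m ihm =>
      intro r₁ r₂ hr P₁ hP₁ P₂ hP₂ hu1 hu2 hm
      have h1ray : ((h, 0, 0) : BPoint) = ray (P₁ 2) r₁ ((Z 2).1 - (P₁ 2).1) := h2.symm.trans hu1.2.2
      refine xplus_fork hU hX hZ (g := 2) (f := 1) (by decide) h1 hP₁ hP₂ hr hu1 hu2
        (not_isApex_below_apex (by have := hu1.2.1; omega) h1ray) ?_ ?_ ?_
      · -- an `N`-server of `P₁` strictly below the apex on the `r₁`-ray: a between-sibling, hence a closer `r₁`-partner
        intro X hXl hu
        by_contra hle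
        have hlt : (X 2).1 < (Z 2).1 := not_le.mp hle
        have hagZ : MAgree X Z 2 := fun j hj => (hu.1 j hj).symm.trans (hu1.1 j hj)
        have hXc : OnCeiling h (X 2) := onCeiling_between h1ray hu.2.2 (by omega)
        obtain ⟨P', hP', hag', hP'2⟩ := hAB X hXl hagZ (by omega) hXc
        have hray' : Z 2 = ray (X 2) r₁ ((Z 2).1 - (X 2).1) := by
          have eZ := hu1.2.2
          have eX := hu.2.2
          calc Z 2 = ray (P₁ 2) r₁ (((X 2).1 - (P₁ 2).1) + ((Z 2).1 - (X 2).1)) := by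
                rw [show ((X 2).1 - (P₁ 2).1) + ((Z 2).1 - (X 2).1) = (Z 2).1 - (P₁ 2).1 by ring]; exact eZ
            _ = ray (X 2) r₁ ((Z 2).1 - (X 2).1) := by rw [ray_add, ← eX]
        have hu' : UPartner Z P' 2 r₁ := ⟨hag', by rw [hP'2]; exact hlt, by rw [hP'2]; exact hray'⟩
        exact ihm r₁ r₂ hr P' hP' P₂ hP₂ hu' hu2 (by rw [hP'2]; have := hu.2.1; push_cast at hm ⊢; omega)
      · -- an `N`-twin strictly between `P₂ 2` and the apex on the `r₂`-ray: a closer `r₂`-partner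
        intro X hXl hag hlt1 hlt2 hray
        have hray1 : ((h, 0, 0) : BPoint) = ray (X 2) r₂ (h - (X 2).1) := by rw [← h2, ← hZ21]; exact hray
        have hXc : OnCeiling h (X 2) := onCeiling_between hray1 (ray_zero (X 2) r₂).symm (by omega)
        obtain ⟨P', hP', hag', hP'2⟩ := hAB X hXl hag (by omega) hXc
        have hu' : UPartner Z P' 2 r₂ := ⟨hag', by rw [hP'2]; exact hlt1, by rw [hP'2]; exact hray⟩
        exact ihm r₁ r₂ hr P₁ hP₁ P' hP' hu1 hu' (by rw [hP'2]; push_cast at hm ⊢; omega)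
      · -- (H-e′): every letter of ◇_h lies causally below the apex
        intro X hXl _ _ _ _
        rw [h2]; exact effective_ceilingApex_sub (hU.1 X hXl 2)
  -- two partners of the apex slot in different directions (RULE D at `N`, floor letter `O`)
  have hk : ∀ k : Fin 4, Adapted (Z 2) k := fun k => by rw [h2]; fin_cases k <;> simp [Adapted]
  have hh1 : 1 ≤ h := by omega
  have hk0 : ∀ k : Fin 4, coord (Z 2) k ≠ 0 := fun k => by rw [h2]; fin_cases k <;> simp [coord] <;> omega
  have hfl : OnFloor (Z 0) := by rw [h0]; exact onFloor_origin
  have h22 : ∀ r : Fin 4, r + 2 + 2 = r := by decide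
  obtain ⟨r₁, -, P₁, hP₁, hu1⟩ := servedBelow_floor_dir hU hZ (hDN Z hZ) (i := 0) (g := 2) (by decide) hfl (hk 0) (hk0 0)
  obtain ⟨r₂, hr₂, P₂, hP₂, hu2⟩ := servedBelow_floor_dir hU hZ (hDN Z hZ) (i := 0) (g := 2) (by decide) hfl (hk (r₁ + 2)) (hk0 (r₁ + 2))
  have hr : r₂ ≠ r₁ := fun e => hr₂ (by rw [e, h22])
  exact desc (((h - (P₁ 2).1) + (h - (P₂ 2).1)).toNat) r₁ r₂ hr P₁ hP₁ P₂ hP₂ hu1 hu2 (Int.self_le_toNat _)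

/-! ### §3c all rows at one `X`, then the induction on the height of `X` -/

/-- at a fixed `X ≠ O`: from the rows at all strictly lower `X′` (`ih`, level `P` suffices), every origin–apex row at `X`. -/
theorem originApex_atX {h μ : ℤ} {C : MConfig} (hU : C.InDiamond h) (hDN : ∀ Z ∈ C.lower, RuleDMu4N C Z)
    (hDP : ∀ P ∈ C.upper, RuleDMu4P C P) (hX : XPlusClosed C) (hA : A2IMinusClosed C) (hGl : PermClosed C.lower) (hGu : PermClosed C.upper)
    (hh : h = 2 * μ) (hμ : 1 ≤ μ) {x : BPoint} (hx : x ≠ (0, 0, 0))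
    (ih : ∀ w : Fin 4, ∀ K : ℤ, 0 ≤ K → K ≤ μ - 1 →
      ∀ P ∈ C.upper, P 0 = (0, 0, 0) → P 1 = (h, 0, 0) → P 2 = ceilLetter h w K → P 3 ≠ (0, 0, 0) → (P 3).1 < x.1 → False) :
    (∀ w : Fin 4, ∀ K : ℤ, -1 ≤ K → K ≤ μ - 1 → ∀ N ∈ C.lower, N 0 = (0, 0, 0) → N 1 = (h, 0, 0) → N 2 = ceilLetter h w K → N 3 = x → False) ∧
    (∀ w : Fin 4, ∀ K : ℤ, 0 ≤ K → K ≤ μ - 1 → ∀ P ∈ C.upper, P 0 = (0, 0, 0) → P 1 = (h, 0, 0) → P 2 = ceilLetter h w K → P 3 = x → False) := by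
  -- stage 2: the double-apex row `N{O, hI, hI, X}` — fork descent (§3b; off the floor the plain fork `apex_stepFork` with stage 1 also works)
  have stage2 : ∀ N ∈ C.lower, N 0 = (0, 0, 0) → N 1 = (h, 0, 0) → N 2 = (h, 0, 0) → N 3 = x → False :=
    fun N hN h0 h1 h2 h3 => originApex_forkDescent hU hDN hX hA hGl hGu hh hμ hx ih hN h0 h1 h2 h3
  -- stage 3: inner induction on `K`: rows `P{O, hI, y(w,K), X}` and `N{O, hI, y(w,K), X}` together
  have stage3 : ∀ n : ℕ, ∀ w : Fin 4, ∀ K : ℤ, 0 ≤ K → K ≤ μ - 1 → K < n →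
      (∀ P ∈ C.upper, P 0 = (0, 0, 0) → P 1 = (h, 0, 0) → P 2 = ceilLetter h w K → P 3 = x → False) ∧
      (∀ N ∈ C.lower, N 0 = (0, 0, 0) → N 1 = (h, 0, 0) → N 2 = ceilLetter h w K → N 3 = x → False) := by
    intro n
    induction n with
    | zero => intro w K hK0 _ hKn; exact absurd hKn (by omega)
    | succ n ihn =>
      intro w K hK0 hKμ hKn
      have hB : ∀ P ∈ C.upper, P 0 = (0, 0, 0) → P 1 = (h, 0, 0) → P 2 = ceilLetter h w K → P 3 = x → False :=
        fun P hP h0 h1 h2 h3 => apex_stepB hU hDP hK0 (fun K' hK'1 hK'K N hN hN0 hN1 hN2 hN3 => by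
          rcases (show K' = -1 ∨ 0 ≤ K' by omega) with hKn1 | hK'0
          · subst hKn1; exact stage2 N hN hN0 hN1 (hN2.trans (ceilLetter_neg_one h w)) hN3
          · exact (ihn w K' hK'0 (by omega) (by omega)).2 N hN hN0 hN1 hN2 hN3) hP h0 h1 h2 h3
      exact ⟨hB, fun N hN h0 h1 h2 h3 => originApex_stepA hU hDN hA hGl hGu hx (ih w K hK0 hKμ) (fun _ => hB) hN h0 h1 h2 h3⟩
  refine ⟨fun w K hK1 hKμ N hN h0 h1 h2 h3 => ?_, fun w K hK0 hKμ => (stage3 (K.toNat + 1) w K hK0 hKμ (by omega)).1⟩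
  rcases (show K = -1 ∨ 0 ≤ K by omega) with hKn1 | hK0
  · subst hKn1; exact stage2 N hN h0 h1 (h2.trans (ceilLetter_neg_one h w)) h3
  · exact (stage3 (K.toNat + 1) w K hK0 hKμ (by omega)).2 N hN h0 h1 h2 h3

/-- the induction on the height of `X`. -/
theorem originApex_aux {h μ : ℤ} {C : MConfig} (hU : C.InDiamond h) (hDN : ∀ Z ∈ C.lower, RuleDMu4N C Z)
    (hDP : ∀ P ∈ C.upper, RuleDMu4P C P) (hX : XPlusClosed C) (hA : A2IMinusClosed C) (hGl : PermClosed C.lower) (hGu : PermClosed C.upper)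
    (hh : h = 2 * μ) (hμ : 1 ≤ μ) :
    ∀ t : ℕ, ∀ x : BPoint, x ≠ (0, 0, 0) → x.1 ≤ t →
      (∀ w : Fin 4, ∀ K : ℤ, -1 ≤ K → K ≤ μ - 1 → ∀ N ∈ C.lower, N 0 = (0, 0, 0) → N 1 = (h, 0, 0) → N 2 = ceilLetter h w K → N 3 = x → False) ∧
      (∀ w : Fin 4, ∀ K : ℤ, 0 ≤ K → K ≤ μ - 1 → ∀ P ∈ C.upper, P 0 = (0, 0, 0) → P 1 = (h, 0, 0) → P 2 = ceilLetter h w K → P 3 = x → False) := by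
  intro t
  induction t with
  | zero =>
    intro x hx hxt
    exact originApex_atX hU hDN hDP hX hA hGl hGu hh hμ hx fun w K _ _ P hP _ _ _ _ hlt => by
      have := fst_nonneg_of_inDiamond (hU.2 P hP 3); push_cast at hxt; omega
  | succ t iht =>
    intro x hx hxt
    exact originApex_atX hU hDN hDP hX hA hGl hGu hh hμ hx fun w K hK0 hKμ P hP h0 h1 h2 h3 hlt =>
      (iht (P 3) h3 (by push_cast at hxt; omega)).2 w K hK0 hKμ P hP h0 h1 h2 rfl

/-! ### §3d T8c: the origin–apex rows -/

/-- **T8c, level `N`.** [◇_h, RULE D both levels, X⁺, A2I⁻, `S₄`; `h = 2μ`, `μ ≥ 1`]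
`N{O, hI, y(w,K), X} ∉ C.lower` for every `−1 ≤ K ≤ μ − 1` (`K = −1`: the double apex `N{O, hI, hI, X}`) and EVERY `X ≠ O`. -/
theorem originApexRowN_absent {h μ K : ℤ} {C : MConfig} (hU : C.InDiamond h) (hDN : ∀ Z ∈ C.lower, RuleDMu4N C Z)
    (hDP : ∀ P ∈ C.upper, RuleDMu4P C P) (hX : XPlusClosed C) (hA : A2IMinusClosed C) (hGl : PermClosed C.lower) (hGu : PermClosed C.upper)
    (hh : h = 2 * μ) (hμ : 1 ≤ μ) {w : Fin 4} (hK1 : -1 ≤ K) (hKμ : K ≤ μ - 1) {N : MCell}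
    (h0 : N 0 = (0, 0, 0)) (h1 : N 1 = (h, 0, 0)) (h2 : N 2 = ceilLetter h w K) (h3 : N 3 ≠ (0, 0, 0)) : N ∉ C.lower := fun hN =>
  (originApex_aux hU hDN hDP hX hA hGl hGu hh hμ (N 3).1.toNat (N 3) h3 (Int.self_le_toNat _)).1 w K hK1 hKμ N hN h0 h1 h2 rfl

/-- **T8c, the origin double apex.** [same]  `N{O, hI, hI, X} ∉ C.lower` for every `X ≠ O` (floor `X` included: H₁). -/
theorem originDoubleApexN_absent {h μ : ℤ} {C : MConfig} (hU : C.InDiamond h) (hDN : ∀ Z ∈ C.lower, RuleDMu4N C Z)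
    (hDP : ∀ P ∈ C.upper, RuleDMu4P C P) (hX : XPlusClosed C) (hA : A2IMinusClosed C) (hGl : PermClosed C.lower) (hGu : PermClosed C.upper)
    (hh : h = 2 * μ) (hμ : 1 ≤ μ) {N : MCell} (h0 : N 0 = (0, 0, 0)) (h1 : N 1 = (h, 0, 0))
    (h2 : N 2 = (h, 0, 0)) (h3 : N 3 ≠ (0, 0, 0)) : N ∉ C.lower :=
  originApexRowN_absent hU hDN hDP hX hA hGl hGu hh hμ (w := 0) (K := -1) le_rfl (by omega) h0 h1
    (h2.trans (ceilLetter_neg_one h 0).symm) h3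

/-- **H₁ holds.** [same]  `OriginApexFloorRowFree C h`: the `μ` rows `N{O, hI, hI, d·ℓ}` are absent (◇₁₀: peel rounds 9 – 14). -/
theorem originApexFloorRowFree_holds {h μ : ℤ} {C : MConfig} (hU : C.InDiamond h) (hDN : ∀ Z ∈ C.lower, RuleDMu4N C Z)
    (hDP : ∀ P ∈ C.upper, RuleDMu4P C P) (hX : XPlusClosed C) (hA : A2IMinusClosed C) (hGl : PermClosed C.lower) (hGu : PermClosed C.upper)
    (hh : h = 2 * μ) (hμ : 1 ≤ μ) : OriginApexFloorRowFree C h := fun _ hN h0 h1 h2 _ h3 =>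
  originDoubleApexN_absent hU hDN hDP hX hA hGl hGu hh hμ h0 h1 h2 h3 hN

/-- **T8c, level `P`.** [same]  `P{O, hI, y(w,K), X} ∉ C.upper` for every `0 ≤ K ≤ μ − 1` and EVERY `X ≠ O`. -/
theorem originApexRowP_absent {h μ K : ℤ} {C : MConfig} (hU : C.InDiamond h) (hDN : ∀ Z ∈ C.lower, RuleDMu4N C Z)
    (hDP : ∀ P ∈ C.upper, RuleDMu4P C P) (hX : XPlusClosed C) (hA : A2IMinusClosed C) (hGl : PermClosed C.lower) (hGu : PermClosed C.upper)
    (hh : h = 2 * μ) (hμ : 1 ≤ μ) {w : Fin 4} (hK0 : 0 ≤ K) (hKμ : K ≤ μ - 1) {P : MCell}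
    (h0 : P 0 = (0, 0, 0)) (h1 : P 1 = (h, 0, 0)) (h2 : P 2 = ceilLetter h w K) (h3 : P 3 ≠ (0, 0, 0)) : P ∉ C.upper := fun hP =>
  (originApex_aux hU hDN hDP hX hA hGl hGu hh hμ (P 3).1.toNat (P 3) h3 (Int.self_le_toNat _)).2 w K hK0 hKμ P hP h0 h1 h2 rfl

/-- **the origin double-apex corners** [same]: `P{O, hI, hI, X} ∉ C.upper` for `X ∉ {O, hI}` — the pin `hI` raises `X`, the
server is an origin double-apex row.  I.e. `CornerFree C h μ True φ 0`. -/
theorem originCornerFree {h μ : ℤ} {C : MConfig} (hU : C.InDiamond h) (hDN : ∀ Z ∈ C.lower, RuleDMu4N C Z)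
    (hDP : ∀ P ∈ C.upper, RuleDMu4P C P) (hX : XPlusClosed C) (hA : A2IMinusClosed C) (hGl : PermClosed C.lower) (hGu : PermClosed C.upper)
    (hh : h = 2 * μ) (hμ : 1 ≤ μ) (φ : Fin 4) : CornerFree C h μ True φ 0 := by
  intro P hP h0 h1 h2 h3 h3h
  have hXI : P 3 ≠ (h, 0, 0) := h3h (Or.inr trivial)
  have hgc1 : OnCeiling h (P 1) := by rw [h1]; exact onCeiling_apex h
  obtain ⟨k, hk, hkh⟩ := exists_frame_ne_h (hU.2 P hP 3) hXI
  obtain ⟨r, N, hN, hNP⟩ := servedAbove_ceiling_apex hU hP (hDP P hP) (g := 1) (j := 3) (by decide) hgc1 hk hkh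
  have hN3 : N 3 ≠ (0, 0, 0) := fun e => by
    have h0le : 0 ≤ (P 3).1 := fst_nonneg_of_inDiamond (hU.2 P hP 3)
    have := hNP.2.1; rw [e] at this; simp only at this; omega
  exact originDoubleApexN_absent hU hDN hDP hX hA hGl hGu hh hμ ((hNP.1 0 (by decide)).symm.trans (h0.trans (ray_zero _ φ)))
    ((hNP.1 1 (by decide)).symm.trans h1) ((hNP.1 2 (by decide)).symm.trans h2) hN3 hN

/-! ### §3e T8d: the origin block -/

/-- **T8d, level `P`.** [◇_h, RULE D both levels, X⁺, A2I⁻, `S₄` both levels; `h = 2μ`, `μ ≥ 1`]  `P{O, B, Y, X} ∉ C.upper` for every boundary letter `B` (`IsBdry`: `c′·ℓ_u`, `0 ≤ c′ ≤ μ−1`, or `y(u,K′)`, `−1 ≤ K′ ≤ μ−1`),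
every ceiling letter `Y` (`IsCeil`) and EVERY `X ∉ {O, hI}`.  Census (`tools/famAC.py`, T8c ∪ T8d): ◇₁₀ 12 722 + 575 members, 0 SURVIVORS. -/
theorem originBlockP_absent {h μ : ℤ} {C : MConfig} (hU : C.InDiamond h) (hDN : ∀ Z ∈ C.lower, RuleDMu4N C Z)
    (hDP : ∀ P ∈ C.upper, RuleDMu4P C P) (hX : XPlusClosed C) (hA : A2IMinusClosed C) (hGl : PermClosed C.lower) (hGu : PermClosed C.upper)
    (hh : h = 2 * μ) (hμ : 1 ≤ μ) {P : MCell} (h0 : P 0 = (0, 0, 0)) (hB : IsBdry h μ (P 1))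
    (hY : IsCeil h μ (P 2)) (h3 : P 3 ≠ (0, 0, 0)) (h3I : P 3 ≠ (h, 0, 0)) : P ∉ C.upper :=
  originBdryBlockP_of_cornerFree hU hDN hDP hA hGl hGu hh hμ (originCornerFree hU hDN hDP hX hA hGl hGu hh hμ 0) h0 hB hY h3 fun _ => h3I

/-- **T8d, level `N`.** [same]  `N{O, B, Y, X} ∉ C.lower` for every boundary `B`, every ceiling `Y` and every `X ∉ {O, hI}`. -/
theorem originBlockN_absent {h μ : ℤ} {C : MConfig} (hU : C.InDiamond h) (hDN : ∀ Z ∈ C.lower, RuleDMu4N C Z)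
    (hDP : ∀ P ∈ C.upper, RuleDMu4P C P) (hX : XPlusClosed C) (hA : A2IMinusClosed C) (hGl : PermClosed C.lower) (hGu : PermClosed C.upper)
    (hh : h = 2 * μ) (hμ : 1 ≤ μ) {N : MCell} (h0 : N 0 = (0, 0, 0)) (hB : IsBdry h μ (N 1))
    (hY : IsCeil h μ (N 2)) (h3 : N 3 ≠ (0, 0, 0)) : N ∉ C.lower :=
  originBdryBlockN_of_cornerFree hU hDN hDP hA hGl hGu hh hμ (originCornerFree hU hDN hDP hX hA hGl hGu hh hμ 0) h0 hB hY h3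

/-- **T8d in letters, level `P`**: `P{O, c′·ℓ_u, y(w,K), X} ∉ C.upper`, `0 ≤ c′ ≤ μ`, `−1 ≤ K ≤ μ − 1`, `X ∉ {O, hI}`. -/
theorem originFloorCeilP_absent {h μ c' K : ℤ} {C : MConfig} (hU : C.InDiamond h) (hDN : ∀ Z ∈ C.lower, RuleDMu4N C Z)
    (hDP : ∀ P ∈ C.upper, RuleDMu4P C P) (hX : XPlusClosed C) (hA : A2IMinusClosed C) (hGl : PermClosed C.lower) (hGu : PermClosed C.upper)
    (hh : h = 2 * μ) (hμ : 1 ≤ μ) {u w : Fin 4} (hc'0 : 0 ≤ c') (hc'μ : c' ≤ μ) (hK1 : -1 ≤ K)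
    (hKμ : K ≤ μ - 1) {P : MCell} (h0 : P 0 = (0, 0, 0)) (h1 : P 1 = floorLetter u c') (h2 : P 2 = ceilLetter h w K) (h3 : P 3 ≠ (0, 0, 0))
    (h3I : P 3 ≠ (h, 0, 0)) : P ∉ C.upper :=
  originBlockP_absent hU hDN hDP hX hA hGl hGu hh hμ h0
    (by rcases (show c' ≤ μ - 1 ∨ c' = μ by omega) with hl | hm
        · rw [h1]; exact isBdry_floorLetter u hc'0 hl
        · rw [h1, hm]; exact isBdry_floorLetter_mu hh (by omega) u)
    (by rw [h2]; exact isCeil_ceilLetter w hK1 hKμ) h3 h3I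

/-- **T8d in letters, level `N`**: `N{O, c′·ℓ_u, y(w,K), X} ∉ C.lower`, `0 ≤ c′ ≤ μ`, `−1 ≤ K ≤ μ − 1`, `X ≠ O` (for `X = hI` use
`originApexRowN_absent` ∕ T8c). -/
theorem originFloorCeilN_absent {h μ c' K : ℤ} {C : MConfig} (hU : C.InDiamond h) (hDN : ∀ Z ∈ C.lower, RuleDMu4N C Z)
    (hDP : ∀ P ∈ C.upper, RuleDMu4P C P) (hX : XPlusClosed C) (hA : A2IMinusClosed C) (hGl : PermClosed C.lower) (hGu : PermClosed C.upper)
    (hh : h = 2 * μ) (hμ : 1 ≤ μ) {u w : Fin 4} (hc'0 : 0 ≤ c') (hc'μ : c' ≤ μ) (hK1 : -1 ≤ K)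
    (hKμ : K ≤ μ - 1) {N : MCell} (h0 : N 0 = (0, 0, 0)) (h1 : N 1 = floorLetter u c') (h2 : N 2 = ceilLetter h w K) (h3 : N 3 ≠ (0, 0, 0)) :
    N ∉ C.lower :=
  originBlockN_absent hU hDN hDP hX hA hGl hGu hh hμ h0
    (by rcases (show c' ≤ μ - 1 ∨ c' = μ by omega) with hl | hm
        · rw [h1]; exact isBdry_floorLetter u hc'0 hl
        · rw [h1, hm]; exact isBdry_floorLetter_mu hh (by omega) u)
    (by rw [h2]; exact isCeil_ceilLetter w hK1 hKμ) h3

/-- **T8d in letters, two ceiling letters, level `P`**: `P{O, y(u,K′), y(w,K), X} ∉ C.upper`, `−1 ≤ K′, K ≤ μ − 1`, `X ∉ {O, hI}`. -/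
theorem originCeilCeilP_absent {h μ K' K : ℤ} {C : MConfig} (hU : C.InDiamond h) (hDN : ∀ Z ∈ C.lower, RuleDMu4N C Z)
    (hDP : ∀ P ∈ C.upper, RuleDMu4P C P) (hX : XPlusClosed C) (hA : A2IMinusClosed C) (hGl : PermClosed C.lower) (hGu : PermClosed C.upper)
    (hh : h = 2 * μ) (hμ : 1 ≤ μ) {u w : Fin 4} (hK'1 : -1 ≤ K') (hK'μ : K' ≤ μ - 1) (hK1 : -1 ≤ K)
    (hKμ : K ≤ μ - 1) {P : MCell} (h0 : P 0 = (0, 0, 0)) (h1 : P 1 = ceilLetter h u K') (h2 : P 2 = ceilLetter h w K) (h3 : P 3 ≠ (0, 0, 0))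
    (h3I : P 3 ≠ (h, 0, 0)) : P ∉ C.upper :=
  originBlockP_absent hU hDN hDP hX hA hGl hGu hh hμ h0 (by rw [h1]; exact isBdry_ceilLetter u hK'1 hK'μ)
    (by rw [h2]; exact isCeil_ceilLetter w hK1 hKμ) h3 h3I

/-- **T8d in letters, two ceiling letters, level `N`**: `N{O, y(u,K′), y(w,K), X} ∉ C.lower`, `−1 ≤ K′, K ≤ μ − 1`, `X ≠ O`. -/
theorem originCeilCeilN_absent {h μ K' K : ℤ} {C : MConfig} (hU : C.InDiamond h) (hDN : ∀ Z ∈ C.lower, RuleDMu4N C Z)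
    (hDP : ∀ P ∈ C.upper, RuleDMu4P C P) (hX : XPlusClosed C) (hA : A2IMinusClosed C) (hGl : PermClosed C.lower) (hGu : PermClosed C.upper)
    (hh : h = 2 * μ) (hμ : 1 ≤ μ) {u w : Fin 4} (hK'1 : -1 ≤ K') (hK'μ : K' ≤ μ - 1) (hK1 : -1 ≤ K)
    (hKμ : K ≤ μ - 1) {N : MCell} (h0 : N 0 = (0, 0, 0)) (h1 : N 1 = ceilLetter h u K') (h2 : N 2 = ceilLetter h w K) (h3 : N 3 ≠ (0, 0, 0)) :
    N ∉ C.lower :=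
  originBlockN_absent hU hDN hDP hX hA hGl hGu hh hμ h0 (by rw [h1]; exact isBdry_ceilLetter u hK'1 hK'μ)
    (by rw [h2]; exact isCeil_ceilLetter w hK1 hKμ) h3

/-! ## §4 T8e ∕ T8 — THE ROWS `{F, hI, Y, X}` OVER A CHARGED FLOOR LETTER `F`, HENCE `SibFree`, HENCE THE WHOLE BOUNDARY BLOCK `{F, B, Y, X}`

For `F ≠ O` on the floor the row `N{F, hI, y, X}` has `X` served BELOW off the floor letter `F` (RULE D at `N`): the child `P{F, hI, y, X′}`
is STRICTLY lower in `X` — for `X′ = O` it is the origin–apex row `P{O, hI, y, F}` of §3 read backwards — so the induction on the height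
of `X` closes with no same-`X` coupling: rows `N{F, hI, y(w,K), X}` (`K ≥ −1`, the double apex by the plain fork `apex_stepFork`) and
`P{F, hI, y(w,K), X}` (`K ≥ 0`) for every `X ≠ O` (T8e).  With §3 this is exactly `SibFree` (T8b's hypothesis, `sibFree_holds`), so §2 gives
every double-apex corner (`cornerFree_holds`) and §1 the whole boundary block T8 (`bdryBlockP_absent ∕ bdryBlockN_absent`) — under the standard
hypotheses only. -/

theorem not_onFloor_apex {h : ℤ} (hh1 : 1 ≤ h) : ¬ OnFloor ((h, 0, 0) : BPoint) := by
  simp [OnFloor, absCharge, chargeOf]; omega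

/-- at a fixed `X ≠ O`, `F ≠ O` on the floor: from the `P`-rows at all strictly lower `X′ ≠ O` (`ih`) and the origin–apex rows (§3),
every row at `X`. -/
theorem floorApex_atX {h μ : ℤ} {C : MConfig} (hU : C.InDiamond h) (hDN : ∀ Z ∈ C.lower, RuleDMu4N C Z)
    (hDP : ∀ P ∈ C.upper, RuleDMu4P C P) (hX : XPlusClosed C) (hA : A2IMinusClosed C) (hGl : PermClosed C.lower) (hGu : PermClosed C.upper)
    (hh : h = 2 * μ) (hμ : 1 ≤ μ) {F : BPoint} (hF : OnFloor F) (hF0 : F ≠ (0, 0, 0)) {x : BPoint}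
    (hx : x ≠ (0, 0, 0))
    (ih : ∀ w : Fin 4, ∀ K : ℤ, 0 ≤ K → K ≤ μ - 1 →
      ∀ P ∈ C.upper, P 0 = F → P 1 = (h, 0, 0) → P 2 = ceilLetter h w K → P 3 ≠ (0, 0, 0) → (P 3).1 < x.1 → False) :
    (∀ w : Fin 4, ∀ K : ℤ, -1 ≤ K → K ≤ μ - 1 → ∀ N ∈ C.lower, N 0 = F → N 1 = (h, 0, 0) → N 2 = ceilLetter h w K → N 3 = x → False) ∧
    (∀ w : Fin 4, ∀ K : ℤ, 0 ≤ K → K ≤ μ - 1 → ∀ P ∈ C.upper, P 0 = F → P 1 = (h, 0, 0) → P 2 = ceilLetter h w K → P 3 = x → False) := by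
  have hArow : ∀ w : Fin 4, ∀ K : ℤ, 0 ≤ K → K ≤ μ - 1 →
      ∀ N ∈ C.lower, N 0 = F → N 1 = (h, 0, 0) → N 2 = ceilLetter h w K → N 3 = x → False :=
    fun w K hK0 hKμ N hN h0 h1 h2 h3 => floorApex_stepA hU hDN hF hx (fun P hP hP0 hP1 hP2 hlt => by
      by_cases hP3 : P 3 = (0, 0, 0)
      · obtain ⟨hP', f0, f1, f2, f3⟩ := perm03_upper hGu hP
        exact originApexRowP_absent hU hDN hDP hX hA hGl hGu hh hμ hK0 hKμ (f0.trans hP3) (f1.trans hP1) (f2.trans hP2)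
          (by rw [f3, hP0]; exact hF0) hP'
      · exact ih w K hK0 hKμ P hP hP0 hP1 hP2 hP3 hlt) hN h0 h1 h2 h3
  have hAall : ∀ w : Fin 4, ∀ K : ℤ, -1 ≤ K → K ≤ μ - 1 →
      ∀ N ∈ C.lower, N 0 = F → N 1 = (h, 0, 0) → N 2 = ceilLetter h w K → N 3 = x → False := by
    intro w K hK1 hKμ N hN h0 h1 h2 h3
    rcases (show K = -1 ∨ 0 ≤ K by omega) with hKn1 | hK0
    · subst hKn1; exact apex_stepFork hU hDN hX hh hμ hF hArow hN h0 h1 (h2.trans (ceilLetter_neg_one h w)) h3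
    · exact hArow w K hK0 hKμ N hN h0 h1 h2 h3
  exact ⟨hAall, fun w K hK0 hKμ P hP h0 h1 h2 h3 =>
    apex_stepB hU hDP hK0 (fun K' hK'1 hK'K => hAall w K' hK'1 (by omega)) hP h0 h1 h2 h3⟩

/-- the induction on the height of `X` (charged floor `F`). -/
theorem floorApex_aux {h μ : ℤ} {C : MConfig} (hU : C.InDiamond h) (hDN : ∀ Z ∈ C.lower, RuleDMu4N C Z)
    (hDP : ∀ P ∈ C.upper, RuleDMu4P C P) (hX : XPlusClosed C) (hA : A2IMinusClosed C) (hGl : PermClosed C.lower) (hGu : PermClosed C.upper)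
    (hh : h = 2 * μ) (hμ : 1 ≤ μ) {F : BPoint} (hF : OnFloor F) (hF0 : F ≠ (0, 0, 0)) :
    ∀ t : ℕ, ∀ x : BPoint, x ≠ (0, 0, 0) → x.1 ≤ t →
      (∀ w : Fin 4, ∀ K : ℤ, -1 ≤ K → K ≤ μ - 1 → ∀ N ∈ C.lower, N 0 = F → N 1 = (h, 0, 0) → N 2 = ceilLetter h w K → N 3 = x → False) ∧
      (∀ w : Fin 4, ∀ K : ℤ, 0 ≤ K → K ≤ μ - 1 → ∀ P ∈ C.upper, P 0 = F → P 1 = (h, 0, 0) → P 2 = ceilLetter h w K → P 3 = x → False) := by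
  intro t
  induction t with
  | zero =>
    intro x hx hxt
    exact floorApex_atX hU hDN hDP hX hA hGl hGu hh hμ hF hF0 hx fun w K _ _ P hP _ _ _ _ hlt => by
      have := fst_nonneg_of_inDiamond (hU.2 P hP 3); push_cast at hxt; omega
  | succ t iht =>
    intro x hx hxt
    exact floorApex_atX hU hDN hDP hX hA hGl hGu hh hμ hF hF0 hx fun w K hK0 hKμ P hP h0 h1 h2 h3 hlt =>
      (iht (P 3) h3 (by push_cast at hxt; omega)).2 w K hK0 hKμ P hP h0 h1 h2 rfl

/-- **T8e, level `N`.** [◇_h, RULE D both levels, X⁺, A2I⁻, `S₄`; `h = 2μ`, `μ ≥ 1`]  for `F ≠ O` on the floor: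
`N{F, hI, y(w,K), X} ∉ C.lower` for every `−1 ≤ K ≤ μ − 1` and every `X ≠ O` (`X = O`: §3 T8c with the slots `0, 3` exchanged). -/
theorem floorApexRowN_absent {h μ K : ℤ} {C : MConfig} (hU : C.InDiamond h) (hDN : ∀ Z ∈ C.lower, RuleDMu4N C Z)
    (hDP : ∀ P ∈ C.upper, RuleDMu4P C P) (hX : XPlusClosed C) (hA : A2IMinusClosed C) (hGl : PermClosed C.lower) (hGu : PermClosed C.upper)
    (hh : h = 2 * μ) (hμ : 1 ≤ μ) {F : BPoint} (hF : OnFloor F) (hF0 : F ≠ (0, 0, 0)) {w : Fin 4}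
    (hK1 : -1 ≤ K) (hKμ : K ≤ μ - 1) {N : MCell} (h0 : N 0 = F) (h1 : N 1 = (h, 0, 0)) (h2 : N 2 = ceilLetter h w K)
    (h3 : N 3 ≠ (0, 0, 0)) : N ∉ C.lower := fun hN =>
  (floorApex_aux hU hDN hDP hX hA hGl hGu hh hμ hF hF0 (N 3).1.toNat (N 3) h3 (Int.self_le_toNat _)).1 w K hK1 hKμ N hN h0 h1 h2 rfl

/-- **T8e, level `P`.** [same]  for `F ≠ O` on the floor: `P{F, hI, y(w,K), X} ∉ C.upper` for every `0 ≤ K ≤ μ − 1` and every `X ≠ O`. -/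
theorem floorApexRowP_absent {h μ K : ℤ} {C : MConfig} (hU : C.InDiamond h) (hDN : ∀ Z ∈ C.lower, RuleDMu4N C Z)
    (hDP : ∀ P ∈ C.upper, RuleDMu4P C P) (hX : XPlusClosed C) (hA : A2IMinusClosed C) (hGl : PermClosed C.lower) (hGu : PermClosed C.upper)
    (hh : h = 2 * μ) (hμ : 1 ≤ μ) {F : BPoint} (hF : OnFloor F) (hF0 : F ≠ (0, 0, 0)) {w : Fin 4}
    (hK0 : 0 ≤ K) (hKμ : K ≤ μ - 1) {P : MCell} (h0 : P 0 = F) (h1 : P 1 = (h, 0, 0)) (h2 : P 2 = ceilLetter h w K)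
    (h3 : P 3 ≠ (0, 0, 0)) : P ∉ C.upper := fun hP =>
  (floorApex_aux hU hDN hDP hX hA hGl hGu hh hμ hF hF0 (P 3).1.toNat (P 3) h3 (Int.self_le_toNat _)).2 w K hK0 hKμ P hP h0 h1 h2 rfl

/-- **T8b's hypothesis discharged**: `SibFree C h` holds (§3 T8c for `F = O`, T8e for `F ≠ O`). -/
theorem sibFree_holds {h μ : ℤ} {C : MConfig} (hU : C.InDiamond h) (hDN : ∀ Z ∈ C.lower, RuleDMu4N C Z)
    (hDP : ∀ P ∈ C.upper, RuleDMu4P C P) (hX : XPlusClosed C) (hA : A2IMinusClosed C) (hGl : PermClosed C.lower) (hGu : PermClosed C.upper)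
    (hh : h = 2 * μ) (hμ : 1 ≤ μ) : SibFree C h := by
  intro N hN hfl h1 hna hc h3
  obtain ⟨w, K, hK0, hKμ, h2⟩ := exists_eq_ceilLetter hh (hU.1 N hN 2) hc (fun e => hna (by rw [e]; exact ⟨rfl, rfl⟩))
  by_cases hF0 : N 0 = (0, 0, 0)
  · exact originApexRowN_absent hU hDN hDP hX hA hGl hGu hh hμ (by omega) hKμ hF0 h1 h2 h3 hN
  · exact floorApexRowN_absent hU hDN hDP hX hA hGl hGu hh hμ hfl hF0 (by omega) hKμ rfl h1 h2 h3 hN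

/-- **every double-apex corner**: `CornerFree C h μ q φ c` for all `0 ≤ c ≤ μ`, both flags — `P{c·ℓ_φ, hI, hI, X} ∉ C.upper` for `X ≠ O`,
`X ≠ hI` when `c = μ` (`P{FL, hI, hI, hI}` IS present in the census worlds). -/
theorem cornerFree_holds {h μ c : ℤ} {C : MConfig} (hU : C.InDiamond h) (hDN : ∀ Z ∈ C.lower, RuleDMu4N C Z)
    (hDP : ∀ P ∈ C.upper, RuleDMu4P C P) (hX : XPlusClosed C) (hA : A2IMinusClosed C) (hGl : PermClosed C.lower) (hGu : PermClosed C.upper)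
    (hh : h = 2 * μ) (hμ : 1 ≤ μ) (q : Prop) (φ : Fin 4) (hc0 : 0 ≤ c) (hcμ : c ≤ μ) :
    CornerFree C h μ q φ c :=
  cornerFree_of_sibFree hU hDN hDP hX hh hμ (sibFree_holds hU hDN hDP hX hA hGl hGu hh hμ) q φ hc0 hcμ

/-! ### T8 -/

/-- **T8, level `P`.** [◇_h, RULE D both levels `RuleDMu4N ∕ RuleDMu4P`, X⁺ `XPlusClosed`, A2I⁻ `A2IMinusClosed`, `S₄` both levels
`PermClosed`; `h = 2μ`, `μ ≥ 1` — nothing else]  `P{c·ℓ_φ, B, Y, X} ∉ C.upper` for every `0 ≤ c ≤ μ`, every boundary letter `B` (`IsBdry`: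
`c′·ℓ_u`, `0 ≤ c′ ≤ μ − 1`, or `y(u,K′)`, `−1 ≤ K′ ≤ μ − 1`), every ceiling letter `Y` (`IsCeil`), every `X ≠ O`, with `X ≠ hI` when `c = μ`
(or when the flag `q` holds).  Census `tools/famAC.py` (family T8, both levels): members ◇₄ 1 385 ∕ ◇₆ 10 955 ∕ ◇₈ 49 089 ∕ ◇₁₀ 157 091,
0 SURVIVORS; beyond the g18 – g23 files ◇₁₀ 124 555 (peel rounds 1 – 19). -/
theorem bdryBlockP_absent {h μ c : ℤ} {C : MConfig} (hU : C.InDiamond h) (hDN : ∀ Z ∈ C.lower, RuleDMu4N C Z)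
    (hDP : ∀ P ∈ C.upper, RuleDMu4P C P) (hX : XPlusClosed C) (hA : A2IMinusClosed C) (hGl : PermClosed C.lower) (hGu : PermClosed C.upper)
    (hh : h = 2 * μ) (hμ : 1 ≤ μ) {q : Prop} (φ : Fin 4) (hc0 : 0 ≤ c) (hcμ : c ≤ μ) {P : MCell}
    (h0 : P 0 = floorLetter φ c) (hB : IsBdry h μ (P 1)) (hY : IsCeil h μ (P 2)) (h3 : P 3 ≠ (0, 0, 0)) (h3h : c = μ ∨ q → P 3 ≠ (h, 0, 0)) :
    P ∉ C.upper :=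
  bdryBlockP_of_sibFree hU hDN hDP hX hA hGl hGu hh hμ (sibFree_holds hU hDN hDP hX hA hGl hGu hh hμ) φ hc0 hcμ h0
    hB hY h3 h3h

/-- **T8, level `N`.** [same]  `N{c·ℓ_φ, B, Y, X} ∉ C.lower` for every `0 ≤ c ≤ μ`, boundary `B`, ceiling `Y`, `X ≠ O` (no proviso). -/
theorem bdryBlockN_absent {h μ c : ℤ} {C : MConfig} (hU : C.InDiamond h) (hDN : ∀ Z ∈ C.lower, RuleDMu4N C Z)
    (hDP : ∀ P ∈ C.upper, RuleDMu4P C P) (hX : XPlusClosed C) (hA : A2IMinusClosed C) (hGl : PermClosed C.lower) (hGu : PermClosed C.upper)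
    (hh : h = 2 * μ) (hμ : 1 ≤ μ) (φ : Fin 4) (hc0 : 0 ≤ c) (hcμ : c ≤ μ) {N : MCell}
    (h0 : N 0 = floorLetter φ c) (hB : IsBdry h μ (N 1)) (hY : IsCeil h μ (N 2)) (h3 : N 3 ≠ (0, 0, 0)) : N ∉ C.lower :=
  bdryBlockN_of_sibFree hU hDN hDP hX hA hGl hGu hh hμ (sibFree_holds hU hDN hDP hX hA hGl hGu hh hμ) φ hc0 hcμ h0
    hB hY h3

/-- **T8 in letters, level `P`**: `P{c·ℓ_φ, c′·ℓ_u, y(w,K), X} ∉ C.upper` — `0 ≤ c, c′ ≤ μ`, `−1 ≤ K ≤ μ − 1`, `X ≠ O`,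
`c = μ → X ≠ hI`. -/
theorem floorFloorCeilP_absent {h μ c c' K : ℤ} {C : MConfig} (hU : C.InDiamond h) (hDN : ∀ Z ∈ C.lower, RuleDMu4N C Z)
    (hDP : ∀ P ∈ C.upper, RuleDMu4P C P) (hX : XPlusClosed C) (hA : A2IMinusClosed C) (hGl : PermClosed C.lower) (hGu : PermClosed C.upper)
    (hh : h = 2 * μ) (hμ : 1 ≤ μ) {φ u w : Fin 4} (hc0 : 0 ≤ c) (hcμ : c ≤ μ) (hc'0 : 0 ≤ c')
    (hc'μ : c' ≤ μ) (hK1 : -1 ≤ K) (hKμ : K ≤ μ - 1) {P : MCell} (h0 : P 0 = floorLetter φ c) (h1 : P 1 = floorLetter u c')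
    (h2 : P 2 = ceilLetter h w K) (h3 : P 3 ≠ (0, 0, 0)) (h3h : c = μ → P 3 ≠ (h, 0, 0)) : P ∉ C.upper :=
  floorFloorCeilP_of_sibFree hU hDN hDP hX hA hGl hGu hh hμ (sibFree_holds hU hDN hDP hX hA hGl hGu hh hμ) hc0 hcμ
    hc'0 hc'μ hK1 hKμ h0 h1 h2 h3 h3h

/-- **T8 in letters, level `N`**: `N{c·ℓ_φ, c′·ℓ_u, y(w,K), X} ∉ C.lower` — `0 ≤ c, c′ ≤ μ`, `−1 ≤ K ≤ μ − 1`, `X ≠ O`. -/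
theorem floorFloorCeilN_absent {h μ c c' K : ℤ} {C : MConfig} (hU : C.InDiamond h) (hDN : ∀ Z ∈ C.lower, RuleDMu4N C Z)
    (hDP : ∀ P ∈ C.upper, RuleDMu4P C P) (hX : XPlusClosed C) (hA : A2IMinusClosed C) (hGl : PermClosed C.lower) (hGu : PermClosed C.upper)
    (hh : h = 2 * μ) (hμ : 1 ≤ μ) {φ u w : Fin 4} (hc0 : 0 ≤ c) (hcμ : c ≤ μ) (hc'0 : 0 ≤ c')
    (hc'μ : c' ≤ μ) (hK1 : -1 ≤ K) (hKμ : K ≤ μ - 1) {N : MCell} (h0 : N 0 = floorLetter φ c) (h1 : N 1 = floorLetter u c')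
    (h2 : N 2 = ceilLetter h w K) (h3 : N 3 ≠ (0, 0, 0)) : N ∉ C.lower :=
  floorFloorCeilN_of_sibFree hU hDN hDP hX hA hGl hGu hh hμ (sibFree_holds hU hDN hDP hX hA hGl hGu hh hμ) hc0 hcμ
    hc'0 hc'μ hK1 hKμ h0 h1 h2 h3

/-- **T8 in letters, two ceiling letters, level `P`**: `P{c·ℓ_φ, y(u,K′), y(w,K), X} ∉ C.upper` — `0 ≤ c ≤ μ`,
`−1 ≤ K′, K ≤ μ − 1`, `X ≠ O`, `c = μ → X ≠ hI`. -/
theorem floorCeilCeilP_absent {h μ c K' K : ℤ} {C : MConfig} (hU : C.InDiamond h) (hDN : ∀ Z ∈ C.lower, RuleDMu4N C Z)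
    (hDP : ∀ P ∈ C.upper, RuleDMu4P C P) (hX : XPlusClosed C) (hA : A2IMinusClosed C) (hGl : PermClosed C.lower) (hGu : PermClosed C.upper)
    (hh : h = 2 * μ) (hμ : 1 ≤ μ) {φ u w : Fin 4} (hc0 : 0 ≤ c) (hcμ : c ≤ μ) (hK'1 : -1 ≤ K')
    (hK'μ : K' ≤ μ - 1) (hK1 : -1 ≤ K) (hKμ : K ≤ μ - 1) {P : MCell} (h0 : P 0 = floorLetter φ c) (h1 : P 1 = ceilLetter h u K')
    (h2 : P 2 = ceilLetter h w K) (h3 : P 3 ≠ (0, 0, 0)) (h3h : c = μ → P 3 ≠ (h, 0, 0)) : P ∉ C.upper :=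
  floorCeilCeilP_of_sibFree hU hDN hDP hX hA hGl hGu hh hμ (sibFree_holds hU hDN hDP hX hA hGl hGu hh hμ) hc0 hcμ
    hK'1 hK'μ hK1 hKμ h0 h1 h2 h3 h3h

/-- **T8 in letters, two ceiling letters, level `N`**: `N{c·ℓ_φ, y(u,K′), y(w,K), X} ∉ C.lower` — `0 ≤ c ≤ μ`,
`−1 ≤ K′, K ≤ μ − 1`, `X ≠ O`. -/
theorem floorCeilCeilN_absent {h μ c K' K : ℤ} {C : MConfig} (hU : C.InDiamond h) (hDN : ∀ Z ∈ C.lower, RuleDMu4N C Z)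
    (hDP : ∀ P ∈ C.upper, RuleDMu4P C P) (hX : XPlusClosed C) (hA : A2IMinusClosed C) (hGl : PermClosed C.lower) (hGu : PermClosed C.upper)
    (hh : h = 2 * μ) (hμ : 1 ≤ μ) {φ u w : Fin 4} (hc0 : 0 ≤ c) (hcμ : c ≤ μ) (hK'1 : -1 ≤ K')
    (hK'μ : K' ≤ μ - 1) (hK1 : -1 ≤ K) (hKμ : K ≤ μ - 1) {N : MCell} (h0 : N 0 = floorLetter φ c) (h1 : N 1 = ceilLetter h u K')
    (h2 : N 2 = ceilLetter h w K) (h3 : N 3 ≠ (0, 0, 0)) : N ∉ C.lower :=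
  floorCeilCeilN_of_sibFree hU hDN hDP hX hA hGl hGu hh hμ (sibFree_holds hU hDN hDP hX hA hGl hGu hh hμ) hc0 hcμ
    hK'1 hK'μ hK1 hKμ h0 h1 h2 h3

/-! ## §5 T9 — THE FULL FLOOR-PINNED BLOCK `{c·ℓ_φ, B, Y, X}`: THE SLOT `B` ARBITRARY

The P-move of §1 needs nothing of `B` except `B ≠ hI`: under the ceiling pin `Y` (slot `2`) RULE D at `P` serves slot `1` ABOVE in some
direction as soon as one adapted frame coordinate of `B` is not `h` (`exists_frame_ne_h`, `servedAbove_ceiling_apex`), and the server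
`N{F, B′, Y, X}` has `B′.1 > B.1` — the depth `(h − B.1) + (h − Y.1)` drops whatever `B′` is.  `B = hI`: the pin `B` raises `Y` along the
ceiling line (`upLine_ceilLetter'`) or the cell is the corner `P{F, hI, hI, X}` (§4 `cornerFree_holds`).  The N-move never looked at `B`.
So the whole §1 induction runs with `B` an ARBITRARY point of ◇_h: T9 `{c·ℓ_φ (0 ≤ c ≤ μ), B, Y ceiling, X ≠ O} ∉ E_±` (P-proviso
`c = μ → X ≠ hI` as in T8).  Census `tools/famAD.py`: members ◇₄ 1 425 ∕ ◇₆ 12 677 ∕ ◇₈ 66 093 ∕ ◇₁₀ 245 439, 0 SURVIVORS; beyond T8 and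
the g18 – g23 files ◇₈ 6 014 ∕ ◇₁₀ 50 530 (N 28 643 + P 21 887, peel rounds 2 – 16). -/

/-- **P-STEP, `B` arbitrary** (RULE D on E₊): `P{c·ℓ_φ, B, Y, X}` (`X ≠ O`; `X ≠ hI` if `c = μ ∨ q`) is absent provided every
`N{c·ℓ_φ, B′, Y′, X}` of SMALLER depth is (`ihN`) and the corner over `c·ℓ_φ` is free. -/
theorem blk_stepP {h μ : ℤ} {C : MConfig} (hU : C.InDiamond h) (hDP : ∀ P ∈ C.upper, RuleDMu4P C P)
    {q : Prop} {φ : Fin 4} {c : ℤ} (hC : CornerFree C h μ q φ c) {m : ℤ}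
    (ihN : ∀ N ∈ C.lower, N 0 = floorLetter φ c → IsCeil h μ (N 2) → N 3 ≠ (0, 0, 0) → (h - (N 1).1) + (h - (N 2).1) < m → False)
    {P : MCell} (hP : P ∈ C.upper) (h0 : P 0 = floorLetter φ c) (hY : IsCeil h μ (P 2)) (h3 : P 3 ≠ (0, 0, 0))
    (h3h : c = μ ∨ q → P 3 ≠ (h, 0, 0)) (hM : (h - (P 1).1) + (h - (P 2).1) ≤ m) : False := by
  obtain ⟨w, K, hK1, hKμ, h2⟩ := hY
  have hgc2 : OnCeiling h (P 2) := by rw [h2]; exact onCeiling_ceilLetter h w (by omega)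
  have hP2f : (P 2).1 = h - 1 - K := by rw [h2, ceilLetter_fst]
  by_cases hBI : P 1 = (h, 0, 0)
  · rcases (show 0 ≤ K ∨ K = -1 by omega) with hK0 | hKn
    · -- `Y = y(w, K)`, `K ≥ 0`, climbs inward under the pin `B = hI`
      have hgc1 : OnCeiling h (P 1) := by rw [hBI]; exact onCeiling_apex h
      obtain ⟨N, hN, hagree, e, he1, heK, hN2⟩ := upLine_ceilLetter' hU hP (hDP P hP) (g := 1) (j := 2) (by decide) hgc1 hK0 h2
      have hN2f : (N 2).1 = h - 1 - (K - e) := by rw [hN2, ceilLetter_fst]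
      exact ihN N hN ((hagree 0 (by decide)).trans h0) (by rw [hN2]; exact isCeil_ceilLetter w (by omega) (by omega))
        (by rw [hagree 3 (by decide)]; exact h3) (by rw [hN2f, hagree 1 (by decide)]; omega)
    · -- the double-apex corner `P{F, hI, hI, X}`
      subst hKn
      exact hC P hP h0 hBI (h2.trans (ceilLetter_neg_one h w)) h3 h3h
  · -- `B ≠ hI`: served above at slot `1` under the ceiling pin at slot `2`, whatever `B` is
    obtain ⟨k, hk, hkh⟩ := exists_frame_ne_h (hU.2 P hP 1) hBI
    obtain ⟨r, N, hN, hNP⟩ := servedAbove_ceiling_apex hU hP (hDP P hP) (g := 2) (j := 1) (by decide) hgc2 hk hkh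
    exact ihN N hN ((hNP.1 0 (by decide)).symm.trans h0) ⟨w, K, hK1, hKμ, (hNP.1 2 (by decide)).symm.trans h2⟩
      (by rw [← hNP.1 3 (by decide)]; exact h3) (by have := hNP.2.1; rw [← hNP.1 2 (by decide)]; omega)

/-- **N-STEP, `B` arbitrary** (RULE D on E₋, A2I⁻, `S₄`): as `bdry_stepN` — the floor pin serves `X` below; the `X′ = O` child is the origin
instance `{O, B, Y, c·ℓ_φ}`; for `c = 0` the origin pin lowers `X` without reaching `O`. -/
theorem blk_stepN {h μ : ℤ} {C : MConfig} (hU : C.InDiamond h) (hDN : ∀ Z ∈ C.lower, RuleDMu4N C Z) (hA : A2IMinusClosed C)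
    (hGl : PermClosed C.lower) (hGu : PermClosed C.upper) (hh1 : 1 ≤ h) {q : Prop} {φ : Fin 4} {c : ℤ} (hc0 : 0 ≤ c) {m : ℤ}
    (ihP : ∀ P ∈ C.upper, P 0 = floorLetter φ c → IsCeil h μ (P 2) → P 3 ≠ (0, 0, 0) → (c = μ ∨ q → P 3 ≠ (h, 0, 0)) →
      (h - (P 1).1) + (h - (P 2).1) ≤ m → False)
    (ihP0 : ∀ P ∈ C.upper, P 0 = (0, 0, 0) → IsCeil h μ (P 2) → P 3 ≠ (0, 0, 0) → P 3 ≠ (h, 0, 0) →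
      (h - (P 1).1) + (h - (P 2).1) ≤ m → False)
    {N : MCell} (hN : N ∈ C.lower) (h0 : N 0 = floorLetter φ c) (hY : IsCeil h μ (N 2)) (h3 : N 3 ≠ (0, 0, 0))
    (hM : (h - (N 1).1) + (h - (N 2).1) ≤ m) : False := by
  rcases (show c = 0 ∨ 1 ≤ c by omega) with hcz | hc1
  · -- `F = O`
    subst hcz
    have hO : N 0 = (0, 0, 0) := h0.trans (ray_zero _ φ)
    obtain ⟨hN', e0, e1, e2, e3⟩ := perm23_lower hGl hN
    have hN3h : (N 3).1 ≤ h := fst_le_of_inDiamond (hU.1 N hN 3)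
    refine originPin_lower_step' hU hDN hA hGl hGu hN' (e0.trans hO) (by rw [e2]; exact h3) fun P hP hP0 hP1 hP3 hle => ?_
    by_contra hP2
    have hP2I : P 2 ≠ (h, 0, 0) := by
      rcases hle with hlt | ⟨heq, hflo⟩
      · intro e; rw [e, e2] at hlt; simp only at hlt; omega
      · intro e; rw [heq] at e; rw [e] at hflo; simp [OnFloor, absCharge, chargeOf] at hflo; omega
    obtain ⟨hP', f0, f1, f2, f3⟩ := perm23_upper hGu hP
    exact ihP0 _ hP' (f0.trans hP0) (by rw [f2, hP3, e3]; exact hY) (by rw [f3]; exact hP2) (by rw [f3]; exact hP2I)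
      (by rw [f1, f2, hP1, hP3, e1, e3]; exact hM)
  · -- `F = c·ℓ_φ`, `c ≥ 1`: the floor pin serves `X` (slot 3) below
    have hfl : OnFloor (N 0) := by rw [h0]; exact onFloor_floorLetter φ (by omega)
    obtain ⟨k, hk, hk0⟩ := exists_frame_ne_zero (hU.1 N hN 3).1 h3
    obtain ⟨r, -, P, hP, hNP⟩ := servedBelow_floor_dir hU hN (hDN N hN) (i := 0) (g := 3) (by decide) hfl hk hk0
    have hP0 : P 0 = floorLetter φ c := (hNP.1 0 (by decide)).trans h0
    have hP1 : P 1 = N 1 := hNP.1 1 (by decide)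
    have hP2 : P 2 = N 2 := hNP.1 2 (by decide)
    have hlt : (P 3).1 < (N 3).1 := hNP.2.1
    have hN3h : (N 3).1 ≤ h := fst_le_of_inDiamond (hU.1 N hN 3)
    by_cases hP3 : P 3 = (0, 0, 0)
    · -- the child `{F, B, Y, O}` is the origin instance `{O, B, Y, F}`
      obtain ⟨hP', f0, f1, f2, f3⟩ := perm03_upper hGu hP
      have h2c : 2 * c ≤ h := two_mul_le_of_floorLetter_inDiamond hc0 (h0 ▸ hU.1 N hN 0)
      exact ihP0 _ hP' (f0.trans hP3) (by rw [f2, hP2]; exact hY)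
        (by rw [f3, hP0]; exact floorLetter_ne_origin φ (by omega)) (by rw [f3, hP0]; exact floorLetter_ne_hI φ (by omega))
        (by rw [f1, f2, hP1, hP2]; exact hM)
    · exact ihP P hP hP0 (by rw [hP2]; exact hY) hP3 (fun _ e => by rw [e] at hlt; simp only at hlt; omega) (by rw [hP1, hP2]; exact hM)

/-- **T9 engine**: for a fixed floor pin `c·ℓ_φ` (and the origin instances it spawns), both levels at once, by induction on the depth. -/
theorem blk_aux {h μ : ℤ} {C : MConfig} (hU : C.InDiamond h) (hDN : ∀ Z ∈ C.lower, RuleDMu4N C Z)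
    (hDP : ∀ P ∈ C.upper, RuleDMu4P C P) (hA : A2IMinusClosed C) (hGl : PermClosed C.lower) (hGu : PermClosed C.upper)
    (hh : h = 2 * μ) (hμ : 1 ≤ μ) {q : Prop} {φ : Fin 4} (hC0 : CornerFree C h μ q φ 0) :
    ∀ n : ℕ, ∀ c : ℤ, 0 ≤ c → CornerFree C h μ q φ c →
      (∀ P ∈ C.upper, P 0 = floorLetter φ c → IsCeil h μ (P 2) → P 3 ≠ (0, 0, 0) → (c = μ ∨ q → P 3 ≠ (h, 0, 0)) →
          (h - (P 1).1) + (h - (P 2).1) ≤ n → False) ∧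
      (∀ N ∈ C.lower, N 0 = floorLetter φ c → IsCeil h μ (N 2) → N 3 ≠ (0, 0, 0) →
          (h - (N 1).1) + (h - (N 2).1) ≤ n → False) := by
  intro n
  induction n with
  | zero =>
    intro c hc0 hC
    have hPc : ∀ c' : ℤ, CornerFree C h μ q φ c' → ∀ P ∈ C.upper, P 0 = floorLetter φ c' → IsCeil h μ (P 2) →
        P 3 ≠ (0, 0, 0) → (c' = μ ∨ q → P 3 ≠ (h, 0, 0)) → (h - (P 1).1) + (h - (P 2).1) ≤ ((0 : ℕ) : ℤ) → False :=
      fun c' hC' P hP h0 hY h3 h3h hM => blk_stepP hU hDP hC' (m := 0)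
        (fun N hN _ _ _ hlt => by
          have := fst_le_of_inDiamond (hU.1 N hN 1); have := fst_le_of_inDiamond (hU.1 N hN 2); omega) hP h0 hY h3 h3h
        (by simpa using hM)
    exact ⟨hPc c hC, fun N hN h0 hY h3 hM => blk_stepN hU hDN hA hGl hGu (by omega) hc0 (m := 0) (hPc c hC)
      (fun P hP hP0 hY' h3' h3I hM' => hPc 0 hC0 P hP (hP0.trans (ray_zero _ φ).symm) hY' h3' (fun _ => h3I) hM')
      hN h0 hY h3 (by simpa using hM)⟩
  | succ n ih =>
    intro c hc0 hC
    have hPc : ∀ c' : ℤ, 0 ≤ c' → CornerFree C h μ q φ c' → ∀ P ∈ C.upper, P 0 = floorLetter φ c' → IsCeil h μ (P 2) →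
        P 3 ≠ (0, 0, 0) → (c' = μ ∨ q → P 3 ≠ (h, 0, 0)) → (h - (P 1).1) + (h - (P 2).1) ≤ ((n + 1 : ℕ) : ℤ) → False :=
      fun c' hc'0 hC' P hP h0 hY h3 h3h hM => blk_stepP hU hDP hC' (m := ((n + 1 : ℕ) : ℤ))
        (fun N hN hN0 hY' h3' hlt => (ih c' hc'0 hC').2 N hN hN0 hY' h3' (by push_cast at hlt; omega)) hP h0 hY h3 h3h hM
    exact ⟨hPc c hc0 hC, fun N hN h0 hY h3 hM => blk_stepN hU hDN hA hGl hGu (by omega) hc0 (m := ((n + 1 : ℕ) : ℤ)) (hPc c hc0 hC)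
      (fun P hP hP0 hY' h3' h3I hM' => hPc 0 le_rfl hC0 P hP (hP0.trans (ray_zero _ φ).symm) hY' h3' (fun _ => h3I) hM')
      hN h0 hY h3 hM⟩

/-! ### T9 -/

/-- **T9, level `P`.** [◇_h, RULE D both levels `RuleDMu4N ∕ RuleDMu4P`, X⁺ `XPlusClosed`, A2I⁻ `A2IMinusClosed`, `S₄` both levels
`PermClosed`; `h = 2μ`, `μ ≥ 1` — nothing else]  `P{c·ℓ_φ, B, Y, X} ∉ C.upper` for every `0 ≤ c ≤ μ`, EVERY `B`, every ceiling letter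
`Y` (`IsCeil`: `y(w,K)`, `−1 ≤ K ≤ μ − 1`), every `X ≠ O`, with `X ≠ hI` when `c = μ` (or when the flag `q` holds).  Census `tools/famAD.py`
(family T9 ⊇ T8, both levels): members ◇₄ 1 425 ∕ ◇₆ 12 677 ∕ ◇₈ 66 093 ∕ ◇₁₀ 245 439, 0 SURVIVORS; beyond T8 and the g18 – g23 files
◇₈ 6 014 ∕ ◇₁₀ 50 530. -/
theorem blockP_absent {h μ c : ℤ} {C : MConfig} (hU : C.InDiamond h) (hDN : ∀ Z ∈ C.lower, RuleDMu4N C Z)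
    (hDP : ∀ P ∈ C.upper, RuleDMu4P C P) (hX : XPlusClosed C) (hA : A2IMinusClosed C) (hGl : PermClosed C.lower) (hGu : PermClosed C.upper)
    (hh : h = 2 * μ) (hμ : 1 ≤ μ) {q : Prop} (φ : Fin 4) (hc0 : 0 ≤ c) (hcμ : c ≤ μ) {P : MCell}
    (h0 : P 0 = floorLetter φ c) (hY : IsCeil h μ (P 2)) (h3 : P 3 ≠ (0, 0, 0)) (h3h : c = μ ∨ q → P 3 ≠ (h, 0, 0)) :
    P ∉ C.upper := fun hP =>
  (blk_aux hU hDN hDP hA hGl hGu hh hμ (cornerFree_holds hU hDN hDP hX hA hGl hGu hh hμ q φ le_rfl (by omega))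
    ((h - (P 1).1) + (h - (P 2).1)).toNat c hc0 (cornerFree_holds hU hDN hDP hX hA hGl hGu hh hμ q φ hc0 hcμ)).1
    P hP h0 hY h3 h3h (Int.self_le_toNat _)

/-- **T9, level `N`.** [same]  `N{c·ℓ_φ, B, Y, X} ∉ C.lower` for every `0 ≤ c ≤ μ`, EVERY `B`, every ceiling letter `Y`, every `X ≠ O`. -/
theorem blockN_absent {h μ c : ℤ} {C : MConfig} (hU : C.InDiamond h) (hDN : ∀ Z ∈ C.lower, RuleDMu4N C Z)
    (hDP : ∀ P ∈ C.upper, RuleDMu4P C P) (hX : XPlusClosed C) (hA : A2IMinusClosed C) (hGl : PermClosed C.lower) (hGu : PermClosed C.upper)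
    (hh : h = 2 * μ) (hμ : 1 ≤ μ) (φ : Fin 4) (hc0 : 0 ≤ c) (hcμ : c ≤ μ) {N : MCell}
    (h0 : N 0 = floorLetter φ c) (hY : IsCeil h μ (N 2)) (h3 : N 3 ≠ (0, 0, 0)) : N ∉ C.lower := fun hN =>
  (blk_aux hU hDN hDP hA hGl hGu hh hμ (q := False) (cornerFree_holds hU hDN hDP hX hA hGl hGu hh hμ False φ le_rfl (by omega))
    ((h - (N 1).1) + (h - (N 2).1)).toNat c hc0 (cornerFree_holds hU hDN hDP hX hA hGl hGu hh hμ False φ hc0 hcμ)).2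
    N hN h0 hY h3 (Int.self_le_toNat _)

/-- **T9 in letters, level `P`**: `P{c·ℓ_φ, B, y(w,K), X} ∉ C.upper` — `0 ≤ c ≤ μ`, `B` arbitrary, `−1 ≤ K ≤ μ − 1`, `X ≠ O`, and
`X ≠ hI` when `c = μ`. -/
theorem floorAnyCeilP_absent {h μ c K : ℤ} {C : MConfig} (hU : C.InDiamond h) (hDN : ∀ Z ∈ C.lower, RuleDMu4N C Z)
    (hDP : ∀ P ∈ C.upper, RuleDMu4P C P) (hX : XPlusClosed C) (hA : A2IMinusClosed C) (hGl : PermClosed C.lower) (hGu : PermClosed C.upper)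
    (hh : h = 2 * μ) (hμ : 1 ≤ μ) {φ w : Fin 4} (hc0 : 0 ≤ c) (hcμ : c ≤ μ) (hK1 : -1 ≤ K) (hKμ : K ≤ μ - 1) {P : MCell}
    (h0 : P 0 = floorLetter φ c) (h2 : P 2 = ceilLetter h w K) (h3 : P 3 ≠ (0, 0, 0)) (h3h : c = μ → P 3 ≠ (h, 0, 0)) : P ∉ C.upper :=
  blockP_absent hU hDN hDP hX hA hGl hGu hh hμ (q := False) φ hc0 hcμ h0 ⟨w, K, hK1, hKμ, h2⟩ h3 fun e => e.elim h3h False.elim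

/-- **T9 in letters, level `N`**: `N{c·ℓ_φ, B, y(w,K), X} ∉ C.lower` — `0 ≤ c ≤ μ`, `B` arbitrary, `−1 ≤ K ≤ μ − 1`, `X ≠ O`. -/
theorem floorAnyCeilN_absent {h μ c K : ℤ} {C : MConfig} (hU : C.InDiamond h) (hDN : ∀ Z ∈ C.lower, RuleDMu4N C Z)
    (hDP : ∀ P ∈ C.upper, RuleDMu4P C P) (hX : XPlusClosed C) (hA : A2IMinusClosed C) (hGl : PermClosed C.lower) (hGu : PermClosed C.upper)
    (hh : h = 2 * μ) (hμ : 1 ≤ μ) {φ w : Fin 4} (hc0 : 0 ≤ c) (hcμ : c ≤ μ) (hK1 : -1 ≤ K) (hKμ : K ≤ μ - 1) {N : MCell}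
    (h0 : N 0 = floorLetter φ c) (h2 : N 2 = ceilLetter h w K) (h3 : N 3 ≠ (0, 0, 0)) : N ∉ C.lower :=
  blockN_absent hU hDN hDP hX hA hGl hGu hh hμ φ hc0 hcμ h0 ⟨w, K, hK1, hKμ, h2⟩ h3

/-- **T9 at the origin, level `P`**: `P{O, B, Y, X} ∉ C.upper` — `B` arbitrary, `Y` a ceiling letter, `X ≠ O`. -/
theorem originAnyCeilP_absent {h μ : ℤ} {C : MConfig} (hU : C.InDiamond h) (hDN : ∀ Z ∈ C.lower, RuleDMu4N C Z)
    (hDP : ∀ P ∈ C.upper, RuleDMu4P C P) (hX : XPlusClosed C) (hA : A2IMinusClosed C) (hGl : PermClosed C.lower) (hGu : PermClosed C.upper)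
    (hh : h = 2 * μ) (hμ : 1 ≤ μ) {P : MCell} (h0 : P 0 = (0, 0, 0)) (hY : IsCeil h μ (P 2)) (h3 : P 3 ≠ (0, 0, 0)) : P ∉ C.upper :=
  blockP_absent hU hDN hDP hX hA hGl hGu hh hμ (q := False) 0 le_rfl (by omega) (h0.trans (ray_zero _ 0).symm) hY h3 fun e =>
    e.elim (fun e0 => absurd e0 (by omega)) False.elim

/-- **T9 at the origin, level `N`**: `N{O, B, Y, X} ∉ C.lower` — `B` arbitrary, `Y` a ceiling letter, `X ≠ O`. -/
theorem originAnyCeilN_absent {h μ : ℤ} {C : MConfig} (hU : C.InDiamond h) (hDN : ∀ Z ∈ C.lower, RuleDMu4N C Z)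
    (hDP : ∀ P ∈ C.upper, RuleDMu4P C P) (hX : XPlusClosed C) (hA : A2IMinusClosed C) (hGl : PermClosed C.lower) (hGu : PermClosed C.upper)
    (hh : h = 2 * μ) (hμ : 1 ≤ μ) {N : MCell} (h0 : N 0 = (0, 0, 0)) (hY : IsCeil h μ (N 2)) (h3 : N 3 ≠ (0, 0, 0)) : N ∉ C.lower :=
  blockN_absent hU hDN hDP hX hA hGl hGu hh hμ 0 le_rfl (by omega) (h0.trans (ray_zero _ 0).symm) hY h3

/-! ## §6 T10 — THE `FL` DOUBLE PIN `{μ·ℓ_φ, B, Z, X}`: ONE LETTER PINS BOTH LEVELS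

`FL_φ = μ·ℓ_φ = y(φ, μ−1)` lies on the floor AND on the ceiling of ◇_h (`h = 2μ`), so it is a floor pin at level `N` (RULE D serves `X`
below) and a ceiling pin at level `P` (RULE D serves `B`, or `Z` when `B = hI`, above) AT THE SAME SLOT: the §5 engine runs with NO
ceiling letter besides the pin.  T10: `{μ·ℓ_φ, B, Z, X} ∉ E_±` for EVERY `B`, every `Z ≠ O`, every `X ≠ O` (`P`-proviso `X ≠ hI`);
equivalently `FL_φ` plus three letters not all but one equal to `O`.  The `X′ = O` child of the `N`-move is the T9 origin instance
`{O, B, FL_φ, Z}`; the `P`-corner `P{FL_φ, hI, hI, X}` is §4 `cornerFree_holds` at `c = μ`.  Census `tools/famAE.py`: members ◇₄ 1 012 ∕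
◇₆ 6 924 ∕ ◇₈ 29 360 ∕ ◇₁₀ 93 650, 0 SURVIVORS; beyond T9 and the g18 – g23 files ◇₆ 46 ∕ ◇₈ 1 076 ∕ ◇₁₀ 7 524 (N 3 954 + P 3 570, peel
rounds 2 – 15). -/

/-- **P-STEP of the `FL` double pin** (RULE D on E₊): raise `B` (slot `1`) under the ceiling pin `FL_φ` (slot `0`); if `B = hI` raise `Z`
(slot `2`); `B = Z = hI` is the corner. -/
theorem fl_stepP {h μ : ℤ} {C : MConfig} (hU : C.InDiamond h) (hDP : ∀ P ∈ C.upper, RuleDMu4P C P) (hh : h = 2 * μ) (hμ : 1 ≤ μ)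
    {q : Prop} {φ : Fin 4} (hC : CornerFree C h μ q φ μ) {m : ℤ}
    (ihN : ∀ N ∈ C.lower, N 0 = floorLetter φ μ → N 2 ≠ (0, 0, 0) → N 3 ≠ (0, 0, 0) → (h - (N 1).1) + (h - (N 2).1) < m → False)
    {P : MCell} (hP : P ∈ C.upper) (h0 : P 0 = floorLetter φ μ) (h2 : P 2 ≠ (0, 0, 0)) (h3 : P 3 ≠ (0, 0, 0)) (h3h : P 3 ≠ (h, 0, 0))
    (hM : (h - (P 1).1) + (h - (P 2).1) ≤ m) : False := by
  have hgc0 : OnCeiling h (P 0) := by rw [h0, floorLetter_mu_eq_ceilLetter hh]; exact onCeiling_ceilLetter h φ (by omega)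
  by_cases hBI : P 1 = (h, 0, 0)
  · by_cases hZI : P 2 = (h, 0, 0)
    · -- the corner `P{FL_φ, hI, hI, X}`
      exact hC P hP h0 hBI hZI h3 fun _ => h3h
    · -- `B = hI`, `Z ≠ hI`: raise `Z`
      obtain ⟨k, hk, hkh⟩ := exists_frame_ne_h (hU.2 P hP 2) hZI
      obtain ⟨r, N, hN, hNP⟩ := servedAbove_ceiling_apex hU hP (hDP P hP) (g := 0) (j := 2) (by decide) hgc0 hk hkh
      have hlt : (P 2).1 < (N 2).1 := hNP.2.1
      have h20 : 0 ≤ (P 2).1 := fst_nonneg_of_inDiamond (hU.2 P hP 2)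
      exact ihN N hN ((hNP.1 0 (by decide)).symm.trans h0) (fun e => by rw [e] at hlt; simp only at hlt; omega)
        (by rw [← hNP.1 3 (by decide)]; exact h3) (by rw [← hNP.1 1 (by decide)]; omega)
  · -- `B ≠ hI`: raise `B`
    obtain ⟨k, hk, hkh⟩ := exists_frame_ne_h (hU.2 P hP 1) hBI
    obtain ⟨r, N, hN, hNP⟩ := servedAbove_ceiling_apex hU hP (hDP P hP) (g := 0) (j := 1) (by decide) hgc0 hk hkh
    have hlt : (P 1).1 < (N 1).1 := hNP.2.1
    exact ihN N hN ((hNP.1 0 (by decide)).symm.trans h0) (by rw [← hNP.1 2 (by decide)]; exact h2)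
      (by rw [← hNP.1 3 (by decide)]; exact h3) (by rw [← hNP.1 2 (by decide)]; omega)

/-- **N-STEP of the `FL` double pin** (RULE D on E₋, `S₄` on E₊): the floor pin `FL_φ` serves `X` (slot `3`) below; the `X′ = O` child is the
T9 origin instance `P{O, B, FL_φ, Z}` (`hT9`). -/
theorem fl_stepN {h μ : ℤ} {C : MConfig} (hU : C.InDiamond h) (hDN : ∀ Z ∈ C.lower, RuleDMu4N C Z) (hGu : PermClosed C.upper)
    (hh : h = 2 * μ) (hμ : 1 ≤ μ) {φ : Fin 4} {m : ℤ}
    (hT9 : ∀ P ∈ C.upper, P 0 = (0, 0, 0) → IsCeil h μ (P 2) → P 3 ≠ (0, 0, 0) → False)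
    (ihP : ∀ P ∈ C.upper, P 0 = floorLetter φ μ → P 2 ≠ (0, 0, 0) → P 3 ≠ (0, 0, 0) → P 3 ≠ (h, 0, 0) →
      (h - (P 1).1) + (h - (P 2).1) ≤ m → False)
    {N : MCell} (hN : N ∈ C.lower) (h0 : N 0 = floorLetter φ μ) (h2 : N 2 ≠ (0, 0, 0)) (h3 : N 3 ≠ (0, 0, 0))
    (hM : (h - (N 1).1) + (h - (N 2).1) ≤ m) : False := by
  have hfl : OnFloor (N 0) := by rw [h0]; exact onFloor_floorLetter φ (by omega)
  obtain ⟨k, hk, hk0⟩ := exists_frame_ne_zero (hU.1 N hN 3).1 h3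
  obtain ⟨r, -, P, hP, hNP⟩ := servedBelow_floor_dir hU hN (hDN N hN) (i := 0) (g := 3) (by decide) hfl hk hk0
  have hP0 : P 0 = floorLetter φ μ := (hNP.1 0 (by decide)).trans h0
  have hP1 : P 1 = N 1 := hNP.1 1 (by decide)
  have hP2 : P 2 = N 2 := hNP.1 2 (by decide)
  have hlt : (P 3).1 < (N 3).1 := hNP.2.1
  have hN3h : (N 3).1 ≤ h := fst_le_of_inDiamond (hU.1 N hN 3)
  by_cases hP3 : P 3 = (0, 0, 0)
  · -- the child `{FL_φ, B, Z, O}` is the T9 origin instance `{O, B, FL_φ, Z}`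
    obtain ⟨hP', f0, f1, f2, f3⟩ := perm03_upper hGu hP
    obtain ⟨hP'', g0, g1, g2, g3⟩ := perm23_upper hGu hP'
    exact hT9 _ hP'' (by rw [g0, f0, hP3]) (by rw [g2, f3, hP0]; exact isCeil_floorLetter_mu hh (by omega) φ)
      (by rw [g3, f2, hP2]; exact h2)
  · exact ihP P hP hP0 (by rw [hP2]; exact h2) hP3 (fun e => by rw [e] at hlt; simp only at hlt; omega) (by rw [hP1, hP2]; exact hM)

/-- **T10 engine**: both levels at once, by induction on the depth `(h − B.1) + (h − Z.1)`. -/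
theorem fl_aux {h μ : ℤ} {C : MConfig} (hU : C.InDiamond h) (hDN : ∀ Z ∈ C.lower, RuleDMu4N C Z)
    (hDP : ∀ P ∈ C.upper, RuleDMu4P C P) (hGu : PermClosed C.upper) (hh : h = 2 * μ) (hμ : 1 ≤ μ) {q : Prop} {φ : Fin 4}
    (hC : CornerFree C h μ q φ μ) (hT9 : ∀ P ∈ C.upper, P 0 = (0, 0, 0) → IsCeil h μ (P 2) → P 3 ≠ (0, 0, 0) → False) :
    ∀ n : ℕ,
      (∀ P ∈ C.upper, P 0 = floorLetter φ μ → P 2 ≠ (0, 0, 0) → P 3 ≠ (0, 0, 0) → P 3 ≠ (h, 0, 0) →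
          (h - (P 1).1) + (h - (P 2).1) ≤ n → False) ∧
      (∀ N ∈ C.lower, N 0 = floorLetter φ μ → N 2 ≠ (0, 0, 0) → N 3 ≠ (0, 0, 0) →
          (h - (N 1).1) + (h - (N 2).1) ≤ n → False) := by
  intro n
  induction n with
  | zero =>
    have hP0 : ∀ P ∈ C.upper, P 0 = floorLetter φ μ → P 2 ≠ (0, 0, 0) → P 3 ≠ (0, 0, 0) → P 3 ≠ (h, 0, 0) →
        (h - (P 1).1) + (h - (P 2).1) ≤ ((0 : ℕ) : ℤ) → False :=
      fun P hP h0 h2 h3 h3h hM => fl_stepP hU hDP hh hμ hC (m := 0)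
        (fun N hN _ _ _ hlt => by
          have := fst_le_of_inDiamond (hU.1 N hN 1); have := fst_le_of_inDiamond (hU.1 N hN 2); omega) hP h0 h2 h3 h3h
        (by simpa using hM)
    exact ⟨hP0, fun N hN h0 h2 h3 hM => fl_stepN hU hDN hGu hh hμ (m := 0) hT9 hP0 hN h0 h2 h3 (by simpa using hM)⟩
  | succ n ih =>
    have hPn : ∀ P ∈ C.upper, P 0 = floorLetter φ μ → P 2 ≠ (0, 0, 0) → P 3 ≠ (0, 0, 0) → P 3 ≠ (h, 0, 0) →
        (h - (P 1).1) + (h - (P 2).1) ≤ ((n + 1 : ℕ) : ℤ) → False :=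
      fun P hP h0 h2 h3 h3h hM => fl_stepP hU hDP hh hμ hC (m := ((n + 1 : ℕ) : ℤ))
        (fun N hN hN0 h2' h3' hlt => ih.2 N hN hN0 h2' h3' (by push_cast at hlt; omega)) hP h0 h2 h3 h3h hM
    exact ⟨hPn, fun N hN h0 h2 h3 hM => fl_stepN hU hDN hGu hh hμ (m := ((n + 1 : ℕ) : ℤ)) hT9 hPn hN h0 h2 h3 hM⟩

/-! ### T10 -/

/-- **T10, level `P`.** [◇_h, RULE D both levels, X⁺, A2I⁻, `S₄` both levels; `h = 2μ`, `μ ≥ 1` — nothing else]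
`P{μ·ℓ_φ, B, Z, X} ∉ C.upper` for EVERY `B`, every `Z ≠ O` and every `X ∉ {O, hI}`.  Census `tools/famAE.py` (family T10, both levels):
members ◇₄ 1 012 ∕ ◇₆ 6 924 ∕ ◇₈ 29 360 ∕ ◇₁₀ 93 650, 0 SURVIVORS; beyond T9 and the g18 – g23 files ◇₈ 1 076 ∕ ◇₁₀ 7 524. -/
theorem flPinP_absent {h μ : ℤ} {C : MConfig} (hU : C.InDiamond h) (hDN : ∀ Z ∈ C.lower, RuleDMu4N C Z)
    (hDP : ∀ P ∈ C.upper, RuleDMu4P C P) (hX : XPlusClosed C) (hA : A2IMinusClosed C) (hGl : PermClosed C.lower) (hGu : PermClosed C.upper)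
    (hh : h = 2 * μ) (hμ : 1 ≤ μ) (φ : Fin 4) {P : MCell}
    (h0 : P 0 = floorLetter φ μ) (h2 : P 2 ≠ (0, 0, 0)) (h3 : P 3 ≠ (0, 0, 0)) (h3h : P 3 ≠ (h, 0, 0)) : P ∉ C.upper := fun hP =>
  (fl_aux hU hDN hDP hGu hh hμ (q := False) (cornerFree_holds hU hDN hDP hX hA hGl hGu hh hμ False φ (by omega) le_rfl)
    (fun P' hP' h0' hY' h3' => originAnyCeilP_absent hU hDN hDP hX hA hGl hGu hh hμ h0' hY' h3' hP')
    ((h - (P 1).1) + (h - (P 2).1)).toNat).1 P hP h0 h2 h3 h3h (Int.self_le_toNat _)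

/-- **T10, level `N`.** [same]  `N{μ·ℓ_φ, B, Z, X} ∉ C.lower` for EVERY `B`, every `Z ≠ O` and every `X ≠ O`. -/
theorem flPinN_absent {h μ : ℤ} {C : MConfig} (hU : C.InDiamond h) (hDN : ∀ Z ∈ C.lower, RuleDMu4N C Z)
    (hDP : ∀ P ∈ C.upper, RuleDMu4P C P) (hX : XPlusClosed C) (hA : A2IMinusClosed C) (hGl : PermClosed C.lower) (hGu : PermClosed C.upper)
    (hh : h = 2 * μ) (hμ : 1 ≤ μ) (φ : Fin 4) {N : MCell}
    (h0 : N 0 = floorLetter φ μ) (h2 : N 2 ≠ (0, 0, 0)) (h3 : N 3 ≠ (0, 0, 0)) : N ∉ C.lower := fun hN =>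
  (fl_aux hU hDN hDP hGu hh hμ (q := False) (cornerFree_holds hU hDN hDP hX hA hGl hGu hh hμ False φ (by omega) le_rfl)
    (fun P' hP' h0' hY' h3' => originAnyCeilP_absent hU hDN hDP hX hA hGl hGu hh hμ h0' hY' h3' hP')
    ((h - (N 1).1) + (h - (N 2).1)).toNat).2 N hN h0 h2 h3 (Int.self_le_toNat _)

/-! ## §7 T11 — THE SUB-APEX `A = (h−2)·I` AS A PSEUDO-CEILING PIN AND THE X⁺ FORK WITH TYPED ESCAPES: THE ORIGIN SUB-APEX BLOCK `{O, B, A, X}`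

The first family whose proof needs the X⁺ clause with BOTH free-slot conditions (`W_f(P₁) = ∅`, (H-b)) NON-vacuous.  Two observations.
(i) THE PSEUDO-PIN.  The only letters strictly null-above `A = (h−2)·I` in ◇_h are the ceiling units `cu_r`; so in a `P`-cell `{F, B, A, X}`
(`F` floor, `X ≠ O`) every RULE-D option that touches the `A`-slot — service above at `A`, or an (r2a) cover above through `A` — produces an
`N`-cell `{F, ·, cu_r, ·}` that T9 already forbids: RULE D at `P` must serve the OTHER slot of the pair above (`servedAbove_subapex_pin`).
`A` pins exactly like a ceiling letter, one level below the ceiling line, at the price of T9.  (Dually `2I` is a pseudo-floor pin at level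
`N`; not used here.)
(ii) THE FORK WITH TYPED ESCAPES.  At the double sub-apex `Z = N{O, A, A, X}` the X⁺ fork of §3b (`xplus_fork`, free slot `f` an apex `hI`,
where `W_f` and (H-b) are vacuous) is replaced by `xplus_fork_esc`: free slot `f` ARBITRARY, the escape cells of `W_f(P₁)` ((r1) legs and
(r2a) covers through `f`) and of (H-b) handed back as hypotheses.  With `Z f = A` every escape carries a ceiling unit at `f` and — this is
where `F = O` is used — a floor letter at slot `0` (a cover through the floor slot raises `O` to some `e·ℓ_ψ`; for `F = c·ℓ_φ`, `c ≥ 1`, it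
may raise `F` off the floor to `2eI + (c−e)·ℓ_φ`, and those escapes `{2eI+(c−e)ℓ, cu, σ_d, X}` are floor-free cells no file types: the
general-`F` double sub-apex row is the g24 item), so T9 kills them all; the (H-e′) breakers not causally below `A` are ceiling letters,
T9 again.  Between-siblings are turned into closer partners by the origin pin + A2I⁻ exactly as in §3b (descent on the partners' depth).
RESULT T11 (origin sub-apex block): `N{O, B, A, X} ∉ C.lower` for EVERY `B` and every `X ≠ O`; `P{O, B, A, X} ∉ C.upper` for every
`X ≠ O` unless `B = X = A` (`P{O, A, A, A}` IS present in the census worlds — its RULE-D servers `N{e·ℓ, A, A, A}` are general-`F` rows).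
Architecture: outer induction on the height of `X` (§7c); at a fixed `X` the double sub-apex `N{O, A, A, X}` first (fork descent, §7b),
then the inner induction on the depth `h − B.1` (the pseudo-pin raises `B`; the origin pin lowers `X` or hands the A2I⁻ companion); the
corners `P{O, A, A, X}`, `X ∉ {O, A}`, last (raise `X` under the pseudo-pin).  Hypotheses as T9 (no `Δ`); `μ ≥ 2`.
Census `tools/famAF.py` (origin part): members ◇₄ 69 ∕ ◇₆ 221 ∕ ◇₈ 547 ∕ ◇₁₀ 1 149, 0 SURVIVORS; NEW beyond T9/T10 and the g18 – g23 files
◇₄ 13 ∕ ◇₆ 69 ∕ ◇₈ 221 (N 111 + P 110) ∕ ◇₁₀ 547 (N 274 + P 273) at peel rounds 3 – 18 — the first typed family reaching the deepest peel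
rounds of ◇₁₀ (14 – 18: 329 of the 547).  The full sub-apex block `{c·ℓ_φ, B, A, X}` (◇₈ 1 717 ∕ ◇₁₀ ≈ 5 000 new, sole census survivor
`P{(μ−1)·ℓ, A, A, A}`) waits for the floor-free escape rows. -/

/-! ### §7a geometry of the sub-apex, the generalized fork, the pseudo-pin server -/

/-- `NullBelow` under the literal dual `dualPt 0` (order reversed). -/
theorem nullBelow_dual0 {a b : BPoint} (hn : NullBelow (dualPt 0 a) (dualPt 0 b)) : NullBelow b a := by
  obtain ⟨a1, a2, a3⟩ := a
  obtain ⟨b1, b2, b3⟩ := b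
  simp only [NullBelow, dualPt] at hn ⊢
  obtain ⟨h1, h2⟩ := hn
  refine ⟨by omega, ?_⟩
  have e1 : (-b2 - -a2) ^ 2 + (-b3 - -a3) ^ 2 = (a2 - b2) ^ 2 + (a3 - b3) ^ 2 := by ring
  have e2 : (0 - b1 - (0 - a1)) ^ 2 = (a1 - b1) ^ 2 := by ring
  rw [← e1, ← e2]; exact h2

/-- a frame coordinate avoiding a prescribed apex value: `z ≠ a·I` has an adapted frame `k` with `coord z k ≠ a`. -/
theorem exists_frame_ne_val {z : BPoint} (hzax : z.2 = (0, 0) ∨ AxisPt z) (a₀ : ℤ) (hne : z ≠ (a₀, 0, 0)) :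
    ∃ k : Fin 4, Adapted z k ∧ coord z k ≠ a₀ := by
  obtain ⟨α, a, b⟩ := z
  simp only [AxisPt, Prod.mk.injEq] at hzax
  simp only [ne_eq, Prod.mk.injEq] at hne
  rcases hzax with ⟨ha, hb⟩ | ⟨ha, hb⟩ | ⟨ha, hb⟩
  · exact ⟨0, by simp [Adapted, hb], by simp [coord]; omega⟩
  · by_cases e : α + a = a₀
    · exact ⟨2, by simp [Adapted, hb], by simp [coord]; omega⟩
    · exact ⟨0, by simp [Adapted, hb], by simp [coord]; omega⟩
  · by_cases e : α - b = a₀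
    · exact ⟨3, by simp [Adapted, ha], by simp [coord]; omega⟩
    · exact ⟨1, by simp [Adapted, ha], by simp [coord]; omega⟩

/-- in ◇_{2μ} a letter is a ceiling letter or lies causally below the sub-apex `A` (causal top `≤ h − 2`; parity). -/
theorem isCeil_or_low {h μ : ℤ} (hh : h = 2 * μ) (hμ : 0 ≤ μ) {z : BPoint} (hz : InDiamond h z) :
    IsCeil h μ z ∨ z.1 + absCharge z ≤ h - 2 := by
  have h1 := hz.2.1
  have h2 := hz.2.2.1
  have h3 := hz.2.2.2
  have h0 : 0 ≤ absCharge z := abs_nonneg _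
  by_cases hc : z.1 + absCharge z = h
  · left
    by_cases hap : z = (h, 0, 0)
    · rw [hap]; exact isCeil_apex hμ
    · obtain ⟨w, K, hK0, hKμ, e⟩ := exists_eq_ceilLetter hh hz hc hap
      exact ⟨w, K, by omega, hKμ, e⟩
  · right; omega

/-- strictly above the sub-apex line `α = h − 2` only ceiling letters live. -/
theorem isCeil_of_fst_gt {h μ : ℤ} (hh : h = 2 * μ) (hμ : 0 ≤ μ) {z : BPoint} (hz : InDiamond h z) (hgt : h - 2 < z.1) : IsCeil h μ z := by
  rcases isCeil_or_low hh hμ hz with hc | hlow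
  · exact hc
  · have h0 : 0 ≤ absCharge z := abs_nonneg _
    omega

/-- `◇_h ∩ {causal top ≤ h − 2} = ◇_{h−2}`. -/
theorem inDiamond_sub_two {h : ℤ} {z : BPoint} (hz : InDiamond h z) (hlow : z.1 + absCharge z ≤ h - 2) : InDiamond (h - 2) z :=
  ⟨hz.1, hz.2.1, hz.2.2.1, hlow⟩

/-- a letter strictly null-above the origin is a floor letter `e·ℓ_ψ`, `e = z.1 ≥ 1`. -/
theorem exists_eq_floorLetter_of_nullBelow_origin {z : BPoint} (hzax : z.2 = (0, 0) ∨ AxisPt z) (hn : NullBelow (0, 0, 0) z) :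
    ∃ ψ : Fin 4, z = floorLetter ψ z.1 := by
  obtain ⟨α, a, b⟩ := z
  simp only [AxisPt, Prod.mk.injEq] at hzax
  simp only [NullBelow, sub_zero] at hn
  obtain ⟨hα, hsq⟩ := hn
  rcases hzax with ⟨ha, hb⟩ | ⟨ha, hb⟩ | ⟨ha, hb⟩
  · subst ha; subst hb; exfalso; nlinarith
  · subst hb
    have hsq' : a ^ 2 = α ^ 2 := by nlinarith
    rcases abs_eq_abs.mp ((sq_eq_sq_iff_abs_eq_abs a α).mp hsq') with e | e
    · exact ⟨0, by (ext <;> simp [ray]); omega⟩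
    · exact ⟨2, by (ext <;> simp [ray]); omega⟩
  · subst ha
    have hsq' : b ^ 2 = α ^ 2 := by nlinarith
    rcases abs_eq_abs.mp ((sq_eq_sq_iff_abs_eq_abs b α).mp hsq') with e | e
    · exact ⟨3, by (ext <;> simp [ray]); omega⟩
    · exact ⟨1, by (ext <;> simp [ray]); omega⟩

/-- `S₄` on E₋, the transposition of slots `1` and `2`. -/
theorem perm12_lower {C : MConfig} (hGl : PermClosed C.lower) {N : MCell} (hN : N ∈ C.lower) :
    N.perm (Equiv.swap (1 : Fin 4) 2) ∈ C.lower ∧ N.perm (Equiv.swap (1 : Fin 4) 2) 0 = N 0 ∧ N.perm (Equiv.swap (1 : Fin 4) 2) 1 = N 2 ∧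
      N.perm (Equiv.swap (1 : Fin 4) 2) 2 = N 1 ∧ N.perm (Equiv.swap (1 : Fin 4) 2) 3 = N 3 :=
  ⟨hGl _ N hN, by show N (Equiv.swap (1 : Fin 4) 2 0) = _; simp [Equiv.swap_apply_of_ne_of_ne],
    by show N (Equiv.swap (1 : Fin 4) 2 1) = _; rw [Equiv.swap_apply_left],
    by show N (Equiv.swap (1 : Fin 4) 2 2) = _; rw [Equiv.swap_apply_right],
    by show N (Equiv.swap (1 : Fin 4) 2 3) = _; simp [Equiv.swap_apply_of_ne_of_ne]⟩

/-- **THE X⁺ FORK WITH ESCAPES** (X⁺ alone): `xplus_fork` with the free slot `f` ARBITRARY.  Head `P₁ ∈ E₊`; `Z ∈ E₋` its lowest `r₁`-server at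
`g` (`htop`); `P₂ ∈ E₊` a second partner of `Z` at `g` in a direction `r₂ ≠ r₁` with no `N`-twin strictly between (`hNC`); (H-e′) as in
`xplus_fork` (`hHe`); and now the cells that would break `W_f(P₁) = ∅` — an `N`-leg of `P₁` on `f` (`hW1`), an (r2a) `N`-cover of `P₁`
through `f` and another slot `g′` (`hW2`) — or (H-b) — an `N`-cell agreeing with `P₁` off `{g, f}`, strictly null-above `P₁ f` (`hHb`) —
are ABSENT by hypothesis.  Then the clause fires: contradiction. -/
theorem xplus_fork_esc {C : MConfig} (hX : XPlusClosed C) {Z : MCell} (hZ : Z ∈ C.lower)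
    {g f : Fin 4} (hfg : f ≠ g) {P₁ P₂ : MCell} (hP₁ : P₁ ∈ C.upper) (hP₂ : P₂ ∈ C.upper)
    {r₁ r₂ : Fin 4} (hr : r₂ ≠ r₁) (h1 : UPartner Z P₁ g r₁) (h2 : UPartner Z P₂ g r₂) (hna : ¬ isApex (P₁ g))
    (htop : ∀ X ∈ C.lower, UPartner X P₁ g r₁ → (Z g).1 ≤ (X g).1)
    (hNC : ∀ X ∈ C.lower, MAgree X Z g → (X g).1 < (Z g).1 → (P₂ g).1 < (X g).1 → Z g ≠ ray (X g) r₂ ((Z g).1 - (X g).1))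
    (hHe : ∀ X ∈ C.lower, MAgree X P₁ g → X g ≠ P₁ g → Effective (bsub (X g) (P₂ g)) → ¬ Timelike (bsub (P₁ g) (X g)) →
      Effective (bsub (Z g) (X g)))
    (hHb : ∀ X ∈ C.lower, MAgree2 X P₁ g f → NullBelow (P₁ f) (X f) → False)
    (hW1 : ∀ X ∈ C.lower, MAgree X P₁ f → NullBelow (P₁ f) (X f) → False)
    (hW2 : ∀ X ∈ C.lower, ∀ g' : Fin 4, g' ≠ f → MAgree2 X P₁ f g' → NullBelow (P₁ f) (X f) → NullBelow (P₁ g') (X g') → False) :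
    False := by
  refine hX (dualCell 0 P₁) (dualCell_mem_dual_lower hP₁) (dualCell 0 Z) (dualCell_mem_dual_upper hZ) (dualCell 0 P₂)
    (dualCell_mem_dual_lower hP₂) g r₁ r₂ f ⟨?_, hfg, (uPartner_dual 0 Z P₁ g r₁).mpr h1, ?_, hr, ?_, ?_, ?_, ?_, ?_⟩
  · exact fun hap => hna ((isApex_dual 0 (P₁ g)).mp hap)
  · -- `Z` is the lowest `r₁`-server of `P₁`
    intro P hP hPu
    obtain ⟨X, hXl, rfl⟩ := Finset.mem_image.mp hP
    have hle := htop X hXl ((uPartner_dual 0 X P₁ g r₁).mp hPu)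
    show 0 - (X g).1 ≤ 0 - (Z g).1
    omega
  · exact ⟨magree_dual.mpr (fun j hj => (h2.1 j hj).symm), (ray_dual_iff 0 (Z g) (P₂ g) r₂).mpr ⟨h2.2.1, h2.2.2⟩⟩
  · -- no `N`-twin of `Z` strictly between `Z g` and `P₂ g` on the `r₂`-ray
    intro P hP hag hlt1 hlt2 hray
    obtain ⟨X, hXl, rfl⟩ := Finset.mem_image.mp hP
    have hag' : MAgree Z X g := magree_dual.mp hag
    obtain ⟨hlt, hZX⟩ := (ray_dual_iff 0 (Z g) (X g) r₂).mp ⟨hlt1, hray⟩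
    have hlt2' : (P₂ g).1 < (X g).1 := by change 0 - (X g).1 < 0 - (P₂ g).1 at hlt2; omega
    exact hNC X hXl (fun j hj => (hag' j hj).symm) hlt hlt2' hZX
  · -- (H-e′)⁺
    intro P hP hag hne hE hnT
    obtain ⟨X, hXl, rfl⟩ := Finset.mem_image.mp hP
    show Effective (bsub (dualPt 0 (X g)) (dualPt 0 (Z g)))
    rw [bsub_dualPt0]
    have hag' : MAgree X P₁ g := fun j hj => ((magree_dual.mp hag) j hj).symm
    have hne' : X g ≠ P₁ g := fun e => hne (by show dualPt 0 (X g) = dualPt 0 (P₁ g); rw [e])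
    have hE' : Effective (bsub (X g) (P₂ g)) := by
      change Effective (bsub (dualPt 0 (P₂ g)) (dualPt 0 (X g))) at hE; rwa [bsub_dualPt0] at hE
    have hnT' : ¬ Timelike (bsub (P₁ g) (X g)) := by
      change ¬ Timelike (bsub (dualPt 0 (X g)) (dualPt 0 (P₁ g))) at hnT; rwa [bsub_dualPt0] at hnT
    exact hHe X hXl hag' hne' hE' hnT'
  · -- (H-b)⁺: the escape is absent
    intro P hP hag2 hnb _
    obtain ⟨X, hXl, rfl⟩ := Finset.mem_image.mp hP
    exact (hHb X hXl (fun j hj1 hj2 => ((magree2_dual.mp hag2) j hj1 hj2).symm) (nullBelow_dual0 hnb)).elim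
  · -- `W_f(P₁) = ∅`: legs and covers through `f` are absent
    intro P hP hnb
    obtain ⟨X, hXl, rfl⟩ := Finset.mem_image.mp hP
    exact ⟨fun hag => hW1 X hXl (fun j hj => ((magree_dual.mp hag) j hj).symm) (nullBelow_dual0 hnb),
      fun g' hg' hag2 hnb' => hW2 X hXl g' hg' (fun j hj1 hj2 => ((magree2_dual.mp hag2) j hj1 hj2).symm) (nullBelow_dual0 hnb)
        (nullBelow_dual0 hnb')⟩

/-- **THE PSEUDO-PIN `A`** (RULE D on E₊, T9): in `P{c·ℓ_φ, ·, A, X}` (`0 ≤ c ≤ μ`, `X ≠ O`, slot `2` the sub-apex) a slot `j ∈ {1, 3}`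
with an adapted coordinate `≠ h − 2` is SERVED ABOVE: the RULE-D alternatives through the `A`-slot are `N{c·ℓ_φ, ·, cu_r, ·}`, absent by T9. -/
theorem servedAbove_subapex_pin {h μ c : ℤ} {C : MConfig} (hU : C.InDiamond h) (hDN : ∀ Z ∈ C.lower, RuleDMu4N C Z)
    (hDP : ∀ P ∈ C.upper, RuleDMu4P C P) (hX : XPlusClosed C) (hA : A2IMinusClosed C) (hGl : PermClosed C.lower) (hGu : PermClosed C.upper)
    (hh : h = 2 * μ) (hμ : 1 ≤ μ) {φ : Fin 4} (hc0 : 0 ≤ c) (hcμ : c ≤ μ) {P : MCell} (hP : P ∈ C.upper)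
    (h0 : P 0 = floorLetter φ c) (h2 : P 2 = (h - 2, 0, 0)) (h3 : P 3 ≠ (0, 0, 0)) {j : Fin 4} (hj : j = 1 ∨ j = 3)
    {k : Fin 4} (hk : Adapted (P j) k) (hkh : coord (P j) k ≠ h - 2) : ∃ r, ∃ N ∈ C.lower, UPartner N P j r := by
  have hj2 : (2 : Fin 4) ≠ j := by rcases hj with rfl | rfl <;> decide
  have hm : Adapted (P 2) 0 := by rw [h2]; simp [Adapted]
  have hmc : coord (P 2) 0 = h - 2 := by rw [h2]; simp [coord]
  have hne : coord (P 2) 0 ≠ coord (P j) k := by rw [hmc]; exact Ne.symm hkh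
  -- an `N`-cell with the floor letter at slot `0`, strictly above `A` at slot `2` and `X ≠ O` at slot `3` is a T9 cell
  have esc : ∀ N ∈ C.lower, N 0 = P 0 → (P 2).1 < (N 2).1 → N 3 ≠ (0, 0, 0) → False := fun N hN hN0 hlt hN3 =>
    blockN_absent hU hDN hDP hX hA hGl hGu hh hμ φ hc0 hcμ (hN0.trans h0)
      (isCeil_of_fst_gt hh (by omega) (hU.1 N hN 2) (by rw [h2] at hlt; exact hlt)) hN3 hN
  have h3nn : 0 ≤ (P 3).1 := fst_nonneg_of_inDiamond (hU.2 P hP 3)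
  rcases hDP P hP 2 j hj2 0 k hm hk hne with ⟨r, -, N, hN, hNP⟩ | ⟨r, -, N, hN, hNP⟩ | ⟨a, b, -, -, N, hN, hag2, hg1, -, hj1, -⟩
  · -- served above at the `A`-slot: a `cu` cell
    exact (esc N hN (hNP.1 0 (by decide)).symm hNP.2.1 (by rw [← hNP.1 3 (by decide)]; exact h3)).elim
  · exact ⟨r, N, hN, hNP⟩
  · -- an (r2a) cover through the `A`-slot: a `cu` cell again
    rcases hj with rfl | rfl
    · exact (esc N hN (hag2 0 (by decide) (by decide)) hg1 (by rw [hag2 3 (by decide) (by decide)]; exact h3)).elim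
    · exact (esc N hN (hag2 0 (by decide) (by decide)) hg1 (fun e => by rw [e] at hj1; simp only at hj1; omega)).elim

/-! ### §7b the origin pin at the sub-apex rows and the double sub-apex `N{O, A, A, X}`: fork descent with typed escapes -/

/-- **N-STEP of the origin sub-apex rows** (RULE D on E₋, A2I⁻, `S₄`): `N{O, B, A, X}` (`X ≠ O`) is absent provided the `P`-rows
`P{O, B, A, X′}`, `X′ ≠ O` strictly lower, are (`ih`) and its A2I⁻ companion `P{O, B, A, X}` is (`hB`). -/
theorem originA_stepN {h : ℤ} {C : MConfig} (hU : C.InDiamond h) (hDN : ∀ Z ∈ C.lower, RuleDMu4N C Z) (hA : A2IMinusClosed C)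
    (hGl : PermClosed C.lower) (hGu : PermClosed C.upper) {x : BPoint} (hx : x ≠ (0, 0, 0)) {B : BPoint}
    (ih : ∀ P ∈ C.upper, P 0 = (0, 0, 0) → P 1 = B → P 2 = (h - 2, 0, 0) → P 3 ≠ (0, 0, 0) → (P 3).1 < x.1 → False)
    (hB : ∀ P ∈ C.upper, P 0 = (0, 0, 0) → P 1 = B → P 2 = (h - 2, 0, 0) → P 3 = x → False)
    {N : MCell} (hN : N ∈ C.lower) (h0 : N 0 = (0, 0, 0)) (h1 : N 1 = B) (h2 : N 2 = (h - 2, 0, 0)) (h3 : N 3 = x) : False := by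
  obtain ⟨hN', e0, e1, e2, e3⟩ := perm23_lower hGl hN
  refine originPin_lower_step' hU hDN hA hGl hGu hN' (e0.trans h0) (by rw [e2, h3]; exact hx) fun P hP hP0 hP1 hP3 hle => ?_
  by_contra hP2
  obtain ⟨hP', f0, f1, f2, f3⟩ := perm23_upper hGu hP
  rcases hle with hlt | ⟨heq, -⟩
  · rw [e2, h3] at hlt
    exact ih _ hP' (f0.trans hP0) (by rw [f1, hP1, e1, h1]) (by rw [f2, hP3, e3, h2]) (by rw [f3]; exact hP2) (by rw [f3]; exact hlt)
  · exact hB _ hP' (f0.trans hP0) (by rw [f1, hP1, e1, h1]) (by rw [f2, hP3, e3, h2]) (by rw [f3, heq, e2, h3])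

/-- **fork descent at the double sub-apex.** [◇_h, RULE D both levels, X⁺, A2I⁻, `S₄`; T9]  If `Z = N{O, A, A, X}` (`X ≠ O`) is present:
RULE D at `Z` (floor letter `O`) gives two `P`-partners `P{O, σ_d(u), A, X}` below slot `1` in DIFFERENT directions; `xplus_fork_esc` at the
pair of minimal total depth (free slot `f = 2`, the other `A`): a between-sibling `N{O, σ_{d′}, A, X}` has, by the origin pin and A2I⁻
(`originA_stepN`, rows below `X` absent by `ih`), a companion `P{O, σ_{d′}, A, X}` — a closer partner (descent); an (H-e′) breaker not
causally below `A` is a ceiling letter, every `W_f` ∕ (H-b) escape carries `cu_r` at slot `2` over a floor letter at slot `0` — T9 cells. -/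
theorem originSubapex_forkDescent {h μ : ℤ} {C : MConfig} (hU : C.InDiamond h) (hDN : ∀ Z ∈ C.lower, RuleDMu4N C Z)
    (hDP : ∀ P ∈ C.upper, RuleDMu4P C P) (hX : XPlusClosed C) (hA : A2IMinusClosed C) (hGl : PermClosed C.lower) (hGu : PermClosed C.upper)
    (hh : h = 2 * μ) (hμ : 2 ≤ μ) {x : BPoint} (hx : x ≠ (0, 0, 0))
    (ih : ∀ B : BPoint, B ≠ (h - 2, 0, 0) →
      ∀ P ∈ C.upper, P 0 = (0, 0, 0) → P 1 = B → P 2 = (h - 2, 0, 0) → P 3 ≠ (0, 0, 0) → (P 3).1 < x.1 → False)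
    {Z : MCell} (hZ : Z ∈ C.lower) (h0 : Z 0 = (0, 0, 0)) (h1 : Z 1 = (h - 2, 0, 0)) (h2 : Z 2 = (h - 2, 0, 0)) (h3 : Z 3 = x) :
    False := by
  have hA1 : (Z 1).1 = h - 2 := by rw [h1]
  -- T9 at the origin, ceiling letter at slot `2` or at slot `1`
  have t9 : ∀ X ∈ C.lower, X 0 = (0, 0, 0) → IsCeil h μ (X 2) → X 3 ≠ (0, 0, 0) → False := fun X hXl hX0 hY hX3 =>
    blockN_absent hU hDN hDP hX hA hGl hGu hh (by omega) 0 le_rfl (by omega) (hX0.trans (ray_zero _ 0).symm) hY hX3 hXl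
  have t9' : ∀ X ∈ C.lower, X 0 = (0, 0, 0) → IsCeil h μ (X 1) → X 3 ≠ (0, 0, 0) → False := fun X hXl hX0 hY hX3 => by
    obtain ⟨hX', e0, -, e2, e3⟩ := perm12_lower hGl hXl
    exact t9 _ hX' (e0.trans hX0) (by rw [e2]; exact hY) (by rw [e3]; exact hX3)
  -- (AB) a sibling of `Z` at slot `1` strictly below `A` has its A2I⁻ companion
  have hAB : ∀ X ∈ C.lower, MAgree X Z 1 → (X 1).1 < h - 2 → ∃ P ∈ C.upper, MAgree P Z 1 ∧ P 1 = X 1 := by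
    intro X hXl hag hlt
    have hne : X 1 ≠ (h - 2, 0, 0) := fun e => by rw [e] at hlt; simp only at hlt; omega
    by_contra hno
    refine originA_stepN hU hDN hA hGl hGu hx (ih (X 1) hne) (fun P hP hP0 hP1 hP2 hP3 => hno ⟨P, hP, ?_, hP1⟩)
      hXl ((hag 0 (by decide)).trans h0) rfl ((hag 2 (by decide)).trans h2) ((hag 3 (by decide)).trans h3)
    intro g hg
    fin_cases g
    · exact hP0.trans h0.symm
    · exact absurd rfl hg
    · exact hP2.trans h2.symm
    · exact hP3.trans h3.symm
  -- descent on the total depth of two partners of slot `1` in different directions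
  have desc : ∀ m : ℕ, ∀ r₁ r₂ : Fin 4, r₂ ≠ r₁ → ∀ P₁ ∈ C.upper, ∀ P₂ ∈ C.upper, UPartner Z P₁ 1 r₁ → UPartner Z P₂ 1 r₂ →
      (h - 2 - (P₁ 1).1) + (h - 2 - (P₂ 1).1) ≤ m → False := by
    intro m
    induction m with
    | zero => intro r₁ r₂ _ P₁ _ P₂ _ hu1 hu2 hm; have := hu1.2.1; have := hu2.2.1; push_cast at hm; omega
    | succ m ihm =>
      intro r₁ r₂ hr P₁ hP₁ P₂ hP₂ hu1 hu2 hm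
      have h1ray : ((h - 2, 0, 0) : BPoint) = ray (P₁ 1) r₁ ((Z 1).1 - (P₁ 1).1) := h1.symm.trans hu1.2.2
      have hP₁0 : P₁ 0 = (0, 0, 0) := (hu1.1 0 (by decide)).trans h0
      have hP₁2 : P₁ 2 = (h - 2, 0, 0) := (hu1.1 2 (by decide)).trans h2
      have hP₁3 : P₁ 3 = x := (hu1.1 3 (by decide)).trans h3
      have hx0 : 0 ≤ x.1 := by rw [← h3]; exact fst_nonneg_of_inDiamond (hU.1 Z hZ 3)
      have above2 : ∀ X ∈ C.lower, NullBelow (P₁ 2) (X 2) → IsCeil h μ (X 2) := fun X hXl hnb =>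
        isCeil_of_fst_gt hh (by omega) (hU.1 X hXl 2) (by have e := hnb.1; rw [hP₁2] at e; exact e)
      refine xplus_fork_esc hX hZ (g := 1) (f := 2) (by decide) hP₁ hP₂ hr hu1 hu2
        (not_isApex_below_apex (by have := hu1.2.1; omega) h1ray) ?_ ?_ ?_ ?_ ?_ ?_
      · -- an `N`-server of `P₁` strictly below `A` on the `r₁`-ray: a between-sibling, hence a closer `r₁`-partner
        intro X hXl hu
        by_contra hle
        have hlt : (X 1).1 < (Z 1).1 := not_le.mp hle
        have hagZ : MAgree X Z 1 := fun j hj => (hu.1 j hj).symm.trans (hu1.1 j hj)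
        obtain ⟨P', hP', hag', hP'1⟩ := hAB X hXl hagZ (by omega)
        have hray' : Z 1 = ray (X 1) r₁ ((Z 1).1 - (X 1).1) := by
          have eZ := hu1.2.2
          have eX := hu.2.2
          calc Z 1 = ray (P₁ 1) r₁ (((X 1).1 - (P₁ 1).1) + ((Z 1).1 - (X 1).1)) := by
                rw [show ((X 1).1 - (P₁ 1).1) + ((Z 1).1 - (X 1).1) = (Z 1).1 - (P₁ 1).1 by ring]; exact eZ
            _ = ray (X 1) r₁ ((Z 1).1 - (X 1).1) := by rw [ray_add, ← eX]
        have hu' : UPartner Z P' 1 r₁ := ⟨hag', by rw [hP'1]; exact hlt, by rw [hP'1]; exact hray'⟩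
        exact ihm r₁ r₂ hr P' hP' P₂ hP₂ hu' hu2 (by rw [hP'1]; have := hu.2.1; push_cast at hm ⊢; omega)
      · -- an `N`-twin strictly between `P₂ 1` and `A` on the `r₂`-ray: a closer `r₂`-partner
        intro X hXl hag hlt1 hlt2 hray
        obtain ⟨P', hP', hag', hP'1⟩ := hAB X hXl hag (by omega)
        have hu' : UPartner Z P' 1 r₂ := ⟨hag', by rw [hP'1]; exact hlt1, by rw [hP'1]; exact hray⟩
        exact ihm r₁ r₂ hr P₁ hP₁ P' hP' hu1 hu' (by rw [hP'1]; push_cast at hm ⊢; omega)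
      · -- (H-e′): a letter of ◇_h is causally below `A` or a ceiling letter — and then the breaker is a T9 cell
        intro X hXl hag _ _ _
        rcases isCeil_or_low hh (by omega) (hU.1 X hXl 1) with hc | hlow
        · exact (t9' X hXl ((hag 0 (by decide)).trans hP₁0) hc (by rw [hag 3 (by decide), hP₁3]; exact hx)).elim
        · rw [h1]; exact effective_ceilingApex_sub (inDiamond_sub_two (hU.1 X hXl 1) hlow)
      · -- (H-b): agreeing with `P₁` off `{1, 2}`, strictly above `A` at slot `2`
        intro X hXl hag2 hnb
        exact t9 X hXl ((hag2 0 (by decide) (by decide)).trans hP₁0) (above2 X hXl hnb)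
          (by rw [hag2 3 (by decide) (by decide), hP₁3]; exact hx)
      · -- a leg of `P₁` on slot `2`
        intro X hXl hag hnb
        exact t9 X hXl ((hag 0 (by decide)).trans hP₁0) (above2 X hXl hnb) (by rw [hag 3 (by decide), hP₁3]; exact hx)
      · -- a cover of `P₁` through slot `2` and `g′`
        intro X hXl g' hg' hag2 hnb hnb'
        have hY := above2 X hXl hnb
        by_cases hg0 : g' = 0
        · -- the floor slot raised: `X 0 = e·ℓ_ψ`
          subst hg0
          rw [hP₁0] at hnb'
          obtain ⟨ψ, hX0⟩ := exists_eq_floorLetter_of_nullBelow_origin (hU.1 X hXl 0).1 hnb'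
          have he : 0 < (X 0).1 := hnb'.1
          have h2e : 2 * (X 0).1 ≤ h :=
            two_mul_le_of_floorLetter_inDiamond (c := (X 0).1) (u := ψ) (by omega) (by rw [← hX0]; exact hU.1 X hXl 0)
          exact blockN_absent hU hDN hDP hX hA hGl hGu hh (by omega) ψ (c := (X 0).1) (by omega) (by omega) hX0 hY
            (by rw [hag2 3 (by decide) (by decide), hP₁3]; exact hx) hXl
        · have hX0 : X 0 = (0, 0, 0) := (hag2 0 (by decide) (fun e => hg0 e.symm)).trans hP₁0
          by_cases hg3 : g' = 3
          · subst hg3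
            exact t9 X hXl hX0 hY (fun e => by have e' := hnb'.1; rw [e, hP₁3] at e'; simp only at e'; omega)
          · exact t9 X hXl hX0 hY (by rw [hag2 3 (by decide) (fun e => hg3 e.symm), hP₁3]; exact hx)
  -- two partners of slot `1` in different directions (RULE D at `N`, floor letter `O`)
  have hk : ∀ k : Fin 4, Adapted (Z 1) k := fun k => by rw [h1]; fin_cases k <;> simp [Adapted]
  have hk0 : ∀ k : Fin 4, coord (Z 1) k ≠ 0 := fun k => by rw [h1]; fin_cases k <;> simp [coord] <;> omega
  have hfl : OnFloor (Z 0) := by rw [h0]; exact onFloor_origin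
  have h22 : ∀ r : Fin 4, r + 2 + 2 = r := by decide
  obtain ⟨r₁, -, P₁, hP₁, hu1⟩ := servedBelow_floor_dir hU hZ (hDN Z hZ) (i := 0) (g := 1) (by decide) hfl (hk 0) (hk0 0)
  obtain ⟨r₂, hr₂, P₂, hP₂, hu2⟩ :=
    servedBelow_floor_dir hU hZ (hDN Z hZ) (i := 0) (g := 1) (by decide) hfl (hk (r₁ + 2)) (hk0 (r₁ + 2))
  have hr : r₂ ≠ r₁ := fun e => hr₂ (by rw [e, h22])
  exact desc (((h - 2 - (P₁ 1).1) + (h - 2 - (P₂ 1).1)).toNat) r₁ r₂ hr P₁ hP₁ P₂ hP₂ hu1 hu2 (Int.self_le_toNat _)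

/-! ### §7c all origin sub-apex rows at one `X`, the induction on the height of `X`, the corners -/

/-- at a fixed `X ≠ O`: from the `P`-rows `P{O, B, A, X′}` (`B ≠ A`) at all strictly lower `X′` (`ih`), every origin sub-apex row at `X`:
`N{O, B, A, X}` for EVERY `B`, `P{O, B, A, X}` for `B ≠ A`.  The double sub-apex first (§7b), then induction on the depth `h − B.1`
(the pseudo-pin `A` raises `B`; the origin pin lowers `X` or hands the A2I⁻ companion). -/
theorem originSubapex_atX {h μ : ℤ} {C : MConfig} (hU : C.InDiamond h) (hDN : ∀ Z ∈ C.lower, RuleDMu4N C Z)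
    (hDP : ∀ P ∈ C.upper, RuleDMu4P C P) (hX : XPlusClosed C) (hA : A2IMinusClosed C) (hGl : PermClosed C.lower) (hGu : PermClosed C.upper)
    (hh : h = 2 * μ) (hμ : 2 ≤ μ) {x : BPoint} (hx : x ≠ (0, 0, 0))
    (ih : ∀ B : BPoint, B ≠ (h - 2, 0, 0) →
      ∀ P ∈ C.upper, P 0 = (0, 0, 0) → P 1 = B → P 2 = (h - 2, 0, 0) → P 3 ≠ (0, 0, 0) → (P 3).1 < x.1 → False) :
    (∀ N ∈ C.lower, N 0 = (0, 0, 0) → N 2 = (h - 2, 0, 0) → N 3 = x → False) ∧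
    (∀ P ∈ C.upper, P 0 = (0, 0, 0) → P 2 = (h - 2, 0, 0) → P 3 = x → P 1 ≠ (h - 2, 0, 0) → False) := by
  -- stage 2: the double sub-apex row
  have stage2 : ∀ N ∈ C.lower, N 0 = (0, 0, 0) → N 1 = (h - 2, 0, 0) → N 2 = (h - 2, 0, 0) → N 3 = x → False :=
    fun N hN h0 h1 h2 h3 => originSubapex_forkDescent hU hDN hDP hX hA hGl hGu hh hμ hx ih hN h0 h1 h2 h3
  -- stage 3: induction on the depth of `B`
  have stage3 : ∀ n : ℕ,
      (∀ P ∈ C.upper, P 0 = (0, 0, 0) → P 2 = (h - 2, 0, 0) → P 3 = x → P 1 ≠ (h - 2, 0, 0) → h - (P 1).1 < n → False) ∧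
      (∀ N ∈ C.lower, N 0 = (0, 0, 0) → N 2 = (h - 2, 0, 0) → N 3 = x → h - (N 1).1 < n → False) := by
    intro n
    induction n with
    | zero =>
      exact ⟨fun P hP _ _ _ _ hlt => by have := fst_le_of_inDiamond (hU.2 P hP 1); push_cast at hlt; omega,
        fun N hN _ _ _ hlt => by have := fst_le_of_inDiamond (hU.1 N hN 1); push_cast at hlt; omega⟩
    | succ n ihn =>
      have hPn : ∀ P ∈ C.upper, P 0 = (0, 0, 0) → P 2 = (h - 2, 0, 0) → P 3 = x → P 1 ≠ (h - 2, 0, 0) →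
          h - (P 1).1 < ((n + 1 : ℕ) : ℤ) → False := by
        intro P hP h0 h2 h3 h1 hlt
        obtain ⟨k, hk, hkh⟩ := exists_frame_ne_val (hU.2 P hP 1).1 (h - 2) h1
        obtain ⟨r, N, hN, hNP⟩ := servedAbove_subapex_pin hU hDN hDP hX hA hGl hGu hh (by omega) (φ := 0) (c := 0) le_rfl (by omega)
          hP (h0.trans (ray_zero _ 0).symm) h2 (by rw [h3]; exact hx) (Or.inl rfl) hk hkh
        exact ihn.2 N hN ((hNP.1 0 (by decide)).symm.trans h0) ((hNP.1 2 (by decide)).symm.trans h2)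
          ((hNP.1 3 (by decide)).symm.trans h3) (by have := hNP.2.1; push_cast at hlt ⊢; omega)
      refine ⟨hPn, fun N hN h0 h2 h3 hlt => ?_⟩
      by_cases hN1 : N 1 = (h - 2, 0, 0)
      · exact stage2 N hN h0 hN1 h2 h3
      · exact originA_stepN hU hDN hA hGl hGu hx (ih (N 1) hN1)
          (fun P hP hP0 hP1 hP2 hP3 => hPn P hP hP0 hP2 hP3 (by rw [hP1]; exact hN1) (by rw [hP1]; exact hlt)) hN h0 rfl h2 h3
  exact ⟨fun N hN h0 h2 h3 => (stage3 ((h - (N 1).1).toNat + 1)).2 N hN h0 h2 h3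
      (by have := Int.self_le_toNat (h - (N 1).1); push_cast; omega),
    fun P hP h0 h2 h3 h1 => (stage3 ((h - (P 1).1).toNat + 1)).1 P hP h0 h2 h3 h1
      (by have := Int.self_le_toNat (h - (P 1).1); push_cast; omega)⟩

/-- the induction on the height of `X`. -/
theorem originSubapex_aux {h μ : ℤ} {C : MConfig} (hU : C.InDiamond h) (hDN : ∀ Z ∈ C.lower, RuleDMu4N C Z)
    (hDP : ∀ P ∈ C.upper, RuleDMu4P C P) (hX : XPlusClosed C) (hA : A2IMinusClosed C) (hGl : PermClosed C.lower) (hGu : PermClosed C.upper)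
    (hh : h = 2 * μ) (hμ : 2 ≤ μ) :
    ∀ t : ℕ, ∀ x : BPoint, x ≠ (0, 0, 0) → x.1 ≤ t →
      (∀ N ∈ C.lower, N 0 = (0, 0, 0) → N 2 = (h - 2, 0, 0) → N 3 = x → False) ∧
      (∀ P ∈ C.upper, P 0 = (0, 0, 0) → P 2 = (h - 2, 0, 0) → P 3 = x → P 1 ≠ (h - 2, 0, 0) → False) := by
  intro t
  induction t with
  | zero =>
    intro x hx hxt
    exact originSubapex_atX hU hDN hDP hX hA hGl hGu hh hμ hx fun B _ P hP _ _ _ _ hlt => by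
      have := fst_nonneg_of_inDiamond (hU.2 P hP 3); push_cast at hxt; omega
  | succ t iht =>
    intro x hx hxt
    exact originSubapex_atX hU hDN hDP hX hA hGl hGu hh hμ hx fun B hB P hP h0 h1 h2 h3 hlt =>
      (iht (P 3) h3 (by push_cast at hxt; omega)).2 P hP h0 h2 rfl (by rw [h1]; exact hB)

/-! ### T11 -/

/-- **T11, level `N`.** [◇_h, RULE D both levels `RuleDMu4N ∕ RuleDMu4P`, X⁺ `XPlusClosed`, A2I⁻ `A2IMinusClosed`, `S₄` both levels
`PermClosed`; `h = 2μ`, `μ ≥ 2`]  `N{O, B, A, X} ∉ C.lower` for EVERY `B` and every `X ≠ O` (`A = (h−2)·I` the sub-apex). -/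
theorem originSubapexN_absent {h μ : ℤ} {C : MConfig} (hU : C.InDiamond h) (hDN : ∀ Z ∈ C.lower, RuleDMu4N C Z)
    (hDP : ∀ P ∈ C.upper, RuleDMu4P C P) (hX : XPlusClosed C) (hA : A2IMinusClosed C) (hGl : PermClosed C.lower) (hGu : PermClosed C.upper)
    (hh : h = 2 * μ) (hμ : 2 ≤ μ) {N : MCell} (h0 : N 0 = (0, 0, 0)) (h2 : N 2 = (h - 2, 0, 0)) (h3 : N 3 ≠ (0, 0, 0)) :
    N ∉ C.lower := fun hN =>
  (originSubapex_aux hU hDN hDP hX hA hGl hGu hh hμ (N 3).1.toNat (N 3) h3 (Int.self_le_toNat _)).1 N hN h0 h2 rfl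

/-- **T11, level `P`, `B ≠ A`.** [same]  `P{O, B, A, X} ∉ C.upper` for every `B ≠ A` and every `X ≠ O`. -/
theorem originSubapexP_absent' {h μ : ℤ} {C : MConfig} (hU : C.InDiamond h) (hDN : ∀ Z ∈ C.lower, RuleDMu4N C Z)
    (hDP : ∀ P ∈ C.upper, RuleDMu4P C P) (hX : XPlusClosed C) (hA : A2IMinusClosed C) (hGl : PermClosed C.lower) (hGu : PermClosed C.upper)
    (hh : h = 2 * μ) (hμ : 2 ≤ μ) {P : MCell} (h0 : P 0 = (0, 0, 0)) (h1 : P 1 ≠ (h - 2, 0, 0)) (h2 : P 2 = (h - 2, 0, 0))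
    (h3 : P 3 ≠ (0, 0, 0)) : P ∉ C.upper := fun hP =>
  (originSubapex_aux hU hDN hDP hX hA hGl hGu hh hμ (P 3).1.toNat (P 3) h3 (Int.self_le_toNat _)).2 P hP h0 h2 rfl h1

/-- **T11, level `P`, `X ≠ A`.** [same]  `P{O, B, A, X} ∉ C.upper` for `X ∉ {O, A}` and EVERY `B` — the pseudo-pin raises `X`
(pair `(A, X)`), the server is the row `N{O, B, A, X↑}`.  (`P{O, A, A, A}` is present in the census worlds: its servers `N{e·ℓ_ψ, A, A, A}`
are general-`F` rows.) -/
theorem originSubapexP_absent_of_ne {h μ : ℤ} {C : MConfig} (hU : C.InDiamond h) (hDN : ∀ Z ∈ C.lower, RuleDMu4N C Z)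
    (hDP : ∀ P ∈ C.upper, RuleDMu4P C P) (hX : XPlusClosed C) (hA : A2IMinusClosed C) (hGl : PermClosed C.lower) (hGu : PermClosed C.upper)
    (hh : h = 2 * μ) (hμ : 2 ≤ μ) {P : MCell} (h0 : P 0 = (0, 0, 0)) (h2 : P 2 = (h - 2, 0, 0)) (h3 : P 3 ≠ (0, 0, 0))
    (h3A : P 3 ≠ (h - 2, 0, 0)) : P ∉ C.upper := fun hP => by
  obtain ⟨k, hk, hkh⟩ := exists_frame_ne_val (hU.2 P hP 3).1 (h - 2) h3A
  obtain ⟨r, N, hN, hNP⟩ := servedAbove_subapex_pin hU hDN hDP hX hA hGl hGu hh (by omega) (φ := 0) (c := 0) le_rfl (by omega) hP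
    (h0.trans (ray_zero _ 0).symm) h2 h3 (Or.inr rfl) hk hkh
  exact originSubapexN_absent hU hDN hDP hX hA hGl hGu hh hμ ((hNP.1 0 (by decide)).symm.trans h0) ((hNP.1 2 (by decide)).symm.trans h2)
    (fun e => by have e' := hNP.2.1; rw [e] at e'; have := fst_nonneg_of_inDiamond (hU.2 P hP 3); simp only at e'; omega) hN

/-- **T11, level `P`.** [same]  `P{O, B, A, X} ∉ C.upper` for every `X ≠ O` and every `B`, unless `B = X = A`. -/
theorem originSubapexP_absent {h μ : ℤ} {C : MConfig} (hU : C.InDiamond h) (hDN : ∀ Z ∈ C.lower, RuleDMu4N C Z)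
    (hDP : ∀ P ∈ C.upper, RuleDMu4P C P) (hX : XPlusClosed C) (hA : A2IMinusClosed C) (hGl : PermClosed C.lower) (hGu : PermClosed C.upper)
    (hh : h = 2 * μ) (hμ : 2 ≤ μ) {P : MCell} (h0 : P 0 = (0, 0, 0)) (h2 : P 2 = (h - 2, 0, 0)) (h3 : P 3 ≠ (0, 0, 0))
    (hBX : P 1 ≠ (h - 2, 0, 0) ∨ P 3 ≠ (h - 2, 0, 0)) : P ∉ C.upper := by
  by_cases h3A : P 3 = (h - 2, 0, 0)
  · exact originSubapexP_absent' hU hDN hDP hX hA hGl hGu hh hμ h0 (hBX.resolve_right (not_not.mpr h3A)) h2 h3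
  · exact originSubapexP_absent_of_ne hU hDN hDP hX hA hGl hGu hh hμ h0 h2 h3 h3A

/-- **T11 in letters, level `N`**: `N{O, B, A, x} ∉ C.lower` with the sub-apex written `σ_0 = subDiagLetter h u 0`?  No — stated plainly:
`N{O, B, (h−2)·I, c′·ℓ_u} ∉ C.lower` for `1 ≤ c′ ≤ μ` (the floor instances, peel rounds up to 18 at ◇₁₀). -/
theorem originSubapexFloorN_absent {h μ c' : ℤ} {C : MConfig} (hU : C.InDiamond h) (hDN : ∀ Z ∈ C.lower, RuleDMu4N C Z)
    (hDP : ∀ P ∈ C.upper, RuleDMu4P C P) (hX : XPlusClosed C) (hA : A2IMinusClosed C) (hGl : PermClosed C.lower) (hGu : PermClosed C.upper)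
    (hh : h = 2 * μ) (hμ : 2 ≤ μ) (u : Fin 4) (hc1 : 1 ≤ c') {N : MCell} (h0 : N 0 = (0, 0, 0)) (h2 : N 2 = (h - 2, 0, 0))
    (h3 : N 3 = floorLetter u c') : N ∉ C.lower :=
  originSubapexN_absent hU hDN hDP hX hA hGl hGu hh hμ h0 h2 (by rw [h3]; exact floorLetter_ne_origin u (by omega))

/-! ## §8 T12 (CONDITIONAL) — THE SUB-APEX BLOCK OVER A CHARGED FLOOR LETTER `{c·ℓ_φ, B, A, X}`, `1 ≤ c ≤ μ − 1`, FROM THE RAISED-FLOOR ESCAPE ROWS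

The §7 argument over `F = c·ℓ_φ`, `c ≥ 1`, is SIMPLER than at the origin except at one point.  Simpler: the floor pin serves `X` strictly
below (no A2I⁻ companion), so at a fixed `X` the rows `N{F, B, A, X}`, `B ≠ A`, need only the lower `P`-rows, the between-siblings of the
fork are then plainly absent (no descent), and the `P`-rows close on the spot against the `N`-rows (no inner induction); the `X′ = O` child
`P{F, B, A, O}` is the T11 row `P{O, B, A, F}`.  The one point: the (r2a) cover of the fork head through the FLOOR slot may raise `c·ℓ_φ`
OFF the floor (to `2e·I + (c−e)·ℓ_φ` or `2c·I + (e−c)·ℓ_{φ+2}`), and the escape `N{F′, σ_d(w), cu_r, X}` is then floor-free — no typed family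
reaches it.  `SubapexEscapeFree C h μ` is exactly the absence of these rows (`F′` non-floor null-above some `c·ℓ_φ`, `1 ≤ c < μ`; slot `1`
strictly null-below `A`; slot `2` strictly above the sub-apex line; `X ≠ O`), and T12 is the block CONDITIONAL on it:
`N{c·ℓ_φ, B, A, X} ∉ C.lower` (every `B`, `X ≠ O`), `P{c·ℓ_φ, B, A, X} ∉ C.upper` (`X ≠ O`, not `B = X = A`), `1 ≤ c ≤ μ − 1`
(`c = 0` is T11, `c = μ` is T10; `P{(μ−1)·ℓ, A, A, A}` IS present).  CENSUS of the hypothesis (`tools/rfrows.py 6 8 10`): the raised-floor rows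
are ◇₆ 1 582 ∕ ◇₈ 7 276 ∕ ◇₁₀ 23 082 orbits, ALL census-absent (0 present), of which ◇₆ 314 ∕ ◇₈ 2 228 ∕ ◇₁₀ 8 962 untyped, at peel rounds
3 – 6 ∕ 2 – 13 ∕ 2 – 24 — the deepest cells of the census; typing them is the g24 item, and this § is what it buys. -/

/-- **the raised-floor escape rows are absent**: no `N`-cell has a NON-floor letter strictly null-above a charged floor letter `c·ℓ_φ`
(`1 ≤ c < μ`) at slot `0`, a letter strictly null-below the sub-apex `A` at slot `1`, a letter strictly above the sub-apex line at slot `2`,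
and `X ≠ O` at slot `3`.  (Census-true at `h ∈ {6, 8, 10}`; untyped.) -/
def SubapexEscapeFree (C : MConfig) (h μ : ℤ) : Prop :=
  ∀ N ∈ C.lower, ∀ φ : Fin 4, ∀ c : ℤ, 1 ≤ c → c < μ → NullBelow (floorLetter φ c) (N 0) → ¬ OnFloor (N 0) → (N 1).1 < h - 2 →
    (∃ r : Fin 4, ((h - 2, 0, 0) : BPoint) = ray (N 1) r ((h - 2) - (N 1).1)) → h - 2 < (N 2).1 → N 3 ≠ (0, 0, 0) → False

/-- a floor point of positive height is strictly null-above the origin. -/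
theorem nullBelow_origin_of_onFloor {z : BPoint} (hzax : z.2 = (0, 0) ∨ AxisPt z) (hfl : OnFloor z) (hpos : 0 < z.1) :
    NullBelow (0, 0, 0) z := by
  obtain ⟨α, a, b⟩ := z
  simp only [AxisPt, Prod.mk.injEq] at hzax
  simp only [OnFloor, absCharge, chargeOf] at hfl
  simp only [NullBelow, sub_zero]
  simp only at hpos
  refine ⟨hpos, ?_⟩
  rcases hzax with ⟨ha, hb⟩ | ⟨ha, hb⟩ | ⟨ha, hb⟩
  · subst ha; subst hb; simp at hfl; omega
  · subst hb; simp only [sub_zero] at hfl; rw [hfl, sq_abs]; ring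
  · subst ha; simp only [zero_sub, abs_neg] at hfl; rw [hfl, sq_abs]; ring

/-- **N-STEP over a charged floor letter**: `N{c·ℓ_φ, B, A, X}` (`c ≥ 1`, `B ≠ A`, `X ≠ O`) is absent provided the `P`-rows `P{c·ℓ_φ, B, A, X′}`,
`X′ ≠ O` strictly lower, are (`ih`); the `X′ = O` child is the T11 row `P{O, B, A, c·ℓ_φ}`. -/
theorem floorA_stepN {h μ c : ℤ} {C : MConfig} (hU : C.InDiamond h) (hDN : ∀ Z ∈ C.lower, RuleDMu4N C Z)
    (hDP : ∀ P ∈ C.upper, RuleDMu4P C P) (hX : XPlusClosed C) (hA : A2IMinusClosed C) (hGl : PermClosed C.lower) (hGu : PermClosed C.upper)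
    (hh : h = 2 * μ) (hμ : 2 ≤ μ) {φ : Fin 4} (hc1 : 1 ≤ c) (hcμ : c < μ) {x : BPoint} (hx : x ≠ (0, 0, 0)) {B : BPoint}
    (ih : ∀ P ∈ C.upper, P 0 = floorLetter φ c → P 1 = B → P 2 = (h - 2, 0, 0) → P 3 ≠ (0, 0, 0) → (P 3).1 < x.1 → False)
    {N : MCell} (hN : N ∈ C.lower) (h0 : N 0 = floorLetter φ c) (h1 : N 1 = B) (h2 : N 2 = (h - 2, 0, 0)) (h3 : N 3 = x) : False := by
  have hfl : OnFloor (N 0) := by rw [h0]; exact onFloor_floorLetter φ (by omega)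
  obtain ⟨k, hk, hk0⟩ := exists_frame_ne_zero (hU.1 N hN 3).1 (by rw [h3]; exact hx)
  obtain ⟨r, -, P, hP, hNP⟩ := servedBelow_floor_dir hU hN (hDN N hN) (i := 0) (g := 3) (by decide) hfl hk hk0
  have hP0 : P 0 = floorLetter φ c := (hNP.1 0 (by decide)).trans h0
  have hP1 : P 1 = B := (hNP.1 1 (by decide)).trans h1
  have hP2 : P 2 = (h - 2, 0, 0) := (hNP.1 2 (by decide)).trans h2
  have hlt : (P 3).1 < x.1 := by rw [← h3]; exact hNP.2.1
  by_cases hP3 : P 3 = (0, 0, 0)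
  · -- the child `{F, B, A, O}` is the T11 row `{O, B, A, F}`
    obtain ⟨hP', f0, -, f2, f3⟩ := perm03_upper hGu hP
    exact originSubapexP_absent hU hDN hDP hX hA hGl hGu hh hμ (f0.trans hP3) (f2.trans hP2)
      (by rw [f3, hP0]; exact floorLetter_ne_origin φ (by omega))
      (Or.inr (by rw [f3, hP0]; exact floorLetter_ne_hI φ (by omega))) hP'
  · exact ih P hP hP0 hP1 hP2 hP3 hlt

/-- **the fork at the double sub-apex over a charged floor letter** — no descent: the between-siblings `N{c·ℓ_φ, σ, A, X}` are absent
outright (`hsib`); the escapes are T9 cells or raised-floor rows (`hRF`). -/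
theorem floorSubapex_fork {h μ c : ℤ} {C : MConfig} (hU : C.InDiamond h) (hDN : ∀ Z ∈ C.lower, RuleDMu4N C Z)
    (hDP : ∀ P ∈ C.upper, RuleDMu4P C P) (hX : XPlusClosed C) (hA : A2IMinusClosed C) (hGl : PermClosed C.lower) (hGu : PermClosed C.upper)
    (hh : h = 2 * μ) {φ : Fin 4} (hc1 : 1 ≤ c) (hcμ : c < μ) (hRF : SubapexEscapeFree C h μ) {x : BPoint} (hx : x ≠ (0, 0, 0))
    (hsib : ∀ X ∈ C.lower, X 0 = floorLetter φ c → X 2 = (h - 2, 0, 0) → X 3 = x → (X 1).1 < h - 2 → False)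
    {Z : MCell} (hZ : Z ∈ C.lower) (h0 : Z 0 = floorLetter φ c) (h1 : Z 1 = (h - 2, 0, 0)) (h2 : Z 2 = (h - 2, 0, 0)) (h3 : Z 3 = x) :
    False := by
  have hμ : 1 ≤ μ := by omega
  have hA1 : (Z 1).1 = h - 2 := by rw [h1]
  have t9 : ∀ X ∈ C.lower, X 0 = floorLetter φ c → IsCeil h μ (X 2) → X 3 ≠ (0, 0, 0) → False := fun X hXl hX0 hY hX3 =>
    blockN_absent hU hDN hDP hX hA hGl hGu hh hμ φ (by omega) (by omega) hX0 hY hX3 hXl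
  have t9' : ∀ X ∈ C.lower, X 0 = floorLetter φ c → IsCeil h μ (X 1) → X 3 ≠ (0, 0, 0) → False := fun X hXl hX0 hY hX3 => by
    obtain ⟨hX', e0, -, e2, e3⟩ := perm12_lower hGl hXl
    exact t9 _ hX' (e0.trans hX0) (by rw [e2]; exact hY) (by rw [e3]; exact hX3)
  -- two partners of slot `1` in different directions
  have hk : ∀ k : Fin 4, Adapted (Z 1) k := fun k => by rw [h1]; fin_cases k <;> simp [Adapted]
  have hk0 : ∀ k : Fin 4, coord (Z 1) k ≠ 0 := fun k => by rw [h1]; fin_cases k <;> simp [coord] <;> omega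
  have hfl : OnFloor (Z 0) := by rw [h0]; exact onFloor_floorLetter φ (by omega)
  have h22 : ∀ r : Fin 4, r + 2 + 2 = r := by decide
  obtain ⟨r₁, -, P₁, hP₁, hu1⟩ := servedBelow_floor_dir hU hZ (hDN Z hZ) (i := 0) (g := 1) (by decide) hfl (hk 0) (hk0 0)
  obtain ⟨r₂, hr₂, P₂, hP₂, hu2⟩ :=
    servedBelow_floor_dir hU hZ (hDN Z hZ) (i := 0) (g := 1) (by decide) hfl (hk (r₁ + 2)) (hk0 (r₁ + 2))
  have hr : r₂ ≠ r₁ := fun e => hr₂ (by rw [e, h22])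
  have h1ray : ((h - 2, 0, 0) : BPoint) = ray (P₁ 1) r₁ ((Z 1).1 - (P₁ 1).1) := h1.symm.trans hu1.2.2
  have hP₁0 : P₁ 0 = floorLetter φ c := (hu1.1 0 (by decide)).trans h0
  have hP₁2 : P₁ 2 = (h - 2, 0, 0) := (hu1.1 2 (by decide)).trans h2
  have hP₁3 : P₁ 3 = x := (hu1.1 3 (by decide)).trans h3
  have hx0 : 0 ≤ x.1 := by rw [← h3]; exact fst_nonneg_of_inDiamond (hU.1 Z hZ 3)
  have above2 : ∀ X ∈ C.lower, NullBelow (P₁ 2) (X 2) → h - 2 < (X 2).1 := fun X _ hnb => by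
    have e := hnb.1; rw [hP₁2] at e; exact e
  refine xplus_fork_esc hX hZ (g := 1) (f := 2) (by decide) hP₁ hP₂ hr hu1 hu2
    (not_isApex_below_apex (by have := hu1.2.1; omega) h1ray) ?_ ?_ ?_ ?_ ?_ ?_
  · -- an `N`-server of `P₁` strictly below `A`: a between-sibling, absent
    intro X hXl hu
    by_contra hle
    exact hsib X hXl ((hu.1 0 (by decide)).symm.trans hP₁0) ((hu.1 2 (by decide)).symm.trans hP₁2) ((hu.1 3 (by decide)).symm.trans hP₁3)
      (by have := not_le.mp hle; omega)
  · -- an `N`-twin strictly between: absent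
    intro X hXl hag hlt1 _ _
    exact (hsib X hXl ((hag 0 (by decide)).trans h0) ((hag 2 (by decide)).trans h2) ((hag 3 (by decide)).trans h3) (by omega)).elim
  · -- (H-e′)
    intro X hXl hag _ _ _
    rcases isCeil_or_low hh (by omega) (hU.1 X hXl 1) with hc | hlow
    · exact (t9' X hXl ((hag 0 (by decide)).trans hP₁0) hc (by rw [hag 3 (by decide), hP₁3]; exact hx)).elim
    · rw [h1]; exact effective_ceilingApex_sub (inDiamond_sub_two (hU.1 X hXl 1) hlow)
  · -- (H-b)
    intro X hXl hag2 hnb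
    exact t9 X hXl ((hag2 0 (by decide) (by decide)).trans hP₁0) (isCeil_of_fst_gt hh (by omega) (hU.1 X hXl 2) (above2 X hXl hnb))
      (by rw [hag2 3 (by decide) (by decide), hP₁3]; exact hx)
  · -- a leg on slot `2`
    intro X hXl hag hnb
    exact t9 X hXl ((hag 0 (by decide)).trans hP₁0) (isCeil_of_fst_gt hh (by omega) (hU.1 X hXl 2) (above2 X hXl hnb))
      (by rw [hag 3 (by decide), hP₁3]; exact hx)
  · -- a cover through slot `2` and `g′`
    intro X hXl g' hg' hag2 hnb hnb'
    have h2X := above2 X hXl hnb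
    have hY : IsCeil h μ (X 2) := isCeil_of_fst_gt hh (by omega) (hU.1 X hXl 2) h2X
    by_cases hg0 : g' = 0
    · subst hg0
      rw [hP₁0] at hnb'
      have hX3 : X 3 = x := (hag2 3 (by decide) (by decide)).trans hP₁3
      by_cases hflX : OnFloor (X 0)
      · -- the floor letter raised along the floor: T9
        have hpos : 0 < (X 0).1 := by have := hnb'.1; rw [floorLetter_fst] at this; omega
        obtain ⟨ψ, hX0⟩ := exists_eq_floorLetter_of_nullBelow_origin (hU.1 X hXl 0).1
          (nullBelow_origin_of_onFloor (hU.1 X hXl 0).1 hflX hpos)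
        have h2e : 2 * (X 0).1 ≤ h :=
          two_mul_le_of_floorLetter_inDiamond (c := (X 0).1) (u := ψ) (by omega) (by rw [← hX0]; exact hU.1 X hXl 0)
        exact blockN_absent hU hDN hDP hX hA hGl hGu hh hμ ψ (c := (X 0).1) (by omega) (by omega) hX0 hY (by rw [hX3]; exact hx) hXl
      · -- the floor letter raised OFF the floor: a raised-floor escape row
        have hX1 : X 1 = P₁ 1 := hag2 1 (by decide) (by decide)
        exact hRF X hXl φ c hc1 hcμ hnb' hflX (by rw [hX1]; have := hu1.2.1; omega) ⟨r₁, by rw [hX1, hA1] at *; exact h1ray⟩ h2X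
          (by rw [hX3]; exact hx)
    · have hX0 : X 0 = floorLetter φ c := (hag2 0 (by decide) (fun e => hg0 e.symm)).trans hP₁0
      by_cases hg3 : g' = 3
      · subst hg3
        exact t9 X hXl hX0 hY (fun e => by have e' := hnb'.1; rw [e, hP₁3] at e'; simp only at e'; omega)
      · exact t9 X hXl hX0 hY (by rw [hag2 3 (by decide) (fun e => hg3 e.symm), hP₁3]; exact hx)

/-- at a fixed `X ≠ O` over `F = c·ℓ_φ` (`1 ≤ c < μ`): every `N{F, B, A, X}` and every `P{F, B, A, X}` with `B ≠ A`, from the lower `P`-rows. -/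
theorem floorSubapex_atX {h μ c : ℤ} {C : MConfig} (hU : C.InDiamond h) (hDN : ∀ Z ∈ C.lower, RuleDMu4N C Z)
    (hDP : ∀ P ∈ C.upper, RuleDMu4P C P) (hX : XPlusClosed C) (hA : A2IMinusClosed C) (hGl : PermClosed C.lower) (hGu : PermClosed C.upper)
    (hh : h = 2 * μ) {φ : Fin 4} (hc1 : 1 ≤ c) (hcμ : c < μ) (hRF : SubapexEscapeFree C h μ) {x : BPoint} (hx : x ≠ (0, 0, 0))
    (ih : ∀ B : BPoint, B ≠ (h - 2, 0, 0) →
      ∀ P ∈ C.upper, P 0 = floorLetter φ c → P 1 = B → P 2 = (h - 2, 0, 0) → P 3 ≠ (0, 0, 0) → (P 3).1 < x.1 → False) :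
    (∀ N ∈ C.lower, N 0 = floorLetter φ c → N 2 = (h - 2, 0, 0) → N 3 = x → False) ∧
    (∀ P ∈ C.upper, P 0 = floorLetter φ c → P 2 = (h - 2, 0, 0) → P 3 = x → P 1 ≠ (h - 2, 0, 0) → False) := by
  have hμ : 2 ≤ μ := by omega
  have rowsN' : ∀ N ∈ C.lower, N 0 = floorLetter φ c → N 2 = (h - 2, 0, 0) → N 3 = x → N 1 ≠ (h - 2, 0, 0) → False :=
    fun N hN h0 h2 h3 h1 => floorA_stepN hU hDN hDP hX hA hGl hGu hh hμ hc1 hcμ hx (ih (N 1) h1) hN h0 rfl h2 h3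
  have rowsN : ∀ N ∈ C.lower, N 0 = floorLetter φ c → N 2 = (h - 2, 0, 0) → N 3 = x → False := fun N hN h0 h2 h3 => by
    by_cases h1 : N 1 = (h - 2, 0, 0)
    · exact floorSubapex_fork hU hDN hDP hX hA hGl hGu hh hc1 hcμ hRF hx
        (fun X hXl hX0 hX2 hX3 hlt => rowsN' X hXl hX0 hX2 hX3 (fun e => by rw [e] at hlt; simp only at hlt; omega)) hN h0 h1 h2 h3
    · exact rowsN' N hN h0 h2 h3 h1
  refine ⟨rowsN, fun P hP h0 h2 h3 h1 => ?_⟩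
  obtain ⟨k, hk, hkh⟩ := exists_frame_ne_val (hU.2 P hP 1).1 (h - 2) h1
  obtain ⟨r, N, hN, hNP⟩ := servedAbove_subapex_pin hU hDN hDP hX hA hGl hGu hh (by omega) (by omega) (by omega) hP h0 h2
    (by rw [h3]; exact hx) (Or.inl rfl) hk hkh
  exact rowsN N hN ((hNP.1 0 (by decide)).symm.trans h0) ((hNP.1 2 (by decide)).symm.trans h2) ((hNP.1 3 (by decide)).symm.trans h3)

/-- the induction on the height of `X`, over a charged floor letter. -/
theorem floorSubapex_aux {h μ c : ℤ} {C : MConfig} (hU : C.InDiamond h) (hDN : ∀ Z ∈ C.lower, RuleDMu4N C Z)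
    (hDP : ∀ P ∈ C.upper, RuleDMu4P C P) (hX : XPlusClosed C) (hA : A2IMinusClosed C) (hGl : PermClosed C.lower) (hGu : PermClosed C.upper)
    (hh : h = 2 * μ) {φ : Fin 4} (hc1 : 1 ≤ c) (hcμ : c < μ) (hRF : SubapexEscapeFree C h μ) :
    ∀ t : ℕ, ∀ x : BPoint, x ≠ (0, 0, 0) → x.1 ≤ t →
      (∀ N ∈ C.lower, N 0 = floorLetter φ c → N 2 = (h - 2, 0, 0) → N 3 = x → False) ∧
      (∀ P ∈ C.upper, P 0 = floorLetter φ c → P 2 = (h - 2, 0, 0) → P 3 = x → P 1 ≠ (h - 2, 0, 0) → False) := by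
  intro t
  induction t with
  | zero =>
    intro x hx hxt
    exact floorSubapex_atX hU hDN hDP hX hA hGl hGu hh hc1 hcμ hRF hx fun B _ P hP _ _ _ _ hlt => by
      have := fst_nonneg_of_inDiamond (hU.2 P hP 3); push_cast at hxt; omega
  | succ t iht =>
    intro x hx hxt
    exact floorSubapex_atX hU hDN hDP hX hA hGl hGu hh hc1 hcμ hRF hx fun B hB P hP h0 h1 h2 h3 hlt =>
      (iht (P 3) h3 (by push_cast at hxt; omega)).2 P hP h0 h2 rfl (by rw [h1]; exact hB)

/-- **T12 (conditional), level `N`.** [◇_h, RULE D both levels, X⁺, A2I⁻, `S₄` both levels; `h = 2μ`; the raised-floor escape rows absent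
`SubapexEscapeFree`]  `N{c·ℓ_φ, B, A, X} ∉ C.lower` for `1 ≤ c ≤ μ − 1`, EVERY `B`, every `X ≠ O`. -/
theorem floorSubapexN_absent {h μ c : ℤ} {C : MConfig} (hU : C.InDiamond h) (hDN : ∀ Z ∈ C.lower, RuleDMu4N C Z)
    (hDP : ∀ P ∈ C.upper, RuleDMu4P C P) (hX : XPlusClosed C) (hA : A2IMinusClosed C) (hGl : PermClosed C.lower) (hGu : PermClosed C.upper)
    (hh : h = 2 * μ) (hRF : SubapexEscapeFree C h μ) (φ : Fin 4) (hc1 : 1 ≤ c) (hcμ : c < μ) {N : MCell}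
    (h0 : N 0 = floorLetter φ c) (h2 : N 2 = (h - 2, 0, 0)) (h3 : N 3 ≠ (0, 0, 0)) : N ∉ C.lower := fun hN =>
  (floorSubapex_aux hU hDN hDP hX hA hGl hGu hh hc1 hcμ hRF (N 3).1.toNat (N 3) h3 (Int.self_le_toNat _)).1 N hN h0 h2 rfl

/-- **T12 (conditional), level `P`.** [same]  `P{c·ℓ_φ, B, A, X} ∉ C.upper` for `1 ≤ c ≤ μ − 1`, every `X ≠ O` and every `B`, unless
`B = X = A` (`P{(μ−1)·ℓ, A, A, A}` is present in the census worlds). -/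
theorem floorSubapexP_absent {h μ c : ℤ} {C : MConfig} (hU : C.InDiamond h) (hDN : ∀ Z ∈ C.lower, RuleDMu4N C Z)
    (hDP : ∀ P ∈ C.upper, RuleDMu4P C P) (hX : XPlusClosed C) (hA : A2IMinusClosed C) (hGl : PermClosed C.lower) (hGu : PermClosed C.upper)
    (hh : h = 2 * μ) (hRF : SubapexEscapeFree C h μ) (φ : Fin 4) (hc1 : 1 ≤ c) (hcμ : c < μ) {P : MCell}
    (h0 : P 0 = floorLetter φ c) (h2 : P 2 = (h - 2, 0, 0)) (h3 : P 3 ≠ (0, 0, 0)) (hBX : P 1 ≠ (h - 2, 0, 0) ∨ P 3 ≠ (h - 2, 0, 0)) :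
    P ∉ C.upper := fun hP => by
  by_cases h3A : P 3 = (h - 2, 0, 0)
  · exact (floorSubapex_aux hU hDN hDP hX hA hGl hGu hh hc1 hcμ hRF (P 3).1.toNat (P 3) h3 (Int.self_le_toNat _)).2 P hP h0 h2 rfl
      (hBX.resolve_right (not_not.mpr h3A))
  · -- `X ∉ {O, A}`: the pseudo-pin raises `X`; the server is the row `N{F, B, A, X↑}`
    obtain ⟨k, hk, hkh⟩ := exists_frame_ne_val (hU.2 P hP 3).1 (h - 2) h3A
    obtain ⟨r, N, hN, hNP⟩ := servedAbove_subapex_pin hU hDN hDP hX hA hGl hGu hh (by omega) (by omega) (by omega) hP h0 h2 h3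
      (Or.inr rfl) hk hkh
    exact floorSubapexN_absent hU hDN hDP hX hA hGl hGu hh hRF φ hc1 hcμ ((hNP.1 0 (by decide)).symm.trans h0)
      ((hNP.1 2 (by decide)).symm.trans h2)
      (fun e => by have e' := hNP.2.1; rw [e] at e'; have := fst_nonneg_of_inDiamond (hU.2 P hP 3); simp only at e'; omega) hN

/-! ## §9 SERVER LEMMAS FOR THE FLOOR-FREE ROWS (control g24): THE CEILING-UNIT COUSIN EXCLUSION AND THE GENERAL OWN-RAY A2I⁻ INTERFACE

The raised-floor escape rows `N{F′, σ_d(w), cu_r ∕ hI, X}` of §8 (`SubapexEscapeFree`) die in the census (j318002 peel, ◇₈ rounds 2 – 13) by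
SHORT chains of three kinds (memo XFORK-SERVER-g24.md §2, `tools/pshape.py` over the 2 228 untyped ◇₈ rows): a direct RULE-D pair; ONE own-ray
A2I⁻ step (the head's interior letter `aI + c·ℓ_u` lowered along its own ray by `d ≤ c` to the partner `q`, the partner's second slot raised to
the server `N′`, all escapes typed); or a climb to the apex `hI` that ends in an X⁺ fork between two COUSINS `P{x, y, cu_a, hI}`, `P{x, y, cu_b, hI}`.
The X⁺ half of this IS g19's second-child theorem (`xplus_unit_fork` ∕ `apexCeilingUnit_absent_of_secondChild`, FloorPinTower §0 —
the census tag `secondChildG` covers only its `Δ`-closed sub-families); (9b) re-exports it in the two-present-cells form the rows use and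
GENERALISES it to an arbitrary free slot; the A2I⁻ half (9c) is new — FloorPinTower has only the origin ∕ floor A2I⁻ interfaces (`a = 0`, `d = c`).
(9a) apex geometry: `hI = (h, 0, 0)` is causally above every diamond point and nothing in the diamond is strictly null-above it.
(9b) `ceilingUnit_cousinsP_absent` [= g19 second-child]: two present `P`-cells agreeing off one slot `g`, with ceiling units of DIFFERENT
phases at `g` and the apex at another slot `f`, are contradictory; `ceilingUnit_cousinsP_esc` [new]: the same with `P₁ f` ARBITRARY and some
other slot on the ceiling — the three free-slot X⁺ escapes (an (H-b) breaker, an (r1) leg above `f`, an (r2a) cover through `f`: `N`-cells whose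
`f`-letter is strictly null-above `P₁ f`) handed back as hypotheses (`lift_of_ceilingUnit` + `xplus_fork_esc` of §7; (H-e′) holds under `hI`
by `effective_apex_bsub`, the topmost and companion sets are empty one step below the apex).  A TWO-CELL EXCLUSION is invisible to the
single-orbit peel: all four `P{y_2(−1), cu_a, hI, hI}` are ◇₈ survivors although (9b) excludes any two of them jointly — census-CONSISTENT
(the survivor set over-approximates every model; it is not a model), not census-testable.
(9c) `a2i_ownray_esc`: the A2I⁻ clause at a head `Z ∈ E₋` whose `σ`-letter `aI + c·ℓ_u` (`a ≥ 0`, `c ≥ 1`) is lowered along its OWN ray by `d`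
(`1 ≤ d ≤ c`: the encoder direction and the guard `d ≤ cabs` hold automatically) to a present partner `q`, with a present server
`N′ = q + e·n_v^{(f)}`, `f ≠ σ`: one of the five escape species is present — handed back as hypotheses to refute, exactly as `xplus_fork_esc`
hands back the X⁺ escapes.  `a2i_origin_interface` ∕ `a2i_origin_floor_interface` are its instances `a = 0`, `d = c`. -/

/-! ### §9a the apex is causally above the diamond -/

/-- every diamond point lies in the closed backward cone of the apex `hI`. -/
theorem effective_apex_bsub {h : ℤ} {y : BPoint} (hy : InDiamond h y) : Effective (bsub (h, 0, 0) y) := by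
  obtain ⟨α, a, b⟩ := y
  obtain ⟨hax, h1, -, h3⟩ := hy
  simp only [AxisPt, absCharge, chargeOf, Prod.mk.injEq] at hax h1 h3
  have key : a ^ 2 + b ^ 2 ≤ (h - α) ^ 2 ∧ α ≤ h := by
    rcases hax with ⟨rfl, rfl⟩ | ⟨-, rfl⟩ | ⟨rfl, -⟩
    · simp only [sub_self, abs_zero] at h1 h3; constructor <;> nlinarith
    · simp only [sub_zero] at h1 h3
      obtain ⟨l, r⟩ := abs_le.mp (show |a| ≤ h - α by have := abs_nonneg a; omega)
      exact ⟨by nlinarith [mul_nonneg (sub_nonneg.mpr r) (show (0:ℤ) ≤ h - α + a by linarith)], by have := abs_nonneg a; omega⟩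
    · simp only [zero_sub, abs_neg] at h1 h3
      obtain ⟨l, r⟩ := abs_le.mp (show |b| ≤ h - α by have := abs_nonneg b; omega)
      exact ⟨by nlinarith [mul_nonneg (sub_nonneg.mpr r) (show (0:ℤ) ≤ h - α + b by linarith)], by have := abs_nonneg b; omega⟩
  simp only [Effective, bsub, zero_sub, even_two, Even.neg_pow, sub_nonneg]
  exact ⟨key.2, key.1⟩

/-- nothing in the diamond is strictly null-above the apex. -/
theorem not_nullBelow_apex {h : ℤ} {y : BPoint} (hy : InDiamond h y) : ¬ NullBelow (h, 0, 0) y := fun hn => by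
  have h1 : h < y.1 := hn.1
  have h3 := hy.2.2.2
  have h0 : (0 : ℤ) ≤ absCharge y := abs_nonneg _
  omega

/-! ### §9b the ceiling-unit cousin exclusion (g19's second-child theorem) and its general-free-slot form -/

/-- **CEILING-UNIT COUSINS ARE EXCLUSIVE** = g19's SECOND-CHILD THEOREM (`apexCeilingUnit_absent_of_secondChild` ∕ `xplus_unit_fork`,
`CeilingUnitApex.lean` §1, restated in FloorPinTower §0) in TWO-PRESENT-CELLS form [◇_h, RULE D at `P`, X⁺] — NOT new, re-exported here under
the name the §8 – §9 rows use: if `P₁, P₂ ∈ E₊` agree off the slot `g`, `P₁ g = cu_a`, `P₂ g = cu_b` with `a ≠ b`, and `P₁ f = hI` at another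
slot `f`, then `False` (RULE D lifts `cu_a` to the apex; the X⁺ fork at the lifted `N`-cell between `P₁`, `P₂` has free slot `f` = `hI`). -/
theorem ceilingUnit_cousinsP_absent {h : ℤ} {C : MConfig} (hU : C.InDiamond h) (hDP : ∀ P ∈ C.upper, RuleDMu4P C P) (hX : XPlusClosed C)
    {P₁ P₂ : MCell} (hP₁ : P₁ ∈ C.upper) (hP₂ : P₂ ∈ C.upper) {g f : Fin 4} (hfg : f ≠ g) (hag : MAgree P₂ P₁ g)
    (hf : P₁ f = (h, 0, 0)) {a b : Fin 4} (hab : a ≠ b) (h1 : P₁ g = ceilingUnit h a) (h2 : P₂ g = ceilingUnit h b) : False :=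
  apexCeilingUnit_absent_of_secondChild hU hDP hX hfg (Ne.symm hab) h1 hf (fun _ => hP₂) hag h2 hP₁

/-- the same with the apex slot read off `P₂` and the agreement stated the other way (convenience). -/
theorem ceilingUnit_cousinsP_absent' {h : ℤ} {C : MConfig} (hU : C.InDiamond h) (hDP : ∀ P ∈ C.upper, RuleDMu4P C P) (hX : XPlusClosed C)
    {P₁ P₂ : MCell} (hP₁ : P₁ ∈ C.upper) (hP₂ : P₂ ∈ C.upper) {g f : Fin 4} (hfg : f ≠ g) (hag : MAgree P₁ P₂ g)
    (hf : P₁ f = (h, 0, 0)) {a b : Fin 4} (hab : a ≠ b) (h1 : P₁ g = ceilingUnit h a) (h2 : P₂ g = ceilingUnit h b) : False :=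
  ceilingUnit_cousinsP_absent hU hDP hX hP₁ hP₂ hfg (fun j hj => (hag j hj).symm) hf hab h1 h2

/-- **the cousin fork with a GENERAL free slot** `f ≠ g` (new: g19's theorem is the case `P₁ f = hI`, where all three escapes are vacuous by
`not_nullBelow_apex`): as `ceilingUnit_cousinsP_absent`, but `P₁ f` arbitrary (the lift needs SOME other slot `c ≠ g` on the ceiling); the three free-slot escape
species of the X⁺ clause — an (H-b) breaker, an (r1) leg of `P₁` above `f`, an (r2a) cover of `P₁` through `f` — are handed back as hypotheses
(each is an `N`-cell agreeing with `P₁` off `f` (and one more slot) whose `f`-letter is STRICTLY NULL-ABOVE `P₁ f`). -/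
theorem ceilingUnit_cousinsP_esc {h : ℤ} {C : MConfig} (hU : C.InDiamond h) (hDP : ∀ P ∈ C.upper, RuleDMu4P C P) (hX : XPlusClosed C)
    {P₁ P₂ : MCell} (hP₁ : P₁ ∈ C.upper) (hP₂ : P₂ ∈ C.upper) {g f c : Fin 4} (hfg : f ≠ g) (hcg : c ≠ g) (hag : MAgree P₂ P₁ g)
    (hc : OnCeiling h (P₁ c)) {a b : Fin 4} (hab : a ≠ b) (h1 : P₁ g = ceilingUnit h a) (h2 : P₂ g = ceilingUnit h b)
    (hHb : ∀ X ∈ C.lower, MAgree2 X P₁ g f → NullBelow (P₁ f) (X f) → False)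
    (hW1 : ∀ X ∈ C.lower, MAgree X P₁ f → NullBelow (P₁ f) (X f) → False)
    (hW2 : ∀ X ∈ C.lower, ∀ g' : Fin 4, g' ≠ f → MAgree2 X P₁ f g' → NullBelow (P₁ f) (X f) → NullBelow (P₁ g') (X g') → False) :
    False := by
  obtain ⟨N, hN, hNP, hNg⟩ := lift_of_ceilingUnit hU hP₁ (hDP P₁ hP₁) hcg hc h1
  have hb1 : (P₂ g).1 = h - 1 := by rw [h2, ceilingUnit_fst]
  refine xplus_fork_esc hX hN hfg hP₁ hP₂ (r₁ := a + 2) (r₂ := b + 2) (fun e => hab (add_right_cancel e).symm) hNP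
    ⟨fun j hj => (hag j hj).trans (hNP.1 j hj), by rw [hb1, hNg]; omega, ?_⟩ (by rw [h1]; exact ceilingUnit_not_isApex h a)
    ?_ ?_ (fun X hX' _ _ _ _ => by rw [hNg]; exact effective_apex_bsub (hU.1 X hX' g)) hHb hW1 hW2
  · rw [hNg, hb1, h2, show h - (h - 1) = 1 by ring]; exact ceilingApex_eq_ray_ceilingUnit h b
  · intro X hX' hXP
    have hlt : (ceilingUnit h a).1 < (X g).1 := by rw [← h1]; exact hXP.2.1
    have e : X g = ray (ceilingUnit h a) (a + 2) ((X g).1 - (P₁ g).1) := by rw [← h1]; exact hXP.2.2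
    rw [(above_ceilingUnit (hU.1 X hX' g) (by rw [h1]; rw [ceilingUnit_fst] at hlt ⊢; omega) e).2, hNg]
  · intro X _ _ hlt1 hlt2 _
    rw [hNg] at hlt1; rw [hb1] at hlt2
    have : (X g).1 < h := hlt1
    omega

/-! ### §9c the general own-ray A2I⁻ interface -/

/-- the absolute charge of the letter `aI + c·ℓ_u`, `c ≥ 0`. -/
theorem cabs_ray_apex (a : ℤ) (u : Fin 4) {c : ℤ} (hc : 0 ≤ c) : cabs (ray ((a, 0, 0) : BPoint) u c) = c := by
  fin_cases u <;> simp [cabs, ray, abs_of_nonneg hc, hc]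

/-- a charged letter `aI + c·ℓ_u` (`c ≠ 0`) is not an apex. -/
theorem ray_apex_not_isApex (a : ℤ) (u : Fin 4) {c : ℤ} (hc : c ≠ 0) : ¬ isApex (ray ((a, 0, 0) : BPoint) u c) := by
  fin_cases u <;> simp [isApex, ray, hc]

/-- the own ray is the encoder direction of `aI + c·ℓ_u` (`a ≥ 0`, `c ≥ 0`). -/
theorem encDir_ray_apex {a c : ℤ} (ha : 0 ≤ a) (hc : 0 ≤ c) (u : Fin 4) : EncDir (ray ((a, 0, 0) : BPoint) u c) u := by
  refine Or.inl ⟨by rw [ray_fst]; omega, ?_⟩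
  rw [cabs_ray_apex a u hc, ray_fst, add_sub_cancel_right]

/-- **THE OWN-RAY A2I⁻ INTERFACE** [A2I⁻ only]: head `Z ∈ E₋` with `Z σ = aI + c·ℓ_u` (`a ≥ 0`, `c ≥ 1`); present partner `q = Z(σ ↦ aI + (c−d)·ℓ_u)`,
`1 ≤ d ≤ c`; present server `N′` of `q` above the slot `f ≠ σ` along `v`.  Then one escape is present; stated contrapositively with the five escape
species as hypotheses to refute: (E1) a partner of `Z` on `σ` in a direction `≠ u`; (E2) a `u`-partner of `Z` on `σ` strictly above `q`; (E3) a
`P`-cell on the `u`-line strictly below `q`; (E4) a below-partner of `Z` on `f` (leg, or (r2a) cover through `f`) NOT along `v`; (E5) a polluter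
`P` agreeing with `Z` off `{σ, f}`, `σ`-letter on the `u`-line at or below `q σ`, `f`-letter `v`-lifted by `1 … e` (3b) or spacelike-lifted (3d). -/
theorem a2i_ownray_esc {C : MConfig} (hA : A2IMinusClosed C) {Z q N' : MCell} (hZ : Z ∈ C.lower) (hq : q ∈ C.upper) (hN' : N' ∈ C.lower)
    {σ f u v : Fin 4} (hfσ : f ≠ σ) {a c d : ℤ} (ha : 0 ≤ a) (hc : 1 ≤ c) (hd1 : 1 ≤ d) (hdc : d ≤ c)
    (hZσ : Z σ = ray (a, 0, 0) u c) (hqZ : MAgree q Z σ) (hqσ : q σ = ray (a, 0, 0) u (c - d)) (hN'q : UPartner N' q f v)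
    (E1 : ∀ P ∈ C.upper, ∀ w : Fin 4, w ≠ u → ¬ UPartner Z P σ w)
    (E2 : ∀ P ∈ C.upper, UPartner Z P σ u → (P σ).1 ≤ (q σ).1)
    (E3 : ∀ P ∈ C.upper, ¬ UPartner q P σ u)
    (E4 : ∀ P ∈ C.upper, NullBelow (P f) (Z f) →
      (MAgree P Z f ∨ ∃ g : Fin 4, g ≠ f ∧ MAgree2 P Z f g ∧ NullBelow (P g) (Z g)) → Z f = ray (P f) v ((Z f).1 - (P f).1))
    (E5 : ∀ P ∈ C.upper, (∀ g, g ≠ σ → g ≠ f → P g = Z g) → OnULineBelowEq (P σ) (q σ) u →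
      ¬ ((Z f).1 < (P f).1 ∧ (P f).1 ≤ (N' f).1 ∧ P f = ray (Z f) v ((P f).1 - (Z f).1)) ∧
        ¬ (Effective (bsub (N' f) (P f)) ∧ Spacelike (bsub (P f) (Z f)))) : False := by
  have hZ1 : (Z σ).1 = a + c := by rw [hZσ, ray_fst]
  have hq1 : (q σ).1 = a + (c - d) := by rw [hqσ, ray_fst]
  refine hA Z hZ q hq N' hN' σ u f v ⟨by rw [hZσ]; exact ray_apex_not_isApex a u (by omega), by rw [hZσ]; exact encDir_ray_apex ha (by omega) u,
    ⟨hqZ, by rw [hZ1, hq1]; omega, ?_⟩, fun _ => by rw [hZ1, hq1, hZσ, cabs_ray_apex a u (by omega)]; omega, hfσ, hN'q, E1, E2, E3, E4, E5⟩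
  rw [hZ1, hq1, hqσ, hZσ, show a + c - (a + (c - d)) = d by ring, ← ray_add, show c - d + d = c by ring]

/-- **the own-ray A2I⁻ interface, existential form**: under (E1) – (E3) (no other partner geometry on `σ`), the presence of `Z`, `q`, `N′` yields a
present `P`-cell that is either an off-`v` below-partner of `Z` on `f` (species E4) or a polluter (species E5). -/
theorem a2i_ownray_witness {C : MConfig} (hA : A2IMinusClosed C) {Z q N' : MCell} (hZ : Z ∈ C.lower) (hq : q ∈ C.upper) (hN' : N' ∈ C.lower)
    {σ f u v : Fin 4} (hfσ : f ≠ σ) {a c d : ℤ} (ha : 0 ≤ a) (hc : 1 ≤ c) (hd1 : 1 ≤ d) (hdc : d ≤ c)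
    (hZσ : Z σ = ray (a, 0, 0) u c) (hqZ : MAgree q Z σ) (hqσ : q σ = ray (a, 0, 0) u (c - d)) (hN'q : UPartner N' q f v)
    (E1 : ∀ P ∈ C.upper, ∀ w : Fin 4, w ≠ u → ¬ UPartner Z P σ w)
    (E2 : ∀ P ∈ C.upper, UPartner Z P σ u → (P σ).1 ≤ (q σ).1)
    (E3 : ∀ P ∈ C.upper, ¬ UPartner q P σ u) :
    ∃ P ∈ C.upper, (NullBelow (P f) (Z f) ∧ (MAgree P Z f ∨ ∃ g : Fin 4, g ≠ f ∧ MAgree2 P Z f g ∧ NullBelow (P g) (Z g)) ∧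
        Z f ≠ ray (P f) v ((Z f).1 - (P f).1)) ∨
      ((∀ g, g ≠ σ → g ≠ f → P g = Z g) ∧ OnULineBelowEq (P σ) (q σ) u ∧
        (((Z f).1 < (P f).1 ∧ (P f).1 ≤ (N' f).1 ∧ P f = ray (Z f) v ((P f).1 - (Z f).1)) ∨
          (Effective (bsub (N' f) (P f)) ∧ Spacelike (bsub (P f) (Z f))))) := by
  by_contra hno
  refine a2i_ownray_esc hA hZ hq hN' hfσ ha hc hd1 hdc hZσ hqZ hqσ hN'q E1 E2 E3 (fun P hP hn hag => ?_) (fun P hP hag hul => ?_)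
  · by_contra hne; exact hno ⟨P, hP, Or.inl ⟨hn, hag, hne⟩⟩
  · exact ⟨fun h3b => hno ⟨P, hP, Or.inr ⟨hag, hul, Or.inl h3b⟩⟩, fun h3d => hno ⟨P, hP, Or.inr ⟨hag, hul, Or.inr h3d⟩⟩⟩

end Summit.HodgeConjecture.HodgeConjecture.Cruxes.BlochSeedDiscOne.XForkServer
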